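/-
Copyright: lit-balaban Phase-2 proof seat p30 (gen 25).  Statement-level skeleton of a published paper; no proof claims beyond what the
kernel checks below.
-/
import Literature.MathematicalPhysics.QuantumFieldTheory.BalabanImbrieJaffe1984to88.BIJ85ScalarPropagatorSupDecay
import Literature.MathematicalPhysics.QuantumFieldTheory.BalabanImbrieJaffe1984to88.BIJ85FlatPropagatorKernelDiffs
import Literature.MathematicalPhysics.QuantumFieldTheory.BalabanImbrieJaffe1984to88.BIJ88Smooth43Axial
import Literature.MathematicalPhysics.QuantumFieldTheory.BalabanImbrieJaffe1984to88.BIJ85CentredAxialGauge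

/-!
# [BalabanImbrieJaffe1985] §7.3 p. 326 / [Balaban1983RegularityDecay] (1.10) — **the COVARIANT-DERIVATIVE member of the sup-norm decay of the
# block propagator `G_k(u)` at small non-flat `U(1)` fields, `k`-uniform**: `|(D_uG_k(T,u)f)(b)| ≤ c₀(L^kε)e^{−t₀ dist(b, supp f)/L^k}‖f‖_∞`

T. Bałaban, J. Imbrie, A. Jaffe, *Renormalization of the Higgs model: minimizers, propagators and the stability of mean field theory*,
Commun. Math. Phys. **97** (1985) 299–329 [BalabanImbrieJaffe1985], §7.3 p. 326 [PDF 28], (4.6.2)–(4.6.3) p. 313, (2.6)–(2.7) p. 303;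
[7] of that paper = T. Bałaban, *Regularity and decay of lattice Green's functions*, Commun. Math. Phys. **89** (1983) 571–597
[Balaban1983RegularityDecay], (1.10) p. 573.

statement-level skeleton of published theorems with citation tags; proofs where landed; nothing here is a claim about the Yang–Mills mass gap

CITATION HEADER (lean-in-tree rule).  Part of the lit-balaban TYPED SKELETON (HOME `run/shared/lean/pub/lit-balaban/`), PHASE-2 proof seat
p30 gen 25 (unit `lit-balaban-p30-g25`; TAKING line HOME/STATUS.md 2026-08-22T22:31:47Z; free-target protocol G.5-34(d) — the residual of
item 3 of the owner's `HOME/lit-balaban-r15/C1-CLOSURE.md` §5 (owner r15, referee ref-5): *"Still free here (M/L): the D_u-derivative …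
members at small non-flat u"*, = p27 g32's declared natural extension of `BIJ85ScalarPropagatorSupDecay` (HONEST SCOPE there: *"The VALUE
member of (1.10) only: no covariant-derivative member"*)).  WHAT THIS FILE IS: kernel file 3 of 3 (after `BIJ85FlatPropagatorKernelDiffs`,
the flat kernel envelopes, and `BIJ85CentredAxialGauge`, the centre-rooted axial gauge) — the MEMBER ITSELF: row **C1.Eq7.3.1-7.3.2** of
`HOME/lit-balaban-r15/ROWS-C1.md`, a LOCATED MEMBER (no head effect): the derivative half of [7] (1.10) for the torus propagator of record.
Kind «model-level theorems» with private plumbing definitions (the cutoff); no `Prop`-valued fact introduced.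

THE PRINTED TEXT (verbatim).  [BalabanImbrieJaffe1985] p. 326 [PDF 28]: *"The propagators arising from Δ_k(u_k), under the restriction
(7.3.1) on the gauge field, also satisfy the regularity and decay estimates of [7]. In order to remain within the framework of this reference,
we remark that by change of gauge u_k can be transformed in a local region Λ into a configuration of the form exp[ie_kηA], where A is smooth
and small."*  [7] (1.10) p. 573 (as transcribed in the tree's `Balaban1983to89.B4Thm110ZeroTorus`): *"|(D^η_{A,μ}G_k(Ω, A)f)(x)|,
|(G_k(Ω, A)f)(x)| ≤ c₀exp(−δ₀ dist(x, supp f))‖f‖_∞ (1.10)"*.  (4.6.2)–(4.6.3) p. 313: *"G_k(u_k) = [−Δ_{u_k} + a_kQ_k^*(u_k)Q_k(u_k)]^{−1},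
(4.6.2) where −Δ_{u_k} = D^*_{u_k}D_{u_k}. (4.6.3)"*.

THE OBJECT.  `G_k(T,u) = BIJ88NeumannPropagator227Torus.gBox (α_kL^{kd}) ε⁻¹ U k univ` (p31), the inverse on `ℓ²(T^{(0)})` of
`N(u) = D_u^*D_u + α_kL^{kd}Q_k(u)^*Q_k(u)` (`nOp`; `D_u = covD ε⁻¹ (cfg U)`, `(D_uφ)(b) = ε⁻¹(u_bφ(b₊) − φ(b₋))`), exactly the object and the
hypotheses of p27's VALUE member `BIJ85ScalarPropagatorSupDecay.decay110_smallField` (`|u(∂p) − 1| ≤ θ` everywhere, `2d³(L^{2k}θ)² ≤ 1`).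

THE MECHANISM (ours — DIVERGENCE OF METHOD from the printed route, disclosed as in p27's file: the print defers to an extension of [7]'s
random-walk expansion after a local change of gauge; here a perturbative INTERIOR GRADIENT ESTIMATE around each bond).  Fix a bond
`b₀ = ⟨y₀, y₀+e_{μ₀}⟩` and `r ≍ cL^k`.  (i) GAUGE: in the centre-rooted axial gauge `h` of `BIJ85CentredAxialGauge` (p. 326 *"change of gauge … in
a local region"*), `u′ = u^h` has `|u′_{z,μ} − 1| ≤ (d−1)|z − y₀|_∞θ` on the ball of radius `2r` and `u′_{b₀} = 1`; `ψ = hφ` solves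
`N(u′)ψ = hf` ((2.7), `gauge_transfer`) and covariant differences are gauge covariant in norm.  (ii) LOCALISATION: with the product-tent cutoff
`χ` (`≡ 1` on `B_r(y₀)`, `0` off `B_{2r}`, `|∇χ| ≤ 1/r`, `∇∇χ` on two kink slabs) and the FLAT propagator `G♭ = N(1)⁻¹` (= pv07's tower inverse,
p31 `gBox_flat_eq_tower`): `ψ(y₀+e_{μ₀}) − ψ(y₀) = Σ_z K(z)(N♭χψ)(z)`, `K(z) = G♭(y₀+e_{μ₀},z) − G♭(y₀,z)`, and
`N♭(χψ) = χ·hf − χ(N(u′) − N♭)ψ + [N♭,χ]ψ` (`loc_representation`).  (iii) BOUNDS: the kernel envelopes `|K| ≤ Cε²/max(|y₀−z|,1)^{d−1}`,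
`|∇K| ≤ Cε²/max(|y₀−z|,1)^d` of `BIJ85FlatPropagatorKernelDiffs`; the gauge term `(N(u′) − N♭)ψ` rewritten bond by bond through the exact
identity `(1−u)K̃(b₋)ψ(b₊) + (1−ū)K̃(b₊)ψ(b₋) = (ū−1)K̃(b₋)(uψ(b₊) − ψ(b₋)) + (1−ū)(K̃(b₊) − K̃(b₋))ψ(b₋)` (first-order structure: one
covariant difference or one kernel gradient per bond); the commutator transposed onto `K` (summation by parts onto `∇χ`, `∇∇χ`); the block
terms `Q^*Q` swapped onto the kernel envelope without cancellations.  Result (`local_gradient_bound`):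
`|ψ(y₀+e_{μ₀}) − ψ(y₀)| ≤ C(Fε²r + γr²M + γrS + S/r + α_kε²(r + L^k)S)` with the local sup `S` of `ψ`, the local sup `M` of covariant
differences, the local sup `F` of `f`, `γ = (d−1)θ`.  (iv) ABSORPTION: with p27's value bound `S ≲ (L^kε)²e^{−t dist/L^k}‖f‖_∞` and the weighted
maximum `M* = max_b e^{t dist(b₋, supp f)/L^k}|u_bφ(b₊) − φ(b₋)|` over the finite torus, `(d−1)θL^{2k} ≤ 1` gives `γr² ≤ c²`, the
coefficient of `M*` is `≤ 1/2` for the ball fraction `c = c(d,L,a)`, hence `M* ≲ L^kε²‖f‖_∞`; bonds with `cL^k < 4` are covered by the value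
bound directly.

WHAT IS PROVED (0 `sorry`; standard axioms; private plumbing: the tents `tentN/tentZ/tentC`, the cutoff `chi`, `ball`, `slab`, counting and
radial-profile lemmas, the algebraic identities and the four term bounds).
* §4 `cfg_one`, `nOp_flat_transpose` (the flat operator is real symmetric), `nOp_flat_mulVec_apply`, `nOp_sub_flat_mulVec_apply`
  (`((N(u) − N♭)ψ)(z) = ε^{−2}Σ_μ((1−u_{z,μ})ψ(z+e_μ) + (1−ū_{z−e_μ,μ})ψ(z−e_μ)) + a′((Q_uᴴQ_uψ)(z) − (Q_1ᴴQ_1ψ)(z))`), `commutator_flat_apply`.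
* §5 `towerQQ_apply_blockK`, `LinvPow_mul_card_blockK`, `aQQ_norm_le` (`a′‖(Q_uᴴQ_uφ)(z)‖ ≤ α_k sup_{B^k(z)}‖φ‖`), `sum_towerQQ_le`,
  `supDist_le_of_blkIter_eq'`.
* §6 **`loc_representation`** (the identity of (ii)); **`local_gradient_bound`**: for `d ≥ 1` and `C_K ≥ 0` there is `C > 0` such that for every
  volume `P` (`P.d = d`), `a > 0`, `1 ≤ k ≤ K`, `r ≥ 4` with `4r + 6 ≤ sitesPerDir 0`, every bond `⟨y₀, μ₀⟩`, field `u`, `ψ, f′` with `N(u)ψ = f′`,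
  kernel envelopes with constant `C_K`, `|u_{z,μ} − 1| ≤ γ|y₀ − z|_∞` (`|y₀−z|_∞ ≤ 2r`), `‖ψ‖ ≤ S` (`≤ 2r + L^k + 1`), `‖u_bψ(b₊) − ψ(b₋)‖ ≤ M`
  and `‖f′‖ ≤ F` (`≤ 2r`): `‖ψ(y₀+e_{μ₀}) − ψ(y₀)‖ ≤ C(Fε²r + γr²M + γrS + S/r + α_kε²(r + L^k)S)`.
* §7 `gauge_transfer`, `cfg_gaugeAct_apply`, `norm_covDiff_gaugeAct`, `dist1_plaqHol_le_of_plaqC`, `two_mul_pow_le_sitesPerDir`,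
  `gamma_nsq_le_one`; **`decay110_smallField_deriv`**: for `2 ≤ d ≤ 3`, `L` odd `> 1`, `a > 0`: `∃ t₀ c₀ > 0` such that for every volume `P`
  (`P.d = d`, `P.L = L`), every `1 ≤ k ≤ K`, every `U : GaugeField P 0 U1` and `θ` with `‖u(∂p) − 1‖ ≤ θ` at every plaquette and
  `2d³((L^k)²θ)² ≤ 1`, every bond `⟨x, μ⟩`, every `f` with `‖f‖ ≤ F` and `f(z) ≠ 0 → D ≤ |x−z|_∞`:
  `‖(D_uG_k(T,u)f)(⟨x, μ⟩)‖ ≤ c₀(L^kε)e^{−t₀D/L^k}F`; **`decay110_smallField_deriv_T`** (p31's (1.10) shape, `c₀e^{−δ₀εD}F`);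
  **`decay110_smallField_deriv_kernel`** (`ε⁻¹|u_{x,μ}G_k(x+e_μ,y) − G_k(x,y)| ≤ c₀(L^kε)e^{−t₀|x−y|_∞/L^k}`).

HONEST SCOPE.  `2 ≤ d ≤ 3` (the value member needs `d ≤ 3`, the kernel envelopes `d ≥ 2`); the WHOLE torus `Ω = T` only (no Neumann
sub-domains); `U(1)` fields (the cell's `U1`); the smallness hypothesis is p27/p33's block-scale plaquette condition `2d³(L^{2k}θ)² ≤ 1`, not
(7.3.1) itself (that (7.3.1) at small `e_k` implies it for the background of record is p33's `BIJ85Claim73PropagatorDecay`, not restated);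
rate `t₀` and constant `c₀` ours (existential, depending on `d, L, a` only), distance in the block scale `L^k` (lattice units) as in p27's file;
no Hölder member (1.9), no `L²` statements.  DIVERGENCE OF METHOD as stated.  Nothing here is summit progress, continuum or Clay.  Unit
`lit-balaban-p30` (literature-prover-lit-balaban-p30-g25-0), HOME `run/shared/lean/pub/lit-balaban/`, 2026-08-23.
-/

open scoped BigOperators ComplexConjugate
open Finset Matrix

namespace Literature.MathematicalPhysics.QuantumFieldTheory.BalabanImbrieJaffe1984to88.BIJ85ScalarPropagatorSupDecayDeriv

open Literature.MathematicalPhysics.QuantumFieldTheory.Balaban1983to89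
open LatticeFieldCalculus (supDist)
open B3TorusRadialSums (cdist cdist_le_supDist supDist_comm supDist_eq_sup_cdist supDist_eq_zero_iff shell card_shell_le
  card_cdist_le_le card_cdist_eq_le cdist_neg cdist_le_val)
open BIJ85Ineq722Torus (supDist_triangle)
open BIJ88Sect3Statements (U1 toC cfg covD norm_toC toC_one)
open BIJ88NeumannPropagator227Torus (nOp gBox dN qMatK nOp_eq gBox_univ_mul nOp_conjTranspose conj_mul_toC)
open BIJ88NeumannPropagatorFlatDecay (nOp_flat_eq_tower gBox_flat_eq_tower)
open BIJ85ScalarPropagatorSupDecay (gram_dN_mulVec_apply norm_gram_qMatK_mulVec_le)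

noncomputable section

/-! ## §1 The tent on `ℕ`, on `ℤ`, and around the circle `ZMod N` -/

section Tent

/-- The tent of flat radius `r` and support `2r` on the distance `t ∈ ℕ`: `1` for `t ≤ r`, `(2r − t)/r` for `r ≤ t ≤ 2r`, `0` beyond.
[folklore] -/
private def tentN (r t : ℕ) : ℝ := if t ≤ r then 1 else if t ≤ 2 * r then ((2 * r - t : ℕ) : ℝ) / r else 0

variable {r : ℕ}

/-- kernel: `0 ≤ tent ≤ 1`. [folklore] -/
private theorem tentN_nonneg (r t : ℕ) : 0 ≤ tentN r t := by
  unfold tentN; split_ifs <;> positivity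

/-- kernel: `tent ≤ 1`. [folklore] -/
private theorem tentN_le_one (hr : 1 ≤ r) (t : ℕ) : tentN r t ≤ 1 := by
  unfold tentN
  split_ifs with h1 h2
  · exact le_rfl
  · rw [div_le_one (by exact_mod_cast hr)]
    have : 2 * r - t ≤ r := by omega
    exact_mod_cast this
  · exact zero_le_one

/-- kernel: the flat top. [folklore] -/
private theorem tentN_of_le {t : ℕ} (ht : t ≤ r) : tentN r t = 1 := by
  unfold tentN; rw [if_pos ht]

/-- kernel: outside the support. [folklore] -/
private theorem tentN_of_ge (hr : 1 ≤ r) {t : ℕ} (ht : 2 * r ≤ t) : tentN r t = 0 := by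
  unfold tentN
  split_ifs with h1 h2
  · omega
  · have : 2 * r - t = 0 := by omega
    rw [this]; simp
  · rfl

/-- kernel: the slope region formula, valid on the CLOSED interval `[r, 2r]`. [folklore] -/
private theorem tentN_of_mem {t : ℕ} (hr : 1 ≤ r) (h1 : r ≤ t) (h2 : t ≤ 2 * r) : tentN r t = ((2 * r - t : ℕ) : ℝ) / r := by
  unfold tentN
  split_ifs with h3
  · have : t = r := le_antisymm h3 h1
    subst this
    rw [show 2 * t - t = t by omega, div_self]
    exact_mod_cast (show (t : ℝ) ≠ 0 by exact_mod_cast (by omega : t ≠ 0))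
  · rfl

/-- kernel: **the tent is `1/r`-Lipschitz** under unit steps of the distance. [folklore] -/
private theorem abs_tentN_succ_sub_le (hr : 1 ≤ r) (t : ℕ) : |tentN r (t + 1) - tentN r t| ≤ 1 / r := by
  have hr0 : (0 : ℝ) < r := by exact_mod_cast hr
  have hr' : (0 : ℝ) ≤ 1 / r := by positivity
  rcases lt_or_ge t r with h | h
  · -- both on the flat top
    rw [tentN_of_le h.le, tentN_of_le (by omega), sub_self, abs_zero]; exact hr'
  rcases lt_or_ge t (2 * r) with h' | h'
  · -- both in the closed slope region
    rw [tentN_of_mem hr h h'.le, tentN_of_mem hr (by omega) (by omega)]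
    rw [← sub_div, abs_div, abs_of_pos hr0, div_le_div_iff_of_pos_right hr0]
    have : ((2 * r - (t + 1) : ℕ) : ℝ) - ((2 * r - t : ℕ) : ℝ) = -1 := by
      have e : 2 * r - t = (2 * r - (t + 1)) + 1 := by omega
      rw [e]; push_cast; ring
    rw [this]; simp
  · rw [tentN_of_ge hr h', tentN_of_ge hr (by omega), sub_self, abs_zero]; exact hr'

/-- kernel: **the second difference of the tent vanishes off the two kinks** `t = r`, `t = 2r` (`t ≥ 1`). [folklore] -/
private theorem tentN_second_diff_eq_zero (hr : 1 ≤ r) {t : ℕ} (ht : 1 ≤ t) (h1 : t ≠ r) (h2 : t ≠ 2 * r) :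
    tentN r (t + 1) - 2 * tentN r t + tentN r (t - 1) = 0 := by
  rcases lt_or_gt_of_ne h1 with h | h
  · rw [tentN_of_le h.le, tentN_of_le (by omega), tentN_of_le (by omega)]; ring
  rcases lt_or_gt_of_ne h2 with h' | h'
  · rw [tentN_of_mem hr h.le h'.le, tentN_of_mem hr (by omega) (by omega), tentN_of_mem hr (by omega) (by omega)]
    have hr0 : (r : ℝ) ≠ 0 := by exact_mod_cast (show r ≠ 0 by omega)
    field_simp
    have e1 : 2 * r - (t - 1) = (2 * r - (t + 1)) + 2 := by omega
    have e2 : 2 * r - t = (2 * r - (t + 1)) + 1 := by omega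
    rw [e1, e2]; push_cast; ring
  · rw [tentN_of_ge hr h'.le, tentN_of_ge hr (by omega), tentN_of_ge hr (by omega)]; ring

/-- The tent read on a SIGNED integer offset `s` (through `|s|`). [folklore] -/
private def tentZ (r : ℕ) (s : ℤ) : ℝ := tentN r s.natAbs

/-- kernel: `|s + 1|` is `|s| + 1` or `|s| − 1`. [folklore] -/
private theorem natAbs_add_one (s : ℤ) : (s + 1).natAbs = s.natAbs + 1 ∨ (s + 1).natAbs + 1 = s.natAbs := by omega

/-- kernel: the signed tent is `1/r`-Lipschitz under unit steps. [folklore] -/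
private theorem abs_tentZ_succ_sub_le (hr : 1 ≤ r) (s : ℤ) : |tentZ r (s + 1) - tentZ r s| ≤ 1 / r := by
  unfold tentZ
  rcases natAbs_add_one s with h | h
  · rw [h]; exact abs_tentN_succ_sub_le hr _
  · rw [← h, abs_sub_comm]; exact abs_tentN_succ_sub_le hr _

/-- kernel: the signed second difference vanishes unless `|s| ∈ {r, 2r}`. [folklore] -/
private theorem tentZ_second_diff_eq_zero (hr : 1 ≤ r) {s : ℤ} (h1 : s.natAbs ≠ r) (h2 : s.natAbs ≠ 2 * r) :
    tentZ r (s + 1) - 2 * tentZ r s + tentZ r (s - 1) = 0 := by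
  unfold tentZ
  rcases lt_trichotomy s 0 with hs | hs | hs
  · have e1 : (s + 1).natAbs = s.natAbs - 1 := by omega
    have e2 : (s - 1).natAbs = s.natAbs + 1 := by omega
    rw [e1, e2]
    have := tentN_second_diff_eq_zero hr (t := s.natAbs) (by omega) h1 h2
    linarith
  · subst hs
    simp only [zero_add, zero_sub, Int.natAbs_one, Int.natAbs_zero, Int.natAbs_neg]
    rw [tentN_of_le hr, tentN_of_le (Nat.zero_le _)]; ring
  · have e1 : (s + 1).natAbs = s.natAbs + 1 := by omega
    have e2 : (s - 1).natAbs = s.natAbs - 1 := by omega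
    rw [e1, e2]
    exact tentN_second_diff_eq_zero hr (t := s.natAbs) (by omega) h1 h2

variable {N : ℕ} [NeZero N]

/-- kernel: `|valMinAbs m| = cdist m`. [folklore] -/
private theorem natAbs_valMinAbs_eq_cdist (m : ZMod N) : m.valMinAbs.natAbs = cdist m := by
  rw [ZMod.valMinAbs_natAbs_eq_min, cdist, ZMod.neg_val]
  split_ifs with h
  · subst h; simp
  · rfl

omit [NeZero N] in
/-- kernel: a unit step changes the least residue by at most `1` in absolute value: `|vm m| ≤ |vm(m + 1)| + 1`. [folklore] -/
private theorem natAbs_valMinAbs_le_succ (hN : 3 ≤ N) (m : ZMod N) : m.valMinAbs.natAbs ≤ (m + 1).valMinAbs.natAbs + 1 := by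
  have h1 : ((-1 : ZMod N)).valMinAbs.natAbs ≤ 1 := by
    rw [ZMod.natAbs_valMinAbs_neg]
    have : ((1 : ℕ) : ZMod N).valMinAbs = (1 : ℕ) := ZMod.valMinAbs_natCast_of_le_half (by omega)
    rw [Nat.cast_one] at this
    rw [this]; simp
  have h := ZMod.natAbs_valMinAbs_add_le (m + 1) (-1 : ZMod N)
  rw [show m + 1 + -1 = m by ring] at h
  exact h.trans ((Int.natAbs_add_le _ _).trans (by omega))

omit [NeZero N] in
/-- kernel: symmetrically `|vm(m + 1)| ≤ |vm m| + 1`. [folklore] -/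
private theorem natAbs_valMinAbs_succ_le (hN : 3 ≤ N) (m : ZMod N) : (m + 1).valMinAbs.natAbs ≤ m.valMinAbs.natAbs + 1 := by
  have h1 : ((1 : ZMod N)).valMinAbs.natAbs ≤ 1 := by
    have : ((1 : ℕ) : ZMod N).valMinAbs = (1 : ℕ) := ZMod.valMinAbs_natCast_of_le_half (by omega)
    rw [Nat.cast_one] at this
    rw [this]; simp
  have h := ZMod.natAbs_valMinAbs_add_le m (1 : ZMod N)
  exact h.trans ((Int.natAbs_add_le _ _).trans (by omega))

/-- kernel: away from the antipode the least residue of `m + 1` is that of `m` plus one. [folklore] -/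
private theorem valMinAbs_add_one {m : ZMod N} (h : 2 * m.valMinAbs.natAbs + 4 ≤ N) :
    (m + 1).valMinAbs = m.valMinAbs + 1 := by
  rw [ZMod.valMinAbs_spec]
  refine ⟨by rw [Int.cast_add, ZMod.coe_valMinAbs, Int.cast_one], ?_, ?_⟩
  · have : -(m.valMinAbs.natAbs : ℤ) ≤ m.valMinAbs := by omega
    omega
  · have : (m.valMinAbs : ℤ) ≤ m.valMinAbs.natAbs := by omega
    omega

/-- kernel: … and of `m − 1` minus one. [folklore] -/
private theorem valMinAbs_sub_one {m : ZMod N} (h : 2 * m.valMinAbs.natAbs + 4 ≤ N) :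
    (m - 1).valMinAbs = m.valMinAbs - 1 := by
  rw [ZMod.valMinAbs_spec]
  refine ⟨by rw [Int.cast_sub, ZMod.coe_valMinAbs, Int.cast_one], ?_, ?_⟩
  · have : -(m.valMinAbs.natAbs : ℤ) ≤ m.valMinAbs := by omega
    omega
  · have : (m.valMinAbs : ℤ) ≤ m.valMinAbs.natAbs := by omega
    omega

/-- The tent around the circle: `T(m) = tent(|vm m|)` for `m ∈ ZMod N`. [folklore] -/
private def tentC (r : ℕ) (m : ZMod N) : ℝ := tentZ r m.valMinAbs

omit [NeZero N] in
/-- kernel: `0 ≤ T ≤ 1`. [folklore] -/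
private theorem tentC_nonneg (r : ℕ) (m : ZMod N) : 0 ≤ tentC r m := tentN_nonneg _ _

omit [NeZero N] in
/-- kernel: `T ≤ 1`. [folklore] -/
private theorem tentC_le_one (hr : 1 ≤ r) (m : ZMod N) : tentC r m ≤ 1 := tentN_le_one hr _

/-- kernel: `T(m) ≠ 0 ⟹ cdist m < 2r`. [folklore] -/
private theorem cdist_lt_of_tentC_ne_zero (hr : 1 ≤ r) {m : ZMod N} (h : tentC r m ≠ 0) : cdist m < 2 * r := by
  by_contra hc
  rw [not_lt, ← natAbs_valMinAbs_eq_cdist] at hc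
  exact h (tentN_of_ge hr hc)

/-- kernel: `T = 1` on the flat top `cdist m ≤ r`. [folklore] -/
private theorem tentC_of_cdist_le {m : ZMod N} (h : cdist m ≤ r) : tentC r m = 1 := by
  unfold tentC tentZ; rw [natAbs_valMinAbs_eq_cdist]; exact tentN_of_le h

/-- kernel: **`1/r`-Lipschitz around the circle** (the tent support stays away from the antipode: `4r + 6 ≤ N`). [folklore] -/
private theorem abs_tentC_succ_sub_le (hr : 1 ≤ r) (hN : 4 * r + 6 ≤ N) (m : ZMod N) : |tentC r (m + 1) - tentC r m| ≤ 1 / r := by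
  have hN3 : 3 ≤ N := by omega
  by_cases h : 2 * m.valMinAbs.natAbs + 4 ≤ N
  · unfold tentC; rw [valMinAbs_add_one h]; exact abs_tentZ_succ_sub_le hr _
  · -- near the antipode both values vanish
    have h0 : 2 * r ≤ m.valMinAbs.natAbs := by omega
    have h1 : 2 * r ≤ (m + 1).valMinAbs.natAbs := by have := natAbs_valMinAbs_le_succ hN3 m; omega
    unfold tentC tentZ
    rw [tentN_of_ge hr h0, tentN_of_ge hr h1, sub_self, abs_zero]; positivity

/-- kernel: **the second difference around the circle vanishes off the kinks** `cdist m ∈ {r, 2r}` (`4r + 6 ≤ N`). [folklore] -/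
private theorem tentC_second_diff_eq_zero (hr : 1 ≤ r) (hN : 4 * r + 6 ≤ N) {m : ZMod N} (h1 : cdist m ≠ r) (h2 : cdist m ≠ 2 * r) :
    tentC r (m + 1) - 2 * tentC r m + tentC r (m - 1) = 0 := by
  have hN3 : 3 ≤ N := by omega
  rw [← natAbs_valMinAbs_eq_cdist] at h1 h2
  by_cases h : 2 * m.valMinAbs.natAbs + 4 ≤ N
  · unfold tentC; rw [valMinAbs_add_one h, valMinAbs_sub_one h]; exact tentZ_second_diff_eq_zero hr h1 h2
  · have h0 : 2 * r ≤ m.valMinAbs.natAbs := by omega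
    have ha : 2 * r ≤ (m + 1).valMinAbs.natAbs := by have := natAbs_valMinAbs_le_succ hN3 m; omega
    have hb : 2 * r ≤ (m - 1).valMinAbs.natAbs := by
      have := natAbs_valMinAbs_succ_le hN3 (m - 1); rw [sub_add_cancel] at this; omega
    unfold tentC tentZ
    rw [tentN_of_ge hr h0, tentN_of_ge hr ha, tentN_of_ge hr hb]; ring

/-- kernel: the second difference around the circle is at most `2/r` in size. [folklore] -/
private theorem abs_tentC_second_diff_le (hr : 1 ≤ r) (hN : 4 * r + 6 ≤ N) (m : ZMod N) :
    |tentC r (m + 1) - 2 * tentC r m + tentC r (m - 1)| ≤ 2 / r := by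
  have e : tentC r (m + 1) - 2 * tentC r m + tentC r (m - 1) =
      (tentC r (m + 1) - tentC r m) - (tentC r (m - 1 + 1) - tentC r (m - 1)) := by rw [sub_add_cancel]; ring
  rw [e]
  refine (abs_sub _ _).trans ?_
  have := abs_tentC_succ_sub_le hr hN m
  have := abs_tentC_succ_sub_le hr hN (m - 1)
  have h2 : (2 : ℝ) / r = 1 / r + 1 / r := by ring
  linarith

/-- kernel: where the first difference of the circular tent is nonzero, the distance is at least `r − 1`. [folklore] -/
private theorem le_cdist_of_tentC_succ_ne (hr : 1 ≤ r) (hN : 4 * r + 6 ≤ N) {m : ZMod N} (h : tentC r (m + 1) ≠ tentC r m) :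
    r ≤ cdist m + 1 := by
  have hN3 : 3 ≤ N := by omega
  by_contra hlt
  have hc : cdist m + 2 ≤ r := by omega
  have h0 : cdist m ≤ r := by omega
  have hc' : m.valMinAbs.natAbs + 2 ≤ r := by rw [natAbs_valMinAbs_eq_cdist]; exact hc
  have h1 : cdist (m + 1) ≤ r := by
    rw [← natAbs_valMinAbs_eq_cdist]
    have := natAbs_valMinAbs_succ_le hN3 m; omega
  exact h (by rw [tentC_of_cdist_le h1, tentC_of_cdist_le h0])

end Tent

/-! ## §1b The product cutoff `χ_{y₀,r}(z) = ∏_ν T_r(z_ν − y₀,ν)` on the torus `T^{(j)}` -/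

section Cutoff

variable {P : Params} {j : ℕ}

/-- kernel: `cdist` is symmetric in the difference. [folklore] -/
private theorem cdist_sub_comm {n : ℕ} [NeZero n] (a b : ZMod n) : cdist (a - b) = cdist (b - a) := by
  rw [← neg_sub, cdist_neg]

/-- kernel: the `μ`-coordinate of `z + e_μ` is `z_μ + 1`, the others are unchanged. [folklore] -/
private theorem shift_apply_self' (z : Balaban1983to89.Site P j) (μ : Fin P.d) : z.shift μ μ = z μ + 1 := by
  simp [Balaban1983to89.Site.shift]

/-- kernel: the other coordinates of `z + e_μ` are those of `z`. [folklore] -/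
private theorem shift_apply_ne' (z : Balaban1983to89.Site P j) {μ ν : Fin P.d} (h : ν ≠ μ) : z.shift μ ν = z ν := by
  simp [Balaban1983to89.Site.shift, Function.update_of_ne h]

/-- kernel: the `μ`-coordinate of `z − e_μ` is `z_μ − 1`. [folklore] -/
private theorem unshift_apply_self' (z : Balaban1983to89.Site P j) (μ : Fin P.d) : z.unshift μ μ = z μ - 1 := by
  simp [Balaban1983to89.Site.unshift]

/-- kernel: the other coordinates of `z − e_μ` are those of `z`. [folklore] -/
private theorem unshift_apply_ne' (z : Balaban1983to89.Site P j) {μ ν : Fin P.d} (h : ν ≠ μ) : z.unshift μ ν = z ν := by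
  simp [Balaban1983to89.Site.unshift, Function.update_of_ne h]

/-- kernel: one lattice step moves the sup distance by at most one. [folklore] -/
private theorem supDist_shift_le_one' (x : Balaban1983to89.Site P j) (μ : Fin P.d) : supDist x (x.shift μ) ≤ 1 := by
  rw [supDist_eq_sup_cdist]
  refine Finset.sup_le fun ν _ => ?_
  by_cases hν : ν = μ
  · subst hν
    have h : x ν - x.shift ν ν = -1 := by rw [shift_apply_self']; ring
    rw [h, cdist_neg]
    exact (cdist_le_val _).trans (by rw [ZMod.val_one_eq_one_mod]; exact Nat.mod_le 1 _)
  · rw [shift_apply_ne' x hν, sub_self]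
    exact (cdist_le_val _).trans (by simp)

/-- kernel: `|y₀ − (z+e_μ)|_∞ ≤ |y₀ − z|_∞ + 1`. [folklore] -/
private theorem supDist_shift_le_succ (y₀ z : Balaban1983to89.Site P j) (μ : Fin P.d) : supDist y₀ (z.shift μ) ≤ supDist y₀ z + 1 :=
  (supDist_triangle y₀ z (z.shift μ)).trans (Nat.add_le_add_left (supDist_shift_le_one' z μ) _)

/-- kernel: `|y₀ − z|_∞ ≤ |y₀ − (z+e_μ)|_∞ + 1`. [folklore] -/
private theorem supDist_le_shift_succ (y₀ z : Balaban1983to89.Site P j) (μ : Fin P.d) : supDist y₀ z ≤ supDist y₀ (z.shift μ) + 1 := by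
  have h := supDist_triangle y₀ (z.shift μ) z
  rw [supDist_comm (z.shift μ) z] at h
  exact h.trans (Nat.add_le_add_left (supDist_shift_le_one' z μ) _)

/-- kernel: `|y₀ − (z−e_μ)|_∞ ≤ |y₀ − z|_∞ + 1`. [folklore] -/
private theorem supDist_unshift_le_succ (y₀ z : Balaban1983to89.Site P j) (μ : Fin P.d) : supDist y₀ (z.unshift μ) ≤ supDist y₀ z + 1 := by
  have h := supDist_le_shift_succ y₀ (z.unshift μ) μ
  rwa [show (z.unshift μ).shift μ = z from (LatticeFieldCalculus.shiftEquiv μ).right_inv z] at h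

/-- THE CUTOFF of the interior estimate: the product of circular tents of flat radius `r` in every coordinate around `y₀` — `1` on the
sup-ball of radius `r`, `0` off the sup-ball of radius `2r − 1`, `1/r`-Lipschitz along bonds, with second differences along bonds supported
on the two kink slabs `cdist(z_μ − y₀,μ) ∈ {r, 2r}`. [folklore] -/
private def chi (y₀ : Balaban1983to89.Site P j) (r : ℕ) (z : Balaban1983to89.Site P j) : ℝ := ∏ ν : Fin P.d, tentC r (z ν - y₀ ν)

variable {r : ℕ}

/-- kernel: `0 ≤ χ`. [folklore] -/
private theorem chi_nonneg (y₀ : Balaban1983to89.Site P j) (r : ℕ) (z : Balaban1983to89.Site P j) : 0 ≤ chi y₀ r z :=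
  Finset.prod_nonneg fun _ _ => tentC_nonneg _ _

/-- kernel: `χ ≤ 1`. [folklore] -/
private theorem chi_le_one (hr : 1 ≤ r) (y₀ z : Balaban1983to89.Site P j) : chi y₀ r z ≤ 1 :=
  Finset.prod_le_one (fun _ _ => tentC_nonneg _ _) fun _ _ => tentC_le_one hr _

/-- kernel: `|χ| ≤ 1`. [folklore] -/
private theorem abs_chi_le_one (hr : 1 ≤ r) (y₀ z : Balaban1983to89.Site P j) : |chi y₀ r z| ≤ 1 := by
  rw [abs_of_nonneg (chi_nonneg y₀ r z)]; exact chi_le_one hr y₀ z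

/-- kernel: `χ = 1` on the ball `|y₀ − z|_∞ ≤ r`. [folklore] -/
private theorem chi_eq_one_of_supDist_le {y₀ z : Balaban1983to89.Site P j} (h : supDist y₀ z ≤ r) : chi y₀ r z = 1 :=
  Finset.prod_eq_one fun ν _ => tentC_of_cdist_le (by rw [cdist_sub_comm]; exact (cdist_le_supDist y₀ z ν).trans h)

/-- kernel: `χ(z) ≠ 0 ⟹ |y₀ − z|_∞ < 2r`. [folklore] -/
private theorem supDist_lt_of_chi_ne_zero (hr : 1 ≤ r) {y₀ z : Balaban1983to89.Site P j} (h : chi y₀ r z ≠ 0) : supDist y₀ z < 2 * r := by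
  rw [supDist_eq_sup_cdist, Finset.sup_lt_iff (by exact_mod_cast (show 0 < 2 * r by omega))]
  intro ν _
  rw [← cdist_sub_comm]
  exact cdist_lt_of_tentC_ne_zero hr (Finset.prod_ne_zero_iff.1 h ν (Finset.mem_univ ν))

/-- kernel: the bond difference of `χ` factorises through the tent difference in the bond direction. [folklore] -/
private theorem chi_shift_sub (y₀ z : Balaban1983to89.Site P j) (μ : Fin P.d) :
    chi y₀ r (z.shift μ) - chi y₀ r z =
      (tentC r (z μ - y₀ μ + 1) - tentC r (z μ - y₀ μ)) * ∏ ν ∈ univ.erase μ, tentC r (z ν - y₀ ν) := by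
  unfold chi
  rw [← Finset.mul_prod_erase univ _ (Finset.mem_univ μ), ← Finset.mul_prod_erase univ _ (Finset.mem_univ μ), shift_apply_self',
    show z μ + 1 - y₀ μ = z μ - y₀ μ + 1 by ring]
  have he : ∏ ν ∈ univ.erase μ, tentC r (z.shift μ ν - y₀ ν) = ∏ ν ∈ univ.erase μ, tentC r (z ν - y₀ ν) :=
    Finset.prod_congr rfl fun ν hν => by rw [shift_apply_ne' z (Finset.ne_of_mem_erase hν)]
  rw [he]; ring

/-- kernel: the second bond difference of `χ` factorises through the second tent difference. [folklore] -/
private theorem chi_second_diff (y₀ z : Balaban1983to89.Site P j) (μ : Fin P.d) :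
    chi y₀ r (z.shift μ) - 2 * chi y₀ r z + chi y₀ r (z.unshift μ) =
      (tentC r (z μ - y₀ μ + 1) - 2 * tentC r (z μ - y₀ μ) + tentC r (z μ - y₀ μ - 1)) *
        ∏ ν ∈ univ.erase μ, tentC r (z ν - y₀ ν) := by
  unfold chi
  rw [← Finset.mul_prod_erase univ _ (Finset.mem_univ μ), ← Finset.mul_prod_erase univ (fun ν => tentC r (z ν - y₀ ν)) (Finset.mem_univ μ),
    ← Finset.mul_prod_erase univ (fun ν => tentC r (z.unshift μ ν - y₀ ν)) (Finset.mem_univ μ), shift_apply_self',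
    unshift_apply_self', show z μ + 1 - y₀ μ = z μ - y₀ μ + 1 by ring, show z μ - 1 - y₀ μ = z μ - y₀ μ - 1 by ring]
  have he : ∏ ν ∈ univ.erase μ, tentC r (z.shift μ ν - y₀ ν) = ∏ ν ∈ univ.erase μ, tentC r (z ν - y₀ ν) :=
    Finset.prod_congr rfl fun ν hν => by rw [shift_apply_ne' z (Finset.ne_of_mem_erase hν)]
  have he' : ∏ ν ∈ univ.erase μ, tentC r (z.unshift μ ν - y₀ ν) = ∏ ν ∈ univ.erase μ, tentC r (z ν - y₀ ν) :=
    Finset.prod_congr rfl fun ν hν => by rw [unshift_apply_ne' z (Finset.ne_of_mem_erase hν)]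
  rw [he, he']; ring

/-- kernel: the co-factor is in `[0, 1]`. [folklore] -/
private theorem abs_prod_erase_le_one (hr : 1 ≤ r) (y₀ z : Balaban1983to89.Site P j) (μ : Fin P.d) :
    |∏ ν ∈ univ.erase μ, tentC r (z ν - y₀ ν)| ≤ 1 := by
  rw [abs_of_nonneg (Finset.prod_nonneg fun _ _ => tentC_nonneg _ _)]
  exact Finset.prod_le_one (fun _ _ => tentC_nonneg _ _) fun _ _ => tentC_le_one hr _

/-- **`χ` IS `1/r`-LIPSCHITZ ALONG BONDS**: `|χ(z+e_μ) − χ(z)| ≤ 1/r` (`4r + 6 ≤ sitesPerDir`). [folklore] -/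
private theorem abs_chi_shift_sub_le (hr : 1 ≤ r) (hN : 4 * r + 6 ≤ P.sitesPerDir j) (y₀ z : Balaban1983to89.Site P j) (μ : Fin P.d) :
    |chi y₀ r (z.shift μ) - chi y₀ r z| ≤ 1 / r := by
  rw [chi_shift_sub, abs_mul]
  have h1 := abs_tentC_succ_sub_le hr hN (z μ - y₀ μ)
  have h2 := abs_prod_erase_le_one hr y₀ z μ
  have : (0 : ℝ) ≤ 1 / r := by positivity
  nlinarith [abs_nonneg (tentC r (z μ - y₀ μ + 1) - tentC r (z μ - y₀ μ)), abs_nonneg (∏ ν ∈ univ.erase μ, tentC r (z ν - y₀ ν))]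

/-- kernel: where the bond difference of `χ` is nonzero, `r ≤ |y₀ − z|_∞ + 1` … [folklore] -/
private theorem le_supDist_of_chi_shift_ne (hr : 1 ≤ r) (hN : 4 * r + 6 ≤ P.sitesPerDir j) {y₀ z : Balaban1983to89.Site P j} {μ : Fin P.d}
    (h : chi y₀ r (z.shift μ) ≠ chi y₀ r z) : r ≤ supDist y₀ z + 1 := by
  have h' : tentC r (z μ - y₀ μ + 1) ≠ tentC r (z μ - y₀ μ) := by
    intro he
    apply h
    have := chi_shift_sub y₀ z μ (r := r)
    rw [he, sub_self, zero_mul] at this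
    linarith
  have h1 := le_cdist_of_tentC_succ_ne hr hN h'
  have h2 : cdist (z μ - y₀ μ) ≤ supDist y₀ z := by rw [cdist_sub_comm]; exact cdist_le_supDist y₀ z μ
  omega

/-- kernel: … and `|y₀ − z|_∞ ≤ 2r`. [folklore] -/
private theorem supDist_le_of_chi_shift_ne (hr : 1 ≤ r) {y₀ z : Balaban1983to89.Site P j} {μ : Fin P.d}
    (h : chi y₀ r (z.shift μ) ≠ chi y₀ r z) : supDist y₀ z ≤ 2 * r := by
  by_cases h0 : chi y₀ r z = 0
  · have h1 : chi y₀ r (z.shift μ) ≠ 0 := by rw [h0] at h; exact h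
    have := supDist_lt_of_chi_ne_zero hr h1
    have := supDist_le_shift_succ y₀ z μ
    omega
  · have := supDist_lt_of_chi_ne_zero hr h0; omega

/-- **THE SECOND BOND DIFFERENCE OF `χ` IS AT MOST `2/r`**. [folklore] -/
private theorem abs_chi_second_diff_le (hr : 1 ≤ r) (hN : 4 * r + 6 ≤ P.sitesPerDir j) (y₀ z : Balaban1983to89.Site P j) (μ : Fin P.d) :
    |chi y₀ r (z.shift μ) - 2 * chi y₀ r z + chi y₀ r (z.unshift μ)| ≤ 2 / r := by
  rw [chi_second_diff, abs_mul]
  have h1 := abs_tentC_second_diff_le hr hN (z μ - y₀ μ)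
  have h2 := abs_prod_erase_le_one hr y₀ z μ
  have : (0 : ℝ) ≤ 2 / r := by positivity
  nlinarith [abs_nonneg (tentC r (z μ - y₀ μ + 1) - 2 * tentC r (z μ - y₀ μ) + tentC r (z μ - y₀ μ - 1)),
    abs_nonneg (∏ ν ∈ univ.erase μ, tentC r (z ν - y₀ ν))]

/-- **… AND IT IS SUPPORTED ON THE TWO KINK SLABS** `cdist(z_μ − y₀,μ) ∈ {r, 2r}`. [folklore] -/
private theorem cdist_eq_of_chi_second_diff_ne_zero (hr : 1 ≤ r) (hN : 4 * r + 6 ≤ P.sitesPerDir j) {y₀ z : Balaban1983to89.Site P j}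
    {μ : Fin P.d} (h : chi y₀ r (z.shift μ) - 2 * chi y₀ r z + chi y₀ r (z.unshift μ) ≠ 0) :
    cdist (z μ - y₀ μ) = r ∨ cdist (z μ - y₀ μ) = 2 * r := by
  by_contra hc
  rw [not_or] at hc
  apply h
  rw [chi_second_diff, tentC_second_diff_eq_zero hr hN hc.1 hc.2, zero_mul]

/-- kernel: … inside the ball `|y₀ − z|_∞ ≤ 2r`. [folklore] -/
private theorem supDist_le_of_chi_second_diff_ne_zero (hr : 1 ≤ r) {y₀ z : Balaban1983to89.Site P j} {μ : Fin P.d}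
    (h : chi y₀ r (z.shift μ) - 2 * chi y₀ r z + chi y₀ r (z.unshift μ) ≠ 0) : supDist y₀ z ≤ 2 * r := by
  by_contra hz
  apply h
  have h0 : chi y₀ r z = 0 := by
    by_contra h0; have := supDist_lt_of_chi_ne_zero hr h0; omega
  have h1 : chi y₀ r (z.shift μ) = 0 := by
    by_contra h1; have := supDist_lt_of_chi_ne_zero hr h1; have := supDist_le_shift_succ y₀ z μ; omega
  have h2 : chi y₀ r (z.unshift μ) = 0 := by
    by_contra h2
    have := supDist_lt_of_chi_ne_zero hr h2
    have h3 := supDist_shift_le_succ y₀ (z.unshift μ) μ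
    rw [show (z.unshift μ).shift μ = z from (LatticeFieldCalculus.shiftEquiv μ).right_inv z] at h3
    omega
  rw [h0, h1, h2]; ring

end Cutoff

/-! ## §2 Lattice counting: sup-balls and coordinate slabs of the torus -/

section Counting

variable {P : Params} {j : ℕ}

/-- The sup-ball `{z : |y₀ − z|_∞ ≤ n}` as a finset. [folklore] -/
private def ball (y₀ : Balaban1983to89.Site P j) (n : ℕ) : Finset (Balaban1983to89.Site P j) := univ.filter fun z => supDist y₀ z ≤ n

/-- The slab of the ball with the `μ`-th circular coordinate distance equal to `s`. [folklore] -/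
private def slab (y₀ : Balaban1983to89.Site P j) (n : ℕ) (μ : Fin P.d) (s : ℕ) : Finset (Balaban1983to89.Site P j) :=
  univ.filter fun z => supDist y₀ z ≤ n ∧ cdist (z μ - y₀ μ) = s

/-- kernel: membership in the ball. [folklore] -/
private theorem mem_ball {y₀ z : Balaban1983to89.Site P j} {n : ℕ} : z ∈ ball y₀ n ↔ supDist y₀ z ≤ n := by
  simp [ball]

/-- kernel: membership in a slab. [folklore] -/
private theorem mem_slab {y₀ z : Balaban1983to89.Site P j} {n : ℕ} {μ : Fin P.d} {s : ℕ} :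
    z ∈ slab y₀ n μ s ↔ supDist y₀ z ≤ n ∧ cdist (z μ - y₀ μ) = s := by
  simp [slab]

/-- kernel: translating a coordinate condition does not change the count (bound form). [folklore] -/
private theorem card_filter_sub_right_le {n : ℕ} [NeZero n] (c : ZMod n) (p : ZMod n → Prop) [DecidablePred p] :
    (univ.filter fun m : ZMod n => p (m - c)).card ≤ (univ.filter p).card := by
  calc (univ.filter fun m : ZMod n => p (m - c)).card
      ≤ ((univ.filter p).image fun m => m + c).card := by
        refine Finset.card_le_card fun m hm => ?_
        rw [Finset.mem_filter] at hm
        exact Finset.mem_image.mpr ⟨m - c, Finset.mem_filter.mpr ⟨Finset.mem_univ _, hm.2⟩, sub_add_cancel m c⟩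
    _ ≤ _ := Finset.card_image_le

/-- **BALL COUNT**: `#{z : |y₀ − z|_∞ ≤ n} ≤ (2n + 1)^d`. [folklore] -/
private theorem card_ball_le (y₀ : Balaban1983to89.Site P j) (n : ℕ) : (ball y₀ n).card ≤ (2 * n + 1) ^ P.d := by
  classical
  set B : Fin P.d → Finset (ZMod (P.sitesPerDir j)) := fun ν => univ.filter fun m => cdist (m - y₀ ν) ≤ n with hB
  have hsub : ball y₀ n ⊆ Fintype.piFinset B := by
    intro z hz
    rw [mem_ball] at hz
    refine Fintype.mem_piFinset.mpr fun ν => Finset.mem_filter.mpr ⟨Finset.mem_univ _, ?_⟩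
    rw [cdist_sub_comm]; exact (cdist_le_supDist y₀ z ν).trans hz
  refine (Finset.card_le_card hsub).trans ?_
  refine (Fintype.card_piFinset B).le.trans ?_
  calc ∏ ν, (B ν).card ≤ ∏ _ν : Fin P.d, (2 * n + 1) :=
        Finset.prod_le_prod (fun _ _ => Nat.zero_le _) fun ν _ =>
          (card_filter_sub_right_le (y₀ ν) (fun m => cdist m ≤ n)).trans (card_cdist_le_le n)
    _ = (2 * n + 1) ^ P.d := by rw [Finset.prod_const, Finset.card_univ, Fintype.card_fin]

/-- **SLAB COUNT**: `#{z : |y₀ − z|_∞ ≤ n, cdist(z_μ − y₀,μ) = s} ≤ 2(2n + 1)^{d−1}`. [folklore] -/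
private theorem card_slab_le (y₀ : Balaban1983to89.Site P j) (n : ℕ) (μ : Fin P.d) (s : ℕ) :
    (slab y₀ n μ s).card ≤ 2 * (2 * n + 1) ^ (P.d - 1) := by
  classical
  set B : Fin P.d → Finset (ZMod (P.sitesPerDir j)) := fun ν =>
    if ν = μ then univ.filter fun m => cdist (m - y₀ ν) = s else univ.filter fun m => cdist (m - y₀ ν) ≤ n with hB
  have hsub : slab y₀ n μ s ⊆ Fintype.piFinset B := by
    intro z hz
    rw [mem_slab] at hz
    refine Fintype.mem_piFinset.mpr fun ν => ?_
    by_cases hν : ν = μ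
    · subst hν; simp only [hB, if_true]; exact Finset.mem_filter.mpr ⟨Finset.mem_univ _, hz.2⟩
    · simp only [hB, hν, if_false]
      refine Finset.mem_filter.mpr ⟨Finset.mem_univ _, ?_⟩
      rw [cdist_sub_comm]; exact (cdist_le_supDist y₀ z ν).trans hz.1
  refine (Finset.card_le_card hsub).trans ?_
  refine (Fintype.card_piFinset B).le.trans ?_
  have hμ : (B μ).card ≤ 2 := by
    simp only [hB, if_true]
    exact (card_filter_sub_right_le (y₀ μ) (fun m => cdist m = s)).trans (card_cdist_eq_le s)
  have hν : ∀ ν ∈ univ.erase μ, (B ν).card ≤ 2 * n + 1 := by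
    intro ν hν
    have hne : ν ≠ μ := Finset.ne_of_mem_erase hν
    simp only [hB, hne, if_false]
    exact (card_filter_sub_right_le (y₀ ν) (fun m => cdist m ≤ n)).trans (card_cdist_le_le n)
  rw [← Finset.mul_prod_erase univ (fun ν => (B ν).card) (Finset.mem_univ μ)]
  refine Nat.mul_le_mul hμ ?_
  calc ∏ ν ∈ univ.erase μ, (B ν).card ≤ ∏ _ν ∈ univ.erase μ, (2 * n + 1) :=
        Finset.prod_le_prod (fun _ _ => Nat.zero_le _) hν
    _ = (2 * n + 1) ^ (P.d - 1) := by
        rw [Finset.prod_const, Finset.card_erase_of_mem (Finset.mem_univ μ), Finset.card_univ, Fintype.card_fin]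

end Counting

/-! ## §3 Radial profiles: sums over the torus of functions dominated by a profile of the sup distance -/

section Radial

variable {P : Params} {j : ℕ}

/-- kernel: the shell of radius `0` is the centre. [folklore] -/
private theorem shell_zero (y₀ : Balaban1983to89.Site P j) : shell y₀ 0 = {y₀} := by
  ext z
  simp only [shell, Finset.mem_filter, Finset.mem_univ, true_and, Finset.mem_singleton, supDist_eq_zero_iff]
  exact eq_comm

/-- **SHELL-BY-SHELL BOUND**: a function `g ≤ F(|y₀ − z|_∞)` on the ball of radius `n`, `≤ 0` outside, `F ≥ 0`, has
`Σ_z g(z) ≤ F(0) + Σ_{s=1}^{n} 2d(2s+1)^{d−1}F(s)`. [folklore] -/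
private theorem sum_le_radial (y₀ : Balaban1983to89.Site P j) (n : ℕ) (Fb : ℕ → ℝ) (hFb : ∀ s, 0 ≤ Fb s) (g : Balaban1983to89.Site P j → ℝ)
    (hg : ∀ z, supDist y₀ z ≤ n → g z ≤ Fb (supDist y₀ z)) (hg' : ∀ z, n < supDist y₀ z → g z ≤ 0) :
    ∑ z, g z ≤ Fb 0 + ∑ i ∈ Finset.range n, 2 * P.d * (2 * ((i + 1 : ℕ) : ℝ) + 1) ^ (P.d - 1) * Fb (i + 1) := by
  classical
  have h1 : ∑ z, g z ≤ ∑ z, (if supDist y₀ z ≤ n then Fb (supDist y₀ z) else 0) := by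
    refine Finset.sum_le_sum fun z _ => ?_
    split_ifs with h
    · exact hg z h
    · exact hg' z (not_le.mp h)
  refine h1.trans ?_
  rw [← Finset.sum_filter]
  have hmaps : ∀ z ∈ univ.filter (fun z : Balaban1983to89.Site P j => supDist y₀ z ≤ n), supDist y₀ z ∈ Finset.range (n + 1) := by
    intro z hz; rw [Finset.mem_filter] at hz; rw [Finset.mem_range]; omega
  rw [← Finset.sum_fiberwise_of_maps_to hmaps]
  have hfib : ∀ s ∈ Finset.range (n + 1),
      ∑ z ∈ (univ.filter fun z : Balaban1983to89.Site P j => supDist y₀ z ≤ n).filter (fun z => supDist y₀ z = s),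
        Fb (supDist y₀ z) = (shell y₀ s).card * Fb s := by
    intro s hs
    rw [Finset.mem_range] at hs
    have hset : (univ.filter fun z : Balaban1983to89.Site P j => supDist y₀ z ≤ n).filter (fun z => supDist y₀ z = s) = shell y₀ s := by
      ext z
      simp only [Finset.mem_filter, Finset.mem_univ, true_and, shell]
      constructor
      · exact fun h => h.2
      · intro h; exact ⟨by omega, h⟩
    rw [hset]
    have h2 : ∑ z ∈ shell y₀ s, Fb (supDist y₀ z) = ∑ z ∈ shell y₀ s, Fb s :=
      Finset.sum_congr rfl fun z hz => by
        have hz' : supDist y₀ z = s := by simp only [shell, Finset.mem_filter, Finset.mem_univ, true_and] at hz; exact hz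
        rw [hz']
    rw [h2, Finset.sum_const, nsmul_eq_mul]
  rw [Finset.sum_congr rfl hfib, Finset.sum_range_succ', shell_zero, Finset.card_singleton, Nat.cast_one, one_mul]
  have key : ∑ i ∈ Finset.range n, ((shell y₀ (i + 1)).card : ℝ) * Fb (i + 1)
      ≤ ∑ i ∈ Finset.range n, 2 * P.d * (2 * ((i + 1 : ℕ) : ℝ) + 1) ^ (P.d - 1) * Fb (i + 1) :=
    Finset.sum_le_sum fun i _ => mul_le_mul_of_nonneg_right (card_shell_le y₀ (s := i + 1) (by omega)) (hFb _)
  linarith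

/-- kernel: `(2s+1)^{d−1} ≤ 3^{d−1}s^{d−1}` for `s ≥ 1`. [folklore] -/
private theorem shellFactor_le {s : ℝ} (hs : 1 ≤ s) (e : ℕ) : (2 * s + 1) ^ e ≤ 3 ^ e * s ^ e := by
  rw [← mul_pow]; exact pow_le_pow_left₀ (by linarith) (by linarith) e

/-- **PROFILE `1/max(s,1)^{d−1}`**: `Σ_{s=1}^{n} 2d(2s+1)^{d−1}·(A/s^{d−1}) ≤ 2d·3^{d−1}·A·n` (`A ≥ 0`). [folklore] -/
private theorem radial_sum_inv_pow_le (hd : 1 ≤ P.d) {A : ℝ} (hA : 0 ≤ A) (n : ℕ) :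
    ∑ i ∈ Finset.range n, 2 * P.d * (2 * ((i + 1 : ℕ) : ℝ) + 1) ^ (P.d - 1) * (A / ((i + 1 : ℕ) : ℝ) ^ (P.d - 1))
      ≤ 2 * P.d * 3 ^ (P.d - 1) * A * n := by
  have hterm : ∀ i ∈ Finset.range n,
      2 * P.d * (2 * ((i + 1 : ℕ) : ℝ) + 1) ^ (P.d - 1) * (A / ((i + 1 : ℕ) : ℝ) ^ (P.d - 1)) ≤ 2 * P.d * 3 ^ (P.d - 1) * A := by
    intro i _
    have hs : (1 : ℝ) ≤ ((i + 1 : ℕ) : ℝ) := by exact_mod_cast Nat.succ_pos i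
    have hsp : (0 : ℝ) < ((i + 1 : ℕ) : ℝ) ^ (P.d - 1) := by positivity
    have h1 := shellFactor_le hs (P.d - 1)
    calc 2 * (P.d : ℝ) * (2 * ((i + 1 : ℕ) : ℝ) + 1) ^ (P.d - 1) * (A / ((i + 1 : ℕ) : ℝ) ^ (P.d - 1))
        ≤ 2 * P.d * (3 ^ (P.d - 1) * ((i + 1 : ℕ) : ℝ) ^ (P.d - 1)) * (A / ((i + 1 : ℕ) : ℝ) ^ (P.d - 1)) := by
          gcongr
      _ = 2 * P.d * 3 ^ (P.d - 1) * A := by field_simp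
  calc _ ≤ ∑ _i ∈ Finset.range n, 2 * (P.d : ℝ) * 3 ^ (P.d - 1) * A := Finset.sum_le_sum hterm
    _ = 2 * P.d * 3 ^ (P.d - 1) * A * n := by rw [Finset.sum_const, Finset.card_range, nsmul_eq_mul]; ring

/-- **PROFILE `s/max(s,1)^{d−1}`**: `Σ_{s=1}^{n} 2d(2s+1)^{d−1}·(A·s/s^{d−1}) ≤ 2d·3^{d−1}·A·n²` (`A ≥ 0`). [folklore] -/
private theorem radial_sum_mul_inv_pow_le (hd : 1 ≤ P.d) {A : ℝ} (hA : 0 ≤ A) (n : ℕ) :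
    ∑ i ∈ Finset.range n, 2 * P.d * (2 * ((i + 1 : ℕ) : ℝ) + 1) ^ (P.d - 1) * (A * ((i + 1 : ℕ) : ℝ) / ((i + 1 : ℕ) : ℝ) ^ (P.d - 1))
      ≤ 2 * P.d * 3 ^ (P.d - 1) * A * n ^ 2 := by
  have hterm : ∀ i ∈ Finset.range n,
      2 * P.d * (2 * ((i + 1 : ℕ) : ℝ) + 1) ^ (P.d - 1) * (A * ((i + 1 : ℕ) : ℝ) / ((i + 1 : ℕ) : ℝ) ^ (P.d - 1))
        ≤ 2 * P.d * 3 ^ (P.d - 1) * A * n := by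
    intro i hi
    rw [Finset.mem_range] at hi
    have hs : (1 : ℝ) ≤ ((i + 1 : ℕ) : ℝ) := by exact_mod_cast Nat.succ_pos i
    have hsn : ((i + 1 : ℕ) : ℝ) ≤ n := by exact_mod_cast hi
    have hsp : (0 : ℝ) < ((i + 1 : ℕ) : ℝ) ^ (P.d - 1) := by positivity
    have h1 := shellFactor_le hs (P.d - 1)
    calc 2 * (P.d : ℝ) * (2 * ((i + 1 : ℕ) : ℝ) + 1) ^ (P.d - 1) * (A * ((i + 1 : ℕ) : ℝ) / ((i + 1 : ℕ) : ℝ) ^ (P.d - 1))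
        ≤ 2 * P.d * (3 ^ (P.d - 1) * ((i + 1 : ℕ) : ℝ) ^ (P.d - 1)) * (A * n / ((i + 1 : ℕ) : ℝ) ^ (P.d - 1)) := by
          gcongr
      _ = 2 * P.d * 3 ^ (P.d - 1) * A * n := by field_simp
  calc _ ≤ ∑ _i ∈ Finset.range n, 2 * (P.d : ℝ) * 3 ^ (P.d - 1) * A * n := Finset.sum_le_sum hterm
    _ = 2 * P.d * 3 ^ (P.d - 1) * A * n ^ 2 := by rw [Finset.sum_const, Finset.card_range, nsmul_eq_mul]; ring

end Radial


/-! ## §4 Algebra of the localized representation through the flat propagator -/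

section Algebra

variable {P : Params}

/-- kernel: the flat field read in `ℂ` is `1` on every bond. [cite: BalabanImbrieJaffe1985, (4.6.3) p.313] -/
theorem cfg_one (b : PBond P 0) : cfg (1 : GaugeField P 0 U1) b = 1 := toC_one

/-- kernel: **the localisation identity** — for any three operators `N♭, N′, X` and `N′ψ = f′`:
`N♭(Xψ) = Xf′ − X(N′ − N♭)ψ + (N♭X − XN♭)ψ`. [folklore] -/
private theorem loc_identity {n : Type*} [Fintype n] [DecidableEq n] (Nf N' X : Matrix n n ℂ) {ψ f' : n → ℂ} (hψ : N' *ᵥ ψ = f') :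
    Nf *ᵥ (X *ᵥ ψ) = X *ᵥ f' - X *ᵥ ((N' - Nf) *ᵥ ψ) + (Nf * X - X * Nf) *ᵥ ψ := by
  rw [sub_mulVec, sub_mulVec, ← mulVec_mulVec, ← mulVec_mulVec, hψ, mulVec_sub]
  abel

/-- kernel: **transposition of the commutator** — for `A` symmetric and `X` diagonal, `K·((AX − XA)ψ) = ((XA − AX)K)·ψ`. [folklore] -/
private theorem dot_commutator_transpose {n : Type*} [Fintype n] [DecidableEq n] {A : Matrix n n ℂ} (hA : Aᵀ = A) (d K ψ : n → ℂ) :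
    K ⬝ᵥ ((A * diagonal d - diagonal d * A) *ᵥ ψ) = ((diagonal d * A - A * diagonal d) *ᵥ K) ⬝ᵥ ψ := by
  rw [dotProduct_mulVec, ← mulVec_transpose, transpose_sub, transpose_mul, transpose_mul, diagonal_transpose, hA]

/-- kernel: the entries of the commutator `((XA − AX)K)(z) = d(z)(AK)(z) − (A(dK))(z)`. [folklore] -/
private theorem commutator_mulVec_apply {n : Type*} [Fintype n] [DecidableEq n] (A : Matrix n n ℂ) (d K : n → ℂ) (z : n) :
    ((diagonal d * A - A * diagonal d) *ᵥ K) z = d z * (A *ᵥ K) z - (A *ᵥ fun w => d w * K w) z := by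
  rw [sub_mulVec, ← mulVec_mulVec, ← mulVec_mulVec, Pi.sub_apply, mulVec_diagonal]
  congr 2
  funext w
  rw [mulVec_diagonal]

/-- kernel: **the per-bond identity** (`ūu = 1`): `(1−u)a ψ₊ + (1−ū)b ψ₋ = (ū−1)a(uψ₊ − ψ₋) + (1−ū)(b − a)ψ₋`. [folklore] -/
private theorem per_bond_identity {u a b ψp ψm : ℂ} (hu : conj u * u = 1) :
    (1 - u) * a * ψp + (1 - conj u) * b * ψm = (conj u - 1) * a * (u * ψp - ψm) + (1 - conj u) * (b - a) * ψm := by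
  linear_combination (-(a * ψp)) * hu

variable {a : ℝ} {k : ℕ}

/-- kernel: the flat whole-torus operator `N♭ = D_1^*D_1 + a′Q_k(1)^*Q_k(1)` has real symmetric entries. [cite: BalabanImbrieJaffe1985, (4.6.2) p.313] -/
theorem nOp_flat_transpose (a : ℝ) (hk : k ≤ P.m + P.K) :
    (nOp (B1RG242Torus.α P a k * (P.L : ℝ) ^ (k * P.d)) P.eps⁻¹ (1 : GaugeField P 0 U1) k univ)ᵀ =
      nOp (B1RG242Torus.α P a k * (P.L : ℝ) ^ (k * P.d)) P.eps⁻¹ (1 : GaugeField P 0 U1) k univ := by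
  ext z w
  have h1 := congr_fun (congr_fun (nOp_conjTranspose (B1RG242Torus.α P a k * (P.L : ℝ) ^ (k * P.d)) P.eps⁻¹
    (1 : GaugeField P 0 U1) k univ) z) w
  rw [conjTranspose_apply] at h1
  rw [transpose_apply, ← h1, nOp_flat_eq_tower a hk, map_apply, Complex.ofRealHom_eq_coe, Complex.star_def, Complex.conj_ofReal]

/-- kernel: **the flat operator entrywise** on a test vector `g`: `(N♭g)(z) = c²Σ_μ((g z − g(z+e_μ)) + (g z − g(z−e_μ))) + a′(Q_1ᴴQ_1g)(z)`.
[cite: BalabanImbrieJaffe1985, (4.6.2) p.313] -/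
theorem nOp_flat_mulVec_apply (a' c : ℝ) (k : ℕ) (g : Balaban1983to89.Site P 0 → ℂ) (z : Balaban1983to89.Site P 0) :
    (nOp a' c (1 : GaugeField P 0 U1) k univ *ᵥ g) z =
      (c : ℂ) ^ 2 * ∑ μ : Fin P.d, ((g z - g (z.shift μ)) + (g z - g (z.unshift μ))) +
        (a' : ℂ) * ((((qMatK (1 : GaugeField P 0 U1) k univ)ᴴ * qMatK (1 : GaugeField P 0 U1) k univ)) *ᵥ g) z := by
  rw [nOp_eq, add_mulVec, smul_mulVec, Pi.add_apply, Pi.smul_apply, smul_eq_mul, gram_dN_mulVec_apply]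
  congr 2
  refine sum_congr rfl fun μ _ => ?_
  rw [cfg_one, cfg_one, map_one, one_mul, one_mul]

/-- kernel: **the difference of the covariant and the flat operator entrywise**:
`((N(u) − N♭)ψ)(z) = c²Σ_μ((1 − u_{z,μ})ψ(z+e_μ) + (1 − ū_{z−e_μ,μ})ψ(z−e_μ)) + a′((Q_uᴴQ_uψ)(z) − (Q_1ᴴQ_1ψ)(z))`.
[cite: BalabanImbrieJaffe1985, (4.6.2) p.313] -/
theorem nOp_sub_flat_mulVec_apply (a' c : ℝ) (U : GaugeField P 0 U1) (k : ℕ) (ψ : Balaban1983to89.Site P 0 → ℂ)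
    (z : Balaban1983to89.Site P 0) :
    ((nOp a' c U k univ - nOp a' c (1 : GaugeField P 0 U1) k univ) *ᵥ ψ) z =
      (c : ℂ) ^ 2 * ∑ μ : Fin P.d, ((1 - cfg U ⟨z, μ⟩) * ψ (z.shift μ) + (1 - conj (cfg U ⟨z.unshift μ, μ⟩)) * ψ (z.unshift μ)) +
        (a' : ℂ) * ((((qMatK U k univ)ᴴ * qMatK U k univ) *ᵥ ψ) z -
          (((qMatK (1 : GaugeField P 0 U1) k univ)ᴴ * qMatK (1 : GaugeField P 0 U1) k univ) *ᵥ ψ) z) := by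
  rw [sub_mulVec, Pi.sub_apply, nOp_flat_mulVec_apply, nOp_eq, add_mulVec, smul_mulVec, Pi.add_apply, Pi.smul_apply,
    smul_eq_mul, gram_dN_mulVec_apply]
  have h : ∑ μ : Fin P.d, ((1 - cfg U ⟨z, μ⟩) * ψ (z.shift μ) + (1 - conj (cfg U ⟨z.unshift μ, μ⟩)) * ψ (z.unshift μ)) =
      ∑ μ : Fin P.d, (ψ z - cfg U ⟨z, μ⟩ * ψ (z.shift μ) + (ψ z - conj (cfg U ⟨z.unshift μ, μ⟩) * ψ (z.unshift μ))) -
        ∑ μ : Fin P.d, ((ψ z - ψ (z.shift μ)) + (ψ z - ψ (z.unshift μ))) := by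
    rw [← sum_sub_distrib]; exact sum_congr rfl fun μ _ => by ring
  rw [h]; ring

/-- kernel: **the Laplacian part of the commutator entrywise**: with `X = diag χ`,
`χ(z)(D_1^*D_1K)(z) − (D_1^*D_1(χK))(z) = c²Σ_μ((χ(z+e_μ) − χ(z))K(z+e_μ) + (χ(z−e_μ) − χ(z))K(z−e_μ))`.
[cite: BalabanImbrieJaffe1985, (4.6.3) p.313] -/
theorem commutator_flat_apply (a' c : ℝ) (k : ℕ) (χ K : Balaban1983to89.Site P 0 → ℂ) (z : Balaban1983to89.Site P 0) :
    ((diagonal χ * nOp a' c (1 : GaugeField P 0 U1) k univ - nOp a' c (1 : GaugeField P 0 U1) k univ * diagonal χ) *ᵥ K) z =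
      (c : ℂ) ^ 2 * ∑ μ : Fin P.d, ((χ (z.shift μ) - χ z) * K (z.shift μ) + (χ (z.unshift μ) - χ z) * K (z.unshift μ)) +
        (a' : ℂ) * (χ z * ((((qMatK (1 : GaugeField P 0 U1) k univ)ᴴ * qMatK (1 : GaugeField P 0 U1) k univ)) *ᵥ K) z -
          ((((qMatK (1 : GaugeField P 0 U1) k univ)ᴴ * qMatK (1 : GaugeField P 0 U1) k univ)) *ᵥ fun w => χ w * K w) z) := by
  rw [commutator_mulVec_apply, nOp_flat_mulVec_apply, nOp_flat_mulVec_apply]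
  have h : ∑ μ : Fin P.d, ((χ (z.shift μ) - χ z) * K (z.shift μ) + (χ (z.unshift μ) - χ z) * K (z.unshift μ)) =
      χ z * ∑ μ : Fin P.d, ((K z - K (z.shift μ)) + (K z - K (z.unshift μ))) -
        ∑ μ : Fin P.d, ((χ z * K z - χ (z.shift μ) * K (z.shift μ)) + (χ z * K z - χ (z.unshift μ) * K (z.unshift μ))) := by
    rw [mul_sum, ← sum_sub_distrib]; exact sum_congr rfl fun μ _ => by ring
  rw [h]; ring

/-- kernel: **the reindexed `W`-sum** (`z ↦ z + e_μ` is a bijection of the torus):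
`Σ_z K̃(z)(1 − ū_{z−e_μ,μ})ψ(z−e_μ) = Σ_z K̃(z+e_μ)(1 − ū_{z,μ})ψ(z)`. [folklore] -/
private theorem sum_unshift_reindex (μ : Fin P.d) (Kt ψ : Balaban1983to89.Site P 0 → ℂ) (u : PBond P 0 → ℂ) :
    ∑ z : Balaban1983to89.Site P 0, Kt z * ((1 - conj (u ⟨z.unshift μ, μ⟩)) * ψ (z.unshift μ)) =
      ∑ z : Balaban1983to89.Site P 0, Kt (z.shift μ) * ((1 - conj (u ⟨z, μ⟩)) * ψ z) := by
  refine (Fintype.sum_equiv (LatticeFieldCalculus.shiftEquiv μ) _ _ fun z => ?_).symm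
  show Kt (z.shift μ) * ((1 - conj (u ⟨z, μ⟩)) * ψ z) =
    Kt (z.shift μ) * ((1 - conj (u ⟨(z.shift μ).unshift μ, μ⟩)) * ψ ((z.shift μ).unshift μ))
  rw [show (z.shift μ).unshift μ = z from (LatticeFieldCalculus.shiftEquiv μ).left_inv z]

/-- kernel: **the `W`-sum after the per-bond identity**: for `|u| = 1` bondwise,
`Σ_z K̃(z)Σ_μ((1−u_{z,μ})ψ(z+e_μ) + (1−ū_{z−e_μ,μ})ψ(z−e_μ)) = Σ_μΣ_z((ū−1)K̃(z)(uψ(z+e_μ) − ψ(z)) + (1−ū)(K̃(z+e_μ) − K̃(z))ψ(z))`.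
[folklore] -/
private theorem W_sum_identity (Kt ψ : Balaban1983to89.Site P 0 → ℂ) (u : PBond P 0 → ℂ) (hu : ∀ b, conj (u b) * u b = 1) :
    ∑ z : Balaban1983to89.Site P 0, Kt z * ∑ μ : Fin P.d,
        ((1 - u ⟨z, μ⟩) * ψ (z.shift μ) + (1 - conj (u ⟨z.unshift μ, μ⟩)) * ψ (z.unshift μ)) =
      ∑ μ : Fin P.d, ∑ z : Balaban1983to89.Site P 0,
        ((conj (u ⟨z, μ⟩) - 1) * Kt z * (u ⟨z, μ⟩ * ψ (z.shift μ) - ψ z) +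
          (1 - conj (u ⟨z, μ⟩)) * (Kt (z.shift μ) - Kt z) * ψ z) := by
  simp_rw [mul_sum]
  rw [sum_comm]
  refine sum_congr rfl fun μ _ => ?_
  simp_rw [mul_add]
  rw [sum_add_distrib, sum_unshift_reindex, ← sum_add_distrib]
  refine sum_congr rfl fun z _ => ?_
  have := per_bond_identity (a := Kt z) (b := Kt (z.shift μ)) (ψp := ψ (z.shift μ)) (ψm := ψ z) (hu ⟨z, μ⟩)
  linear_combination this

end Algebra


/-! ## §5 Envelope helpers and the block-average (`Q_k^*Q_k`) bookkeeping -/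

section Helpers

/-- kernel: **neighbour envelope** — if `T ≤ T′ + 1` then `A/max(T′,1)^p ≤ 2^pA/max(T,1)^p` (`A ≥ 0`). [folklore] -/
private theorem env_neighbour {T T' : ℕ} (h : T ≤ T' + 1) (p : ℕ) {A : ℝ} (hA : 0 ≤ A) :
    A / (max (T' : ℝ) 1) ^ p ≤ 2 ^ p * A / (max (T : ℝ) 1) ^ p := by
  have h1 : max (T : ℝ) 1 ≤ 2 * max (T' : ℝ) 1 := by
    have hT : (T : ℝ) ≤ T' + 1 := by exact_mod_cast h
    refine max_le ?_ ?_
    · have := le_max_left (T' : ℝ) 1; have := le_max_right (T' : ℝ) 1; linarith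
    · have := le_max_right (T' : ℝ) 1; linarith
  have hm : 0 < max (T : ℝ) 1 := lt_max_of_lt_right one_pos
  have hm' : 0 < max (T' : ℝ) 1 := lt_max_of_lt_right one_pos
  rw [le_div_iff₀ (pow_pos hm _), div_mul_eq_mul_div, div_le_iff₀ (pow_pos hm' _)]
  calc A * (max (T : ℝ) 1) ^ p ≤ A * (2 * max (T' : ℝ) 1) ^ p :=
        mul_le_mul_of_nonneg_left (pow_le_pow_left₀ hm.le h1 p) hA
    _ = 2 ^ p * A * (max (T' : ℝ) 1) ^ p := by rw [mul_pow]; ring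

/-- kernel: **far envelope** — if `ρ/2 ≤ T` (`ρ > 0`) then `A/max(T,1)^p ≤ A(2/ρ)^p` (`A ≥ 0`). [folklore] -/
private theorem env_far {T : ℕ} {ρ : ℝ} (hρ : 0 < ρ) (h : ρ / 2 ≤ (T : ℝ)) (p : ℕ) {A : ℝ} (hA : 0 ≤ A) :
    A / (max (T : ℝ) 1) ^ p ≤ A * (2 / ρ) ^ p := by
  have hm : ρ / 2 ≤ max (T : ℝ) 1 := h.trans (le_max_left _ _)
  have hm0 : 0 < max (T : ℝ) 1 := lt_max_of_lt_right one_pos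
  rw [div_eq_mul_inv, ← inv_pow]
  refine mul_le_mul_of_nonneg_left (pow_le_pow_left₀ (inv_nonneg.2 hm0.le) ?_ p) hA
  rw [inv_le_comm₀ hm0 (by positivity), inv_div]; exact hm

/-- kernel: on a shell of radius `s ≥ 1` the envelope `max(s,1)` is `s`. [folklore] -/
private theorem max_cast_succ (i : ℕ) : max (((i + 1 : ℕ) : ℝ)) 1 = ((i + 1 : ℕ) : ℝ) :=
  max_eq_left (by exact_mod_cast Nat.succ_pos i)

variable {P : Params}

/-- **RADIAL BOUND, PROFILE `A/max(T,1)^{d−1}`**: a real function `g ≤ A/max(|y₀−z|_∞,1)^{d−1}` on the ball of radius `n` and `≤ 0`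
outside has `Σ_z g(z) ≤ A(1 + 2d3^{d−1}n)`. [folklore] -/
private theorem radial_env_one (hd : 1 ≤ P.d) (y₀ : Balaban1983to89.Site P 0) (n : ℕ) {A : ℝ} (hA : 0 ≤ A) (g : Balaban1983to89.Site P 0 → ℝ)
    (hg : ∀ z, supDist y₀ z ≤ n → g z ≤ A / (max (supDist y₀ z : ℝ) 1) ^ (P.d - 1)) (hg' : ∀ z, n < supDist y₀ z → g z ≤ 0) :
    ∑ z, g z ≤ A * (1 + 2 * P.d * 3 ^ (P.d - 1) * n) := by
  have h := sum_le_radial y₀ n (fun s => A / (max (s : ℝ) 1) ^ (P.d - 1)) (fun s => by positivity) g hg hg'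
  refine h.trans ?_
  simp only [Nat.cast_zero]
  rw [max_eq_right (zero_le_one' ℝ), one_pow, div_one]
  have h2 := radial_sum_inv_pow_le hd hA n
  simp only [max_cast_succ]
  linarith [h2]

/-- **RADIAL BOUND, PROFILE `A·T/max(T,1)^{d−1}`**: `Σ_z g(z) ≤ 2d3^{d−1}An²`. [folklore] -/
private theorem radial_env_T (hd : 1 ≤ P.d) (y₀ : Balaban1983to89.Site P 0) (n : ℕ) {A : ℝ} (hA : 0 ≤ A) (g : Balaban1983to89.Site P 0 → ℝ)
    (hg : ∀ z, supDist y₀ z ≤ n → g z ≤ A * (supDist y₀ z : ℝ) / (max (supDist y₀ z : ℝ) 1) ^ (P.d - 1))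
    (hg' : ∀ z, n < supDist y₀ z → g z ≤ 0) :
    ∑ z, g z ≤ 2 * P.d * 3 ^ (P.d - 1) * A * n ^ 2 := by
  have h := sum_le_radial y₀ n (fun s => A * (s : ℝ) / (max (s : ℝ) 1) ^ (P.d - 1)) (fun s => by positivity) g hg hg'
  refine h.trans ?_
  simp only [Nat.cast_zero, mul_zero, zero_div, zero_add]
  have h2 := radial_sum_mul_inv_pow_le hd hA n
  simp only [max_cast_succ]
  exact h2

open BIJ85BlockAveragesTorus BIJ85BlockAveragesTorusK

/-- kernel: **the flat block average over the `k`-block**: `(Q_k^*Q_kv)(z) = L^{−kd}Σ_{z′ ∈ B^k(z_k)}v(z′)`. [cite: Balaban1982Higgs1, (2.11) p.609] -/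
theorem towerQQ_apply_blockK {k : ℕ} (hk : k ≤ P.m + P.K) (v : Balaban1983to89.Site P 0 → ℝ) (z : Balaban1983to89.Site P 0) :
    ((B1RG242Torus.Qks P k * B1RG242Torus.Qk P k) *ᵥ v) z = (((P.L : ℝ) ^ P.d)⁻¹) ^ k * ∑ z' ∈ blockK k (blkIter k z), v z' := by
  rw [BIJ85FreeResolventTorus.towerQQ_mulVec_apply hk]
  congr 1
  refine sum_congr ?_ fun _ _ => rfl
  ext z'
  rw [mem_filter, mem_blockK, BIJ88NeumannPropagatorFlatDecay.blkIter_eq_iff_proj_eq hk, B1RG242Torus.lvl_of_le P hk]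
  simp

/-- kernel: `L^{−kd}·#B^k = 1`. [cite: BalabanImbrieJaffe1985, (5.1.2)–(5.1.3) p.313] -/
theorem LinvPow_mul_card_blockK {k : ℕ} (hk : k ≤ P.m + P.K) (y : Balaban1983to89.Site P (0 + k)) :
    (((P.L : ℝ) ^ P.d)⁻¹) ^ k * ((blockK k y).card : ℝ) = 1 := by
  rw [card_blockK k (by omega) y, Nat.cast_pow, inv_pow, ← pow_mul, Nat.mul_comm k P.d,
    inv_mul_cancel₀ (pow_ne_zero _ P.cast_L_pos.ne')]

/-- **THE COVARIANT BLOCK TERM AGAINST A BLOCK SUP**: `a′‖(Q_k(u)ᴴQ_k(u)φ)(z)‖ ≤ α_k·S` when `‖φ‖ ≤ S` on the block of `z`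
(`a′ = α_kL^{kd}`, `|u(Γ)| = 1`). [cite: BalabanImbrieJaffe1985, (2.6) p.303] -/
theorem aQQ_norm_le {a : ℝ} {k : ℕ} (hk : k ≤ P.m + P.K) (hα : 0 ≤ B1RG242Torus.α P a k) (U : GaugeField P 0 U1)
    (φ : Balaban1983to89.Site P 0 → ℂ) (z : Balaban1983to89.Site P 0) {S : ℝ} (hS : ∀ z', blkIter k z' = blkIter k z → ‖φ z'‖ ≤ S) :
    (B1RG242Torus.α P a k * (P.L : ℝ) ^ (k * P.d)) * ‖(((qMatK U k univ)ᴴ * qMatK U k univ) *ᵥ φ) z‖ ≤ B1RG242Torus.α P a k * S := by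
  have h1 := norm_gram_qMatK_mulVec_le hk U φ z
  have hN : 0 < (P.L : ℝ) ^ (k * P.d) := pow_pos P.cast_L_pos _
  rw [towerQQ_apply_blockK hk] at h1
  have h2 : ∑ z' ∈ blockK k (blkIter k z), ‖φ z'‖ ≤ (blockK k (blkIter k z)).card • S :=
    sum_le_card_nsmul _ _ _ fun z' hz' => hS z' (mem_blockK.1 hz')
  rw [nsmul_eq_mul] at h2
  calc B1RG242Torus.α P a k * (P.L : ℝ) ^ (k * P.d) * ‖(((qMatK U k univ)ᴴ * qMatK U k univ) *ᵥ φ) z‖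
      ≤ B1RG242Torus.α P a k * (P.L : ℝ) ^ (k * P.d) *
          (((P.L : ℝ) ^ (k * P.d))⁻¹ * ((((P.L : ℝ) ^ P.d)⁻¹) ^ k * ∑ z' ∈ blockK k (blkIter k z), ‖φ z'‖)) :=
        mul_le_mul_of_nonneg_left h1 (by positivity)
    _ = B1RG242Torus.α P a k * ((((P.L : ℝ) ^ P.d)⁻¹) ^ k * ∑ z' ∈ blockK k (blkIter k z), ‖φ z'‖) := by
        field_simp
    _ ≤ B1RG242Torus.α P a k * ((((P.L : ℝ) ^ P.d)⁻¹) ^ k * ((blockK k (blkIter k z)).card * S)) := by gcongr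
    _ = B1RG242Torus.α P a k * S := by rw [← mul_assoc (((((P.L : ℝ) ^ P.d)⁻¹) ^ k)), LinvPow_mul_card_blockK hk, one_mul]

/-- **SWAPPING A BLOCK AVERAGE ONTO THE WEIGHT**: for `v ≥ 0` and a finite set `A`,
`Σ_{x∈A}(Q_k^*Q_kv)(x) ≤ Σ_{w : B^k(w) meets A} v(w)`. [cite: Balaban1982Higgs1, (2.11) p.609] -/
theorem sum_towerQQ_le {k : ℕ} (hk : k ≤ P.m + P.K) (v : Balaban1983to89.Site P 0 → ℝ) (hv : ∀ w, 0 ≤ v w)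
    (A : Finset (Balaban1983to89.Site P 0)) :
    ∑ x ∈ A, ((B1RG242Torus.Qks P k * B1RG242Torus.Qk P k) *ᵥ v) x ≤
      ∑ w, if (∃ x ∈ A, blkIter k x = blkIter k w) then v w else 0 := by
  classical
  simp_rw [towerQQ_apply_blockK hk]
  rw [← mul_sum]
  have h1 : ∑ x ∈ A, ∑ w ∈ blockK k (blkIter k x), v w = ∑ w, ((A.filter fun x => blkIter k x = blkIter k w).card : ℝ) * v w := by
    have e1 : ∀ x ∈ A, ∑ w ∈ blockK k (blkIter k x), v w = ∑ w, if blkIter k x = blkIter k w then v w else 0 := by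
      intro x _
      rw [← sum_filter]
      refine sum_congr ?_ fun _ _ => rfl
      ext w; rw [mem_blockK, mem_filter]; simp [eq_comm]
    rw [sum_congr rfl e1, sum_comm]
    refine sum_congr rfl fun w _ => ?_
    rw [← sum_filter, sum_const, nsmul_eq_mul]
  rw [h1, mul_sum]
  refine sum_le_sum fun w _ => ?_
  split_ifs with hex
  · have hc : ((A.filter fun x => blkIter k x = blkIter k w).card : ℝ) ≤ (blockK k (blkIter k w)).card := by
      exact_mod_cast card_le_card fun x hx => by rw [mem_filter] at hx; exact mem_blockK.2 hx.2
    calc (((P.L : ℝ) ^ P.d)⁻¹) ^ k * (((A.filter fun x => blkIter k x = blkIter k w).card : ℝ) * v w)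
        ≤ (((P.L : ℝ) ^ P.d)⁻¹) ^ k * (((blockK k (blkIter k w)).card : ℝ) * v w) := by gcongr; exact hv w
      _ = v w := by rw [← mul_assoc, LinvPow_mul_card_blockK hk, one_mul]
  · have h0 : (A.filter fun x => blkIter k x = blkIter k w) = ∅ := by
      rw [Finset.filter_eq_empty_iff]; intro x hx h; exact hex ⟨x, hx, h⟩
    rw [h0, card_empty, Nat.cast_zero, zero_mul, mul_zero]

/-- kernel: two sites of one `k`-block are within sup distance `L^k − 1 ≤ L^k`. [cite: BalabanImbrieJaffe1985, (5.1.2)–(5.1.3) p.313] -/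
theorem supDist_le_of_blkIter_eq' {k : ℕ} (hk : k ≤ P.m + P.K) {x x' : Balaban1983to89.Site P 0} (h : blkIter k x = blkIter k x') :
    supDist x x' ≤ P.L ^ k :=
  (BIJ85ScalarPropagatorDecay.supDist_le_of_blkIter_eq (j := 0) (by omega) h).trans (Nat.sub_le _ _)

end Helpers

/-! ## §6 THE LOCAL INTERIOR GRADIENT ESTIMATE at one bond, in a gauge with linear growth from the bond -/

section Local

variable {P : Params}

open BIJ85BlockAveragesTorus BIJ85BlockAveragesTorusK

/-- **(E1)–(E4) THE LOCALIZED REPRESENTATION**: for the whole-torus operators `N′ = N(u)`, `N♭ = N(1)` with `G♭N♭ = 1`, `N′ψ = f′`, and a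
real cutoff `χ` with `χ(y₀) = χ(y₀+e_{μ₀}) = 1`:
`ψ(y₀+e_{μ₀}) − ψ(y₀) = Σ_z K(z)χ(z)f′(z) − Σ_z K(z)χ(z)((N′ − N♭)ψ)(z) + Σ_z((XN♭ − N♭X)K)(z)ψ(z)`, `K(z) = G♭(y₀+e_{μ₀},z) − G♭(y₀,z)`.
[cite: BalabanImbrieJaffe1985, (4.6.2) p.313] -/
theorem loc_representation {a : ℝ} (ha : 0 < a) {k : ℕ} (hk1 : 1 ≤ k) (hk : k ≤ P.m + P.K) (U : GaugeField P 0 U1)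
    (ψ f' : Balaban1983to89.Site P 0 → ℂ)
    (hψ : nOp (B1RG242Torus.α P a k * (P.L : ℝ) ^ (k * P.d)) P.eps⁻¹ U k univ *ᵥ ψ = f')
    (χ : Balaban1983to89.Site P 0 → ℂ) (y₀ : Balaban1983to89.Site P 0) (μ₀ : Fin P.d) (hχ0 : χ y₀ = 1) (hχ1 : χ (y₀.shift μ₀) = 1) :
    ψ (y₀.shift μ₀) - ψ y₀ =
      ∑ z, (gBox (B1RG242Torus.α P a k * (P.L : ℝ) ^ (k * P.d)) P.eps⁻¹ (1 : GaugeField P 0 U1) k univ (y₀.shift μ₀) z -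
              gBox (B1RG242Torus.α P a k * (P.L : ℝ) ^ (k * P.d)) P.eps⁻¹ (1 : GaugeField P 0 U1) k univ y₀ z) * (χ z * f' z)
      - ∑ z, (gBox (B1RG242Torus.α P a k * (P.L : ℝ) ^ (k * P.d)) P.eps⁻¹ (1 : GaugeField P 0 U1) k univ (y₀.shift μ₀) z -
              gBox (B1RG242Torus.α P a k * (P.L : ℝ) ^ (k * P.d)) P.eps⁻¹ (1 : GaugeField P 0 U1) k univ y₀ z) *
          (χ z * ((nOp (B1RG242Torus.α P a k * (P.L : ℝ) ^ (k * P.d)) P.eps⁻¹ U k univ -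
              nOp (B1RG242Torus.α P a k * (P.L : ℝ) ^ (k * P.d)) P.eps⁻¹ (1 : GaugeField P 0 U1) k univ) *ᵥ ψ) z)
      + ∑ z, ((diagonal χ * nOp (B1RG242Torus.α P a k * (P.L : ℝ) ^ (k * P.d)) P.eps⁻¹ (1 : GaugeField P 0 U1) k univ -
              nOp (B1RG242Torus.α P a k * (P.L : ℝ) ^ (k * P.d)) P.eps⁻¹ (1 : GaugeField P 0 U1) k univ * diagonal χ) *ᵥ
            fun z => gBox (B1RG242Torus.α P a k * (P.L : ℝ) ^ (k * P.d)) P.eps⁻¹ (1 : GaugeField P 0 U1) k univ (y₀.shift μ₀) z -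
              gBox (B1RG242Torus.α P a k * (P.L : ℝ) ^ (k * P.d)) P.eps⁻¹ (1 : GaugeField P 0 U1) k univ y₀ z) z * ψ z := by
  set a' : ℝ := B1RG242Torus.α P a k * (P.L : ℝ) ^ (k * P.d) with ha'def
  set Nf := nOp a' P.eps⁻¹ (1 : GaugeField P 0 U1) k univ with hNf
  set N' := nOp a' P.eps⁻¹ U k univ with hN'
  set Gf := gBox a' P.eps⁻¹ (1 : GaugeField P 0 U1) k univ with hGf
  set K : Balaban1983to89.Site P 0 → ℂ := fun z => Gf (y₀.shift μ₀) z - Gf y₀ z with hK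
  have hk0 : 0 + k ≤ P.m + P.K := by omega
  have hα : 0 < B1RG242Torus.α P a k :=
    mul_pos (B1.aSeq_pos ha (B1RG242Torus.one_lt_cast_L P) hk1) (inv_pos.2 (pow_pos (P.spacing_pos k) 2))
  have ha' : 0 < a' := mul_pos hα (pow_pos P.cast_L_pos _)
  have hc : P.eps⁻¹ ≠ 0 := inv_ne_zero P.eps_pos.ne'
  have hGN : Gf * Nf = 1 := (gBox_univ_mul hk0 hc ha' (1 : GaugeField P 0 U1)).1
  set v := Nf *ᵥ (diagonal χ *ᵥ ψ) with hv
  have hE1 : diagonal χ *ᵥ ψ = Gf *ᵥ v := by rw [hv, mulVec_mulVec, hGN, one_mulVec]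
  have hy : ∀ y, χ y = 1 → ψ y = ∑ z, Gf y z * v z := fun y hy => by
    have h := congr_fun hE1 y
    rw [mulVec_diagonal, hy, one_mul] at h
    rw [h]; rfl
  have hdiff : ψ (y₀.shift μ₀) - ψ y₀ = ∑ z, K z * v z := by
    rw [hy _ hχ1, hy _ hχ0, ← sum_sub_distrib]
    exact sum_congr rfl fun z _ => by rw [hK]; ring
  rw [hdiff, hv, loc_identity Nf N' (diagonal χ) hψ]
  simp only [Pi.add_apply, Pi.sub_apply, mulVec_diagonal, mul_add, mul_sub, sum_add_distrib, sum_sub_distrib]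
  congr 1
  -- the commutator term, transposed
  have ht := dot_commutator_transpose (nOp_flat_transpose a hk) χ K ψ
  simp only [dotProduct] at ht
  rw [← hNf] at ht
  exact ht

/-- **THE `χ`-WEIGHTED KERNEL SUM**: `‖Σ_z K(z)χ(z)w(z)‖ ≤ W·A(1 + 4d3^{d−1}r)` when `‖K‖ ≤ A/max(T,1)^{d−1}` and `‖w‖ ≤ W` on the ball
`T < 2r`. [folklore] -/
private theorem chi_weighted_sum_le (hd : 1 ≤ P.d) {r : ℕ} (hr : 1 ≤ r) (y₀ : Balaban1983to89.Site P 0) (K w : Balaban1983to89.Site P 0 → ℂ)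
    {A W : ℝ} (hA : 0 ≤ A) (hW : 0 ≤ W) (hK : ∀ z, ‖K z‖ ≤ A / (max (supDist y₀ z : ℝ) 1) ^ (P.d - 1))
    (hw : ∀ z, supDist y₀ z < 2 * r → ‖w z‖ ≤ W) :
    ‖∑ z, K z * (((chi y₀ r z : ℝ) : ℂ) * w z)‖ ≤ W * A * (1 + 2 * P.d * 3 ^ (P.d - 1) * (2 * r : ℕ)) := by
  refine (norm_sum_le _ _).trans ?_
  have hin : ∀ z, supDist y₀ z ≤ 2 * r → ‖K z * (((chi y₀ r z : ℝ) : ℂ) * w z)‖ ≤ W * A / (max (supDist y₀ z : ℝ) 1) ^ (P.d - 1) := by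
    intro z _
    have hχ0 := chi_nonneg y₀ r z
    rw [norm_mul, norm_mul, Complex.norm_real, Real.norm_of_nonneg hχ0]
    by_cases h0 : chi y₀ r z = 0
    · rw [h0, zero_mul, mul_zero]; positivity
    · have hT := supDist_lt_of_chi_ne_zero hr h0
      calc ‖K z‖ * (chi y₀ r z * ‖w z‖) ≤ (A / (max (supDist y₀ z : ℝ) 1) ^ (P.d - 1)) * (1 * W) :=
            mul_le_mul (hK z) (mul_le_mul (chi_le_one hr y₀ z) (hw z hT) (norm_nonneg _) zero_le_one)
              (mul_nonneg hχ0 (norm_nonneg _)) (by positivity)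
        _ = W * A / (max (supDist y₀ z : ℝ) 1) ^ (P.d - 1) := by ring
  have hout : ∀ z, 2 * r < supDist y₀ z → ‖K z * (((chi y₀ r z : ℝ) : ℂ) * w z)‖ ≤ 0 := by
    intro z hz
    have h0 : chi y₀ r z = 0 := by
      by_contra h0; have := supDist_lt_of_chi_ne_zero hr h0; omega
    rw [h0]; simp
  have hmain := radial_env_one hd y₀ (2 * r) (A := W * A) (by positivity) _ hin hout
  linarith [hmain]

/-- **THE `W`-TERM** (the per-bond identity summed): with `|1 − u_{z,μ}| ≤ γ|y₀ − z|_∞` on the ball `T ≤ 2r`, `‖uψ(z+e_μ) − ψ(z)‖ ≤ M`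
there, `‖ψ‖ ≤ S` there, and the two kernel envelopes,
`‖Σ_μΣ_z((ū−1)K̃(z)(uψ(z+e_μ) − ψ(z)) + (1−ū)(K̃(z+e_μ) − K̃(z))ψ(z))‖ ≤ dγA(2d3^{d−1}(M + 2^{d−1}S/r)(2r)² + S(1 + 2d3^{d−1}2r))`.
[folklore] -/
private theorem W_term_le (hd : 1 ≤ P.d) {r : ℕ} (hr : 1 ≤ r) (hN : 4 * r + 6 ≤ P.sitesPerDir 0) (y₀ : Balaban1983to89.Site P 0)
    (K ψ : Balaban1983to89.Site P 0 → ℂ) (u : PBond P 0 → ℂ) {A γ S M : ℝ} (hA : 0 ≤ A) (hγ : 0 ≤ γ) (hS : 0 ≤ S) (hM : 0 ≤ M)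
    (hK1 : ∀ z, ‖K z‖ ≤ A / (max (supDist y₀ z : ℝ) 1) ^ (P.d - 1))
    (hK2 : ∀ z ν, ‖K (z.shift ν) - K z‖ ≤ A / (max (supDist y₀ z : ℝ) 1) ^ P.d)
    (hu : ∀ z μ, supDist y₀ z ≤ 2 * r → ‖u ⟨z, μ⟩ - 1‖ ≤ γ * supDist y₀ z)
    (hψS : ∀ z, supDist y₀ z ≤ 2 * r → ‖ψ z‖ ≤ S)
    (hψM : ∀ z μ, supDist y₀ z ≤ 2 * r → ‖u ⟨z, μ⟩ * ψ (z.shift μ) - ψ z‖ ≤ M) :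
    ‖∑ μ : Fin P.d, ∑ z : Balaban1983to89.Site P 0,
        ((conj (u ⟨z, μ⟩) - 1) * (((chi y₀ r z : ℝ) : ℂ) * K z) * (u ⟨z, μ⟩ * ψ (z.shift μ) - ψ z) +
          (1 - conj (u ⟨z, μ⟩)) * ((((chi y₀ r (z.shift μ) : ℝ) : ℂ) * K (z.shift μ)) - (((chi y₀ r z : ℝ) : ℂ) * K z)) * ψ z)‖ ≤
      P.d * (2 * P.d * 3 ^ (P.d - 1) * (γ * (A * (M + 2 ^ (P.d - 1) * S / r))) * (2 * r : ℕ) ^ 2 +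
        γ * (A * S) * (1 + 2 * P.d * 3 ^ (P.d - 1) * (2 * r : ℕ))) := by
  have hr0 : (0 : ℝ) < r := by exact_mod_cast hr
  refine (norm_sum_le _ _).trans ?_
  have hμ : ∀ μ : Fin P.d, ‖∑ z : Balaban1983to89.Site P 0,
      ((conj (u ⟨z, μ⟩) - 1) * (((chi y₀ r z : ℝ) : ℂ) * K z) * (u ⟨z, μ⟩ * ψ (z.shift μ) - ψ z) +
        (1 - conj (u ⟨z, μ⟩)) * ((((chi y₀ r (z.shift μ) : ℝ) : ℂ) * K (z.shift μ)) - (((chi y₀ r z : ℝ) : ℂ) * K z)) * ψ z)‖ ≤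
      2 * P.d * 3 ^ (P.d - 1) * (γ * (A * (M + 2 ^ (P.d - 1) * S / r))) * (2 * r : ℕ) ^ 2 +
        γ * (A * S) * (1 + 2 * P.d * 3 ^ (P.d - 1) * (2 * r : ℕ)) := by
    intro μ
    -- the two majorants
    set p1 : Balaban1983to89.Site P 0 → ℝ := fun z => ‖u ⟨z, μ⟩ - 1‖ *
      (chi y₀ r z * ‖K z‖ * ‖u ⟨z, μ⟩ * ψ (z.shift μ) - ψ z‖ + |chi y₀ r (z.shift μ) - chi y₀ r z| * ‖K (z.shift μ)‖ * ‖ψ z‖) with hp1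
    set p2 : Balaban1983to89.Site P 0 → ℝ := fun z => ‖u ⟨z, μ⟩ - 1‖ * (chi y₀ r z * ‖K (z.shift μ) - K z‖ * ‖ψ z‖) with hp2
    -- pointwise splitting
    have hpt : ∀ z, ‖(conj (u ⟨z, μ⟩) - 1) * (((chi y₀ r z : ℝ) : ℂ) * K z) * (u ⟨z, μ⟩ * ψ (z.shift μ) - ψ z) +
        (1 - conj (u ⟨z, μ⟩)) * ((((chi y₀ r (z.shift μ) : ℝ) : ℂ) * K (z.shift μ)) - (((chi y₀ r z : ℝ) : ℂ) * K z)) * ψ z‖ ≤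
        p1 z + p2 z := by
      intro z
      have hχ0 := chi_nonneg y₀ r z
      have hn1 : ‖conj (u ⟨z, μ⟩) - 1‖ = ‖u ⟨z, μ⟩ - 1‖ := by
        rw [← Complex.norm_conj, map_sub, Complex.conj_conj, map_one]
      have hn2 : ‖1 - conj (u ⟨z, μ⟩)‖ = ‖u ⟨z, μ⟩ - 1‖ := by rw [norm_sub_rev, hn1]
      have e1 : ‖(conj (u ⟨z, μ⟩) - 1) * (((chi y₀ r z : ℝ) : ℂ) * K z) * (u ⟨z, μ⟩ * ψ (z.shift μ) - ψ z)‖ =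
          ‖u ⟨z, μ⟩ - 1‖ * (chi y₀ r z * ‖K z‖) * ‖u ⟨z, μ⟩ * ψ (z.shift μ) - ψ z‖ := by
        rw [norm_mul, norm_mul, norm_mul, hn1, Complex.norm_real, Real.norm_of_nonneg hχ0]
      have e2 : ‖(1 - conj (u ⟨z, μ⟩)) * ((((chi y₀ r (z.shift μ) : ℝ) : ℂ) * K (z.shift μ)) - (((chi y₀ r z : ℝ) : ℂ) * K z)) * ψ z‖ =
          ‖u ⟨z, μ⟩ - 1‖ * ‖(((chi y₀ r (z.shift μ) : ℝ) : ℂ) * K (z.shift μ)) - (((chi y₀ r z : ℝ) : ℂ) * K z)‖ * ‖ψ z‖ := by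
        rw [norm_mul, norm_mul, hn2]
      have h3 : ‖(((chi y₀ r (z.shift μ) : ℝ) : ℂ) * K (z.shift μ)) - (((chi y₀ r z : ℝ) : ℂ) * K z)‖ ≤
          |chi y₀ r (z.shift μ) - chi y₀ r z| * ‖K (z.shift μ)‖ + chi y₀ r z * ‖K (z.shift μ) - K z‖ := by
        have hsplit : (((chi y₀ r (z.shift μ) : ℝ) : ℂ) * K (z.shift μ)) - (((chi y₀ r z : ℝ) : ℂ) * K z) =
            (((chi y₀ r (z.shift μ) : ℝ) : ℂ) - ((chi y₀ r z : ℝ) : ℂ)) * K (z.shift μ) + ((chi y₀ r z : ℝ) : ℂ) * (K (z.shift μ) - K z) := by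
          ring
        rw [hsplit]
        refine (norm_add_le _ _).trans (le_of_eq ?_)
        rw [norm_mul, norm_mul, ← Complex.ofReal_sub, Complex.norm_real, Complex.norm_real, Real.norm_eq_abs,
          Real.norm_of_nonneg hχ0]
      calc _ ≤ _ := norm_add_le _ _
        _ = ‖u ⟨z, μ⟩ - 1‖ * (chi y₀ r z * ‖K z‖) * ‖u ⟨z, μ⟩ * ψ (z.shift μ) - ψ z‖ +
            ‖u ⟨z, μ⟩ - 1‖ * ‖(((chi y₀ r (z.shift μ) : ℝ) : ℂ) * K (z.shift μ)) - (((chi y₀ r z : ℝ) : ℂ) * K z)‖ * ‖ψ z‖ := by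
            rw [e1, e2]
        _ ≤ ‖u ⟨z, μ⟩ - 1‖ * (chi y₀ r z * ‖K z‖) * ‖u ⟨z, μ⟩ * ψ (z.shift μ) - ψ z‖ +
            ‖u ⟨z, μ⟩ - 1‖ * (|chi y₀ r (z.shift μ) - chi y₀ r z| * ‖K (z.shift μ)‖ + chi y₀ r z * ‖K (z.shift μ) - K z‖) * ‖ψ z‖ := by
            gcongr
        _ = p1 z + p2 z := by simp only [hp1, hp2]; ring
    -- profile `T`: pointwise bound of `p1`
    have hP1 : ∀ z, supDist y₀ z ≤ 2 * r →
        p1 z ≤ γ * (A * (M + 2 ^ (P.d - 1) * S / r)) * (supDist y₀ z : ℝ) / (max (supDist y₀ z : ℝ) 1) ^ (P.d - 1) := by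
      intro z hz
      have hu' := hu z μ hz
      have hKz := hK1 z
      have hKs : ‖K (z.shift μ)‖ ≤ 2 ^ (P.d - 1) * A / (max (supDist y₀ z : ℝ) 1) ^ (P.d - 1) :=
        (hK1 (z.shift μ)).trans (env_neighbour (supDist_le_shift_succ y₀ z μ) _ hA)
      have hχ1 := chi_le_one hr y₀ z
      have hχ0 := chi_nonneg y₀ r z
      have hdχ := abs_chi_shift_sub_le hr hN y₀ z μ
      have hMz := hψM z μ hz
      have hSz := hψS z hz
      have hm : 0 < (max (supDist y₀ z : ℝ) 1) ^ (P.d - 1) := by positivity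
      have step1 : chi y₀ r z * ‖K z‖ * ‖u ⟨z, μ⟩ * ψ (z.shift μ) - ψ z‖ ≤ 1 * (A / (max (supDist y₀ z : ℝ) 1) ^ (P.d - 1)) * M := by
        gcongr
      have step2 : |chi y₀ r (z.shift μ) - chi y₀ r z| * ‖K (z.shift μ)‖ * ‖ψ z‖ ≤
          (1 / r) * (2 ^ (P.d - 1) * A / (max (supDist y₀ z : ℝ) 1) ^ (P.d - 1)) * S := by
        gcongr
      have step3 : p1 z ≤ (γ * supDist y₀ z) * (1 * (A / (max (supDist y₀ z : ℝ) 1) ^ (P.d - 1)) * M +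
          (1 / r) * (2 ^ (P.d - 1) * A / (max (supDist y₀ z : ℝ) 1) ^ (P.d - 1)) * S) := by
        simp only [hp1]
        exact mul_le_mul hu' (add_le_add step1 step2) (add_nonneg (by positivity) (by positivity)) (by positivity)
      refine step3.trans (le_of_eq ?_)
      field_simp
    have hP1' : ∀ z, 2 * r < supDist y₀ z → p1 z ≤ 0 := by
      intro z hz
      have h0 : chi y₀ r z = 0 := by
        by_contra h0; have := supDist_lt_of_chi_ne_zero hr h0; omega
      have h1 : chi y₀ r (z.shift μ) = 0 := by
        by_contra h1; have := supDist_lt_of_chi_ne_zero hr h1; have := supDist_le_shift_succ y₀ z μ; omega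
      simp only [hp1]; rw [h0, h1]; simp
    -- profile `1`: pointwise bound of `p2` (`T/max(T,1)^d ≤ 1/max(T,1)^{d-1}`)
    have hP2 : ∀ z, supDist y₀ z ≤ 2 * r → p2 z ≤ γ * (A * S) / (max (supDist y₀ z : ℝ) 1) ^ (P.d - 1) := by
      intro z hz
      have hu' := hu z μ hz
      have hχ1 := chi_le_one hr y₀ z
      have hχ0 := chi_nonneg y₀ r z
      have hSz := hψS z hz
      have hK2z := hK2 z μ
      have hm0 : (0 : ℝ) < max (supDist y₀ z : ℝ) 1 := by positivity
      have hTm : (supDist y₀ z : ℝ) ≤ max (supDist y₀ z : ℝ) 1 := le_max_left _ _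
      have hkey : (supDist y₀ z : ℝ) * (A / (max (supDist y₀ z : ℝ) 1) ^ P.d) ≤ A / (max (supDist y₀ z : ℝ) 1) ^ (P.d - 1) := by
        have hp : (max (supDist y₀ z : ℝ) 1) ^ P.d = (max (supDist y₀ z : ℝ) 1) ^ (P.d - 1) * max (supDist y₀ z : ℝ) 1 := by
          rw [← pow_succ, Nat.sub_add_cancel hd]
        rw [hp]
        have hm1 : (0 : ℝ) < (max (supDist y₀ z : ℝ) 1) ^ (P.d - 1) := by positivity
        calc (supDist y₀ z : ℝ) * (A / ((max (supDist y₀ z : ℝ) 1) ^ (P.d - 1) * max (supDist y₀ z : ℝ) 1))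
            = (A / (max (supDist y₀ z : ℝ) 1) ^ (P.d - 1)) * ((supDist y₀ z : ℝ) / max (supDist y₀ z : ℝ) 1) := by
              field_simp
          _ ≤ (A / (max (supDist y₀ z : ℝ) 1) ^ (P.d - 1)) * 1 :=
              mul_le_mul_of_nonneg_left ((div_le_one hm0).2 hTm) (by positivity)
          _ = A / (max (supDist y₀ z : ℝ) 1) ^ (P.d - 1) := mul_one _
      have step : p2 z ≤ (γ * supDist y₀ z) * (1 * (A / (max (supDist y₀ z : ℝ) 1) ^ P.d) * S) := by
        simp only [hp2]; gcongr
      calc p2 z ≤ (γ * supDist y₀ z) * (1 * (A / (max (supDist y₀ z : ℝ) 1) ^ P.d) * S) := step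
        _ = γ * S * ((supDist y₀ z : ℝ) * (A / (max (supDist y₀ z : ℝ) 1) ^ P.d)) := by ring
        _ ≤ γ * S * (A / (max (supDist y₀ z : ℝ) 1) ^ (P.d - 1)) := mul_le_mul_of_nonneg_left hkey (by positivity)
        _ = γ * (A * S) / (max (supDist y₀ z : ℝ) 1) ^ (P.d - 1) := by ring
    have hP2' : ∀ z, 2 * r < supDist y₀ z → p2 z ≤ 0 := by
      intro z hz
      have h0 : chi y₀ r z = 0 := by
        by_contra h0; have := supDist_lt_of_chi_ne_zero hr h0; omega
      simp only [hp2]; rw [h0]; simp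
    have hTsum := radial_env_T hd y₀ (2 * r) (A := γ * (A * (M + 2 ^ (P.d - 1) * S / r))) (by positivity) p1 hP1 hP1'
    have h1sum := radial_env_one hd y₀ (2 * r) (A := γ * (A * S)) (by positivity) p2 hP2 hP2'
    calc _ ≤ ∑ z, (p1 z + p2 z) := (norm_sum_le _ _).trans (sum_le_sum fun z _ => hpt z)
      _ = ∑ z, p1 z + ∑ z, p2 z := sum_add_distrib
      _ ≤ _ := add_le_add hTsum h1sum
  calc ∑ μ : Fin P.d, ‖∑ z : Balaban1983to89.Site P 0,
        ((conj (u ⟨z, μ⟩) - 1) * (((chi y₀ r z : ℝ) : ℂ) * K z) * (u ⟨z, μ⟩ * ψ (z.shift μ) - ψ z) +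
          (1 - conj (u ⟨z, μ⟩)) * ((((chi y₀ r (z.shift μ) : ℝ) : ℂ) * K (z.shift μ)) - (((chi y₀ r z : ℝ) : ℂ) * K z)) * ψ z)‖
      ≤ ∑ _μ : Fin P.d, (2 * P.d * 3 ^ (P.d - 1) * (γ * (A * (M + 2 ^ (P.d - 1) * S / r))) * (2 * r : ℕ) ^ 2 +
        γ * (A * S) * (1 + 2 * P.d * 3 ^ (P.d - 1) * (2 * r : ℕ))) := sum_le_sum fun μ _ => hμ μ
    _ = _ := by rw [sum_const, card_univ, Fintype.card_fin, nsmul_eq_mul]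

/-- **THE LAPLACIAN PART OF THE COMMUTATOR** (summation by parts onto the cutoff): with `‖ψ‖ ≤ S` on the ball `T ≤ 2r + 1`, `r ≥ 4`,
`‖Σ_z(Σ_μ((χ(z+e_μ) − χ(z))K(z+e_μ) + (χ(z−e_μ) − χ(z))K(z−e_μ)))ψ(z)‖ ≤ d·A·S·(8·9^{d−1} + 2·10^d)/r`: the second differences of `χ` live
on two slabs of width one at distance `≥ r − 1` (where `|K| ≲ A r^{1−d}`), its first differences on a shell of width `r` (where `|δK| ≲ A r^{−d}`).
[folklore] -/
private theorem commLap_le {r : ℕ} (hr : 4 ≤ r) (hN : 4 * r + 6 ≤ P.sitesPerDir 0) (y₀ : Balaban1983to89.Site P 0)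
    (K ψ : Balaban1983to89.Site P 0 → ℂ) {A S : ℝ} (hA : 0 ≤ A) (hS : 0 ≤ S)
    (hK1 : ∀ z, ‖K z‖ ≤ A / (max (supDist y₀ z : ℝ) 1) ^ (P.d - 1))
    (hK2 : ∀ z ν, ‖K (z.shift ν) - K z‖ ≤ A / (max (supDist y₀ z : ℝ) 1) ^ P.d)
    (hψS : ∀ z, supDist y₀ z ≤ 2 * r + 1 → ‖ψ z‖ ≤ S) :
    ‖∑ z : Balaban1983to89.Site P 0, (∑ μ : Fin P.d,
        ((((chi y₀ r (z.shift μ) : ℝ) : ℂ) - ((chi y₀ r z : ℝ) : ℂ)) * K (z.shift μ) +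
          (((chi y₀ r (z.unshift μ) : ℝ) : ℂ) - ((chi y₀ r z : ℝ) : ℂ)) * K (z.unshift μ))) * ψ z‖ ≤
      P.d * (A * S * (8 * 9 ^ (P.d - 1) + 2 * 10 ^ P.d) / r) := by
  classical
  have hr1 : 1 ≤ r := by omega
  have hr0 : (0 : ℝ) < r := by exact_mod_cast (show 0 < r by omega)
  have hrr : (r : ℝ) / 2 ≤ ((r - 2 : ℕ) : ℝ) := by
    have : ((r - 2 : ℕ) : ℝ) = r - 2 := by rw [Nat.cast_sub (by omega)]; norm_num
    rw [this]; have : (4 : ℝ) ≤ r := by exact_mod_cast hr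
    linarith
  -- reduce to one direction
  have hμ : ∀ μ : Fin P.d, ∑ z : Balaban1983to89.Site P 0,
      ‖((((chi y₀ r (z.shift μ) : ℝ) : ℂ) - ((chi y₀ r z : ℝ) : ℂ)) * K (z.shift μ) +
          (((chi y₀ r (z.unshift μ) : ℝ) : ℂ) - ((chi y₀ r z : ℝ) : ℂ)) * K (z.unshift μ))‖ * ‖ψ z‖ ≤
      A * S * (8 * 9 ^ (P.d - 1) + 2 * 10 ^ P.d) / r := by
    intro μ
    -- summation by parts: `(χ⁺−χ)K⁺ + (χ⁻−χ)K⁻ = (χ⁺ − 2χ + χ⁻)K⁺ + (χ − χ⁻)(K⁺ − K⁻)`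
    set q1 : Balaban1983to89.Site P 0 → ℝ := fun z =>
      |chi y₀ r (z.shift μ) - 2 * chi y₀ r z + chi y₀ r (z.unshift μ)| * ‖K (z.shift μ)‖ * ‖ψ z‖ with hq1
    set q2 : Balaban1983to89.Site P 0 → ℝ := fun z =>
      |chi y₀ r z - chi y₀ r (z.unshift μ)| * (‖K (z.shift μ) - K z‖ + ‖K ((z.unshift μ).shift μ) - K (z.unshift μ)‖) * ‖ψ z‖ with hq2
    have hzs : ∀ z : Balaban1983to89.Site P 0, (z.unshift μ).shift μ = z := fun z => (LatticeFieldCalculus.shiftEquiv μ).right_inv z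
    have hpt : ∀ z, ‖((((chi y₀ r (z.shift μ) : ℝ) : ℂ) - ((chi y₀ r z : ℝ) : ℂ)) * K (z.shift μ) +
        (((chi y₀ r (z.unshift μ) : ℝ) : ℂ) - ((chi y₀ r z : ℝ) : ℂ)) * K (z.unshift μ))‖ * ‖ψ z‖ ≤ q1 z + q2 z := by
      intro z
      have e : (((chi y₀ r (z.shift μ) : ℝ) : ℂ) - ((chi y₀ r z : ℝ) : ℂ)) * K (z.shift μ) +
          (((chi y₀ r (z.unshift μ) : ℝ) : ℂ) - ((chi y₀ r z : ℝ) : ℂ)) * K (z.unshift μ) =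
          (((chi y₀ r (z.shift μ) - 2 * chi y₀ r z + chi y₀ r (z.unshift μ) : ℝ) : ℂ)) * K (z.shift μ) +
            ((chi y₀ r z - chi y₀ r (z.unshift μ) : ℝ) : ℂ) * (K (z.shift μ) - K ((z.unshift μ).shift μ) +
              (K ((z.unshift μ).shift μ) - K (z.unshift μ))) := by
        rw [hzs]; push_cast; ring
      rw [e]
      have h1 : ‖(((chi y₀ r (z.shift μ) - 2 * chi y₀ r z + chi y₀ r (z.unshift μ) : ℝ) : ℂ)) * K (z.shift μ)‖ =
          |chi y₀ r (z.shift μ) - 2 * chi y₀ r z + chi y₀ r (z.unshift μ)| * ‖K (z.shift μ)‖ := by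
        rw [norm_mul, Complex.norm_real, Real.norm_eq_abs]
      have h2 : ‖((chi y₀ r z - chi y₀ r (z.unshift μ) : ℝ) : ℂ) * (K (z.shift μ) - K ((z.unshift μ).shift μ) +
          (K ((z.unshift μ).shift μ) - K (z.unshift μ)))‖ ≤
          |chi y₀ r z - chi y₀ r (z.unshift μ)| * (‖K (z.shift μ) - K z‖ + ‖K ((z.unshift μ).shift μ) - K (z.unshift μ)‖) := by
        rw [norm_mul, Complex.norm_real, Real.norm_eq_abs]
        refine mul_le_mul_of_nonneg_left ((norm_add_le _ _).trans (by rw [hzs])) (abs_nonneg _)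
      calc _ ≤ (‖(((chi y₀ r (z.shift μ) - 2 * chi y₀ r z + chi y₀ r (z.unshift μ) : ℝ) : ℂ)) * K (z.shift μ)‖ +
            ‖((chi y₀ r z - chi y₀ r (z.unshift μ) : ℝ) : ℂ) * (K (z.shift μ) - K ((z.unshift μ).shift μ) +
              (K ((z.unshift μ).shift μ) - K (z.unshift μ)))‖) * ‖ψ z‖ :=
            mul_le_mul_of_nonneg_right (norm_add_le _ _) (norm_nonneg _)
        _ ≤ (|chi y₀ r (z.shift μ) - 2 * chi y₀ r z + chi y₀ r (z.unshift μ)| * ‖K (z.shift μ)‖ +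
            |chi y₀ r z - chi y₀ r (z.unshift μ)| * (‖K (z.shift μ) - K z‖ + ‖K ((z.unshift μ).shift μ) - K (z.unshift μ)‖)) * ‖ψ z‖ := by
            rw [h1]; gcongr
        _ = q1 z + q2 z := by simp only [hq1, hq2]; ring
    -- the kink slabs
    set Sl : Finset (Balaban1983to89.Site P 0) := slab y₀ (2 * r) μ r ∪ slab y₀ (2 * r) μ (2 * r) with hSl
    have hB1 : (0 : ℝ) ≤ 2 / r * (A * (2 / r) ^ (P.d - 1)) * S := by positivity
    have hq1pt : ∀ z, q1 z ≤ if z ∈ Sl then 2 / r * (A * (2 / r) ^ (P.d - 1)) * S else 0 := by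
      intro z
      split_ifs with hz
      · have hz' : supDist y₀ z ≤ 2 * r ∧ (cdist (z μ - y₀ μ) = r ∨ cdist (z μ - y₀ μ) = 2 * r) := by
          rw [hSl, mem_union, mem_slab, mem_slab] at hz
          rcases hz with h | h
          · exact ⟨h.1, Or.inl h.2⟩
          · exact ⟨h.1, Or.inr h.2⟩
        have hTz : r ≤ supDist y₀ z := by
          have h1 : cdist (z μ - y₀ μ) ≤ supDist y₀ z := by rw [cdist_sub_comm]; exact cdist_le_supDist y₀ z μ
          rcases hz'.2 with h | h <;> omega
        have hT' : (r : ℝ) / 2 ≤ (supDist y₀ (z.shift μ) : ℝ) := by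
          have := supDist_le_shift_succ y₀ z μ
          have h4 : ((r : ℕ) : ℝ) ≤ (supDist y₀ (z.shift μ) : ℕ) + 1 := by exact_mod_cast (hTz.trans this)
          have : (4 : ℝ) ≤ r := by exact_mod_cast hr
          linarith
        have hKs : ‖K (z.shift μ)‖ ≤ A * (2 / r) ^ (P.d - 1) := (hK1 _).trans (env_far hr0 hT' _ hA)
        have hdd := abs_chi_second_diff_le hr1 hN y₀ z μ
        have hψz := hψS z (by omega)
        simp only [hq1]
        gcongr
      · have h0 : chi y₀ r (z.shift μ) - 2 * chi y₀ r z + chi y₀ r (z.unshift μ) = 0 := by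
          by_contra h0
          have h1 := cdist_eq_of_chi_second_diff_ne_zero hr1 hN h0
          have h2 := supDist_le_of_chi_second_diff_ne_zero hr1 h0
          apply hz
          rw [hSl, mem_union, mem_slab, mem_slab]
          rcases h1 with h | h
          · exact Or.inl ⟨h2, h⟩
          · exact Or.inr ⟨h2, h⟩
        simp only [hq1]; rw [h0]; simp
    have hcardSl : (Sl.card : ℝ) ≤ 4 * (4 * r + 1) ^ (P.d - 1) := by
      have h1 := card_slab_le y₀ (2 * r) μ r
      have h2 := card_slab_le y₀ (2 * r) μ (2 * r)
      have h3 := Finset.card_union_le (slab y₀ (2 * r) μ r) (slab y₀ (2 * r) μ (2 * r))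
      have e : 2 * (2 * r) + 1 = 4 * r + 1 := by ring
      rw [e] at h1 h2
      have : Sl.card ≤ 4 * (4 * r + 1) ^ (P.d - 1) := by rw [hSl]; omega
      exact_mod_cast this
    have hsum1 : ∑ z, q1 z ≤ 8 * 9 ^ (P.d - 1) * A * S / r := by
      calc ∑ z, q1 z ≤ ∑ z, (if z ∈ Sl then 2 / r * (A * (2 / r) ^ (P.d - 1)) * S else 0) := sum_le_sum fun z _ => hq1pt z
        _ = Sl.card * (2 / r * (A * (2 / r) ^ (P.d - 1)) * S) := by
            rw [← sum_filter, Finset.filter_mem_eq_inter, univ_inter, sum_const, nsmul_eq_mul]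
        _ ≤ (4 * (4 * r + 1) ^ (P.d - 1)) * (2 / r * (A * (2 / r) ^ (P.d - 1)) * S) := mul_le_mul_of_nonneg_right hcardSl hB1
        _ = 8 * ((2 / r) * (4 * r + 1)) ^ (P.d - 1) * A * S / r := by rw [mul_pow]; ring
        _ ≤ 8 * 9 ^ (P.d - 1) * A * S / r := by
            have h9 : (2 / r) * (4 * (r : ℝ) + 1) ≤ 9 := by
              have h4 : (4 : ℝ) ≤ r := by exact_mod_cast hr
              rw [div_mul_eq_mul_div, div_le_iff₀ hr0]; linarith
            have h9' : (0 : ℝ) ≤ (2 / r) * (4 * (r : ℝ) + 1) := by positivity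
            gcongr
    -- the gradient shell
    have hB2 : (0 : ℝ) ≤ 1 / r * (A * (2 / r) ^ P.d + A * (2 / r) ^ P.d) * S := by positivity
    have hq2pt : ∀ z, q2 z ≤ if z ∈ ball y₀ (2 * r + 1) then 1 / r * (A * (2 / r) ^ P.d + A * (2 / r) ^ P.d) * S else 0 := by
      intro z
      by_cases hne : chi y₀ r z = chi y₀ r (z.unshift μ)
      · have : q2 z = 0 := by simp only [hq2]; rw [hne, sub_self, abs_zero, zero_mul, zero_mul]
        rw [this]; split_ifs <;> [exact hB2; exact le_rfl]
      · have hne' : chi y₀ r ((z.unshift μ).shift μ) ≠ chi y₀ r (z.unshift μ) := by rw [hzs]; exact hne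
        have h1 := le_supDist_of_chi_shift_ne hr1 hN hne'
        have h2 := supDist_le_of_chi_shift_ne hr1 hne'
        have h3 := supDist_unshift_le_succ y₀ z μ
        have h4 : supDist y₀ z ≤ supDist y₀ (z.unshift μ) + 1 := by
          have := supDist_shift_le_succ y₀ (z.unshift μ) μ; rwa [hzs] at this
        have hzb : z ∈ ball y₀ (2 * r + 1) := by rw [mem_ball]; omega
        rw [if_pos hzb]
        have hT1 : (r : ℝ) / 2 ≤ (supDist y₀ z : ℝ) := by
          have : ((r - 2 : ℕ) : ℝ) ≤ (supDist y₀ z : ℕ) := by exact_mod_cast (show r - 2 ≤ supDist y₀ z by omega)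
          exact hrr.trans this
        have hT2 : (r : ℝ) / 2 ≤ (supDist y₀ (z.unshift μ) : ℝ) := by
          have : ((r - 2 : ℕ) : ℝ) ≤ (supDist y₀ (z.unshift μ) : ℕ) := by exact_mod_cast (show r - 2 ≤ supDist y₀ (z.unshift μ) by omega)
          exact hrr.trans this
        have hKa : ‖K (z.shift μ) - K z‖ ≤ A * (2 / r) ^ P.d := (hK2 z μ).trans (env_far hr0 hT1 _ hA)
        have hKb : ‖K ((z.unshift μ).shift μ) - K (z.unshift μ)‖ ≤ A * (2 / r) ^ P.d := (hK2 _ μ).trans (env_far hr0 hT2 _ hA)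
        have hdχ : |chi y₀ r z - chi y₀ r (z.unshift μ)| ≤ 1 / r := by
          have := abs_chi_shift_sub_le hr1 hN y₀ (z.unshift μ) μ; rwa [hzs] at this
        have hψz := hψS z (by omega)
        simp only [hq2]
        gcongr
    have hcardB : ((ball y₀ (2 * r + 1)).card : ℝ) ≤ (4 * r + 3) ^ P.d := by
      have := card_ball_le y₀ (2 * r + 1)
      have e : 2 * (2 * r + 1) + 1 = 4 * r + 3 := by ring
      rw [e] at this; exact_mod_cast this
    have hsum2 : ∑ z, q2 z ≤ 2 * 10 ^ P.d * A * S / r := by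
      calc ∑ z, q2 z ≤ ∑ z, (if z ∈ ball y₀ (2 * r + 1) then 1 / r * (A * (2 / r) ^ P.d + A * (2 / r) ^ P.d) * S else 0) :=
            sum_le_sum fun z _ => hq2pt z
        _ = (ball y₀ (2 * r + 1)).card * (1 / r * (A * (2 / r) ^ P.d + A * (2 / r) ^ P.d) * S) := by
            rw [← sum_filter, Finset.filter_mem_eq_inter, univ_inter, sum_const, nsmul_eq_mul]
        _ ≤ (4 * r + 3) ^ P.d * (1 / r * (A * (2 / r) ^ P.d + A * (2 / r) ^ P.d) * S) := mul_le_mul_of_nonneg_right hcardB hB2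
        _ = 2 * ((2 / r) * (4 * r + 3)) ^ P.d * A * S / r := by rw [mul_pow]; ring
        _ ≤ 2 * 10 ^ P.d * A * S / r := by
            have h10 : (2 / r) * (4 * (r : ℝ) + 3) ≤ 10 := by
              have h4 : (4 : ℝ) ≤ r := by exact_mod_cast hr
              rw [div_mul_eq_mul_div, div_le_iff₀ hr0]; linarith
            have h10' : (0 : ℝ) ≤ (2 / r) * (4 * (r : ℝ) + 3) := by positivity
            gcongr
    calc _ ≤ ∑ z, (q1 z + q2 z) := sum_le_sum fun z _ => hpt z
      _ = ∑ z, q1 z + ∑ z, q2 z := sum_add_distrib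
      _ ≤ 8 * 9 ^ (P.d - 1) * A * S / r + 2 * 10 ^ P.d * A * S / r := add_le_add hsum1 hsum2
      _ = A * S * (8 * 9 ^ (P.d - 1) + 2 * 10 ^ P.d) / r := by ring
  -- sum over the directions
  calc _ ≤ ∑ z : Balaban1983to89.Site P 0, ‖(∑ μ : Fin P.d,
        ((((chi y₀ r (z.shift μ) : ℝ) : ℂ) - ((chi y₀ r z : ℝ) : ℂ)) * K (z.shift μ) +
          (((chi y₀ r (z.unshift μ) : ℝ) : ℂ) - ((chi y₀ r z : ℝ) : ℂ)) * K (z.unshift μ)))‖ * ‖ψ z‖ :=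
        (norm_sum_le _ _).trans (sum_le_sum fun z _ => (norm_mul_le _ _))
    _ ≤ ∑ z : Balaban1983to89.Site P 0, ∑ μ : Fin P.d, ‖((((chi y₀ r (z.shift μ) : ℝ) : ℂ) - ((chi y₀ r z : ℝ) : ℂ)) * K (z.shift μ) +
          (((chi y₀ r (z.unshift μ) : ℝ) : ℂ) - ((chi y₀ r z : ℝ) : ℂ)) * K (z.unshift μ))‖ * ‖ψ z‖ := by
        refine sum_le_sum fun z _ => ?_
        rw [← sum_mul]
        exact mul_le_mul_of_nonneg_right (norm_sum_le _ _) (norm_nonneg _)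
    _ = ∑ μ : Fin P.d, ∑ z : Balaban1983to89.Site P 0, ‖((((chi y₀ r (z.shift μ) : ℝ) : ℂ) - ((chi y₀ r z : ℝ) : ℂ)) * K (z.shift μ) +
          (((chi y₀ r (z.unshift μ) : ℝ) : ℂ) - ((chi y₀ r z : ℝ) : ℂ)) * K (z.unshift μ))‖ * ‖ψ z‖ := sum_comm
    _ ≤ ∑ _μ : Fin P.d, A * S * (8 * 9 ^ (P.d - 1) + 2 * 10 ^ P.d) / r := sum_le_sum fun μ _ => hμ μ
    _ = _ := by rw [sum_const, card_univ, Fintype.card_fin, nsmul_eq_mul]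

/-- **THE BLOCK PART OF THE COMMUTATOR**: with `‖ψ‖ ≤ S` on the ball `T ≤ 2r + L^k` (the blocks meeting the support of `χ`) and `a′ = α_kL^{kd}`,
`‖Σ_z a′(χ(z)(Q_1ᴴQ_1K)(z) − (Q_1ᴴQ_1(χK))(z))ψ(z)‖ ≤ α_kSA((1 + 2d3^{d−1}(2r + L^k)) + (1 + 2d3^{d−1}2r))` — no cancellation is used,
each block average is swapped onto the kernel envelope. [folklore] -/
private theorem commQ_le (hd : 1 ≤ P.d) {a : ℝ} {k : ℕ} (hk : k ≤ P.m + P.K) (hα : 0 ≤ B1RG242Torus.α P a k) {r : ℕ} (hr : 1 ≤ r)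
    (y₀ : Balaban1983to89.Site P 0) (K ψ : Balaban1983to89.Site P 0 → ℂ) {A S : ℝ} (hA : 0 ≤ A) (hS : 0 ≤ S)
    (hK1 : ∀ z, ‖K z‖ ≤ A / (max (supDist y₀ z : ℝ) 1) ^ (P.d - 1))
    (hψS : ∀ z, supDist y₀ z ≤ 2 * r + P.L ^ k → ‖ψ z‖ ≤ S) :
    ‖∑ z : Balaban1983to89.Site P 0, (((B1RG242Torus.α P a k * (P.L : ℝ) ^ (k * P.d) : ℝ) : ℂ) *
        (((chi y₀ r z : ℝ) : ℂ) * ((((qMatK (1 : GaugeField P 0 U1) k univ)ᴴ * qMatK (1 : GaugeField P 0 U1) k univ)) *ᵥ K) z -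
          ((((qMatK (1 : GaugeField P 0 U1) k univ)ᴴ * qMatK (1 : GaugeField P 0 U1) k univ)) *ᵥ
            fun w => ((chi y₀ r w : ℝ) : ℂ) * K w) z)) * ψ z‖ ≤
      B1RG242Torus.α P a k * S * (A * (1 + 2 * P.d * 3 ^ (P.d - 1) * (2 * r + P.L ^ k : ℕ)) +
        A * (1 + 2 * P.d * 3 ^ (P.d - 1) * (2 * r : ℕ))) := by
  classical
  set a' : ℝ := B1RG242Torus.α P a k * (P.L : ℝ) ^ (k * P.d) with ha'def
  set QQ := B1RG242Torus.Qks P k * B1RG242Torus.Qk P k with hQQ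
  set Q1 := (qMatK (1 : GaugeField P 0 U1) k univ)ᴴ * qMatK (1 : GaugeField P 0 U1) k univ with hQ1
  have ha' : 0 ≤ a' := mul_nonneg hα (pow_nonneg P.cast_L_pos.le _)
  set nK : Balaban1983to89.Site P 0 → ℝ := fun w => ‖K w‖ with hnK
  set nKχ : Balaban1983to89.Site P 0 → ℝ := fun w => chi y₀ r w * ‖K w‖ with hnKχ
  -- pointwise: `a′‖Q1 g‖ ≤ α (QQ ‖g‖)`
  have hQ : ∀ (g : Balaban1983to89.Site P 0 → ℂ) z, a' * ‖(Q1 *ᵥ g) z‖ ≤ B1RG242Torus.α P a k * (QQ *ᵥ fun w => ‖g w‖) z := by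
    intro g z
    have h1 := norm_gram_qMatK_mulVec_le hk (1 : GaugeField P 0 U1) g z
    have hN : 0 < (P.L : ℝ) ^ (k * P.d) := pow_pos P.cast_L_pos _
    calc a' * ‖(Q1 *ᵥ g) z‖ ≤ a' * (((P.L : ℝ) ^ (k * P.d))⁻¹ * (QQ *ᵥ fun w => ‖g w‖) z) := mul_le_mul_of_nonneg_left h1 ha'
      _ = B1RG242Torus.α P a k * (QQ *ᵥ fun w => ‖g w‖) z := by rw [ha'def]; field_simp
  have hQQnn : ∀ (v : Balaban1983to89.Site P 0 → ℝ), (∀ w, 0 ≤ v w) → ∀ z, 0 ≤ (QQ *ᵥ v) z := fun v hv z => by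
    rw [hQQ, towerQQ_apply_blockK hk]; exact mul_nonneg (by positivity) (sum_nonneg fun w _ => hv w)
  -- part (i): `Σ_z a′χ‖Q1K‖‖ψ‖ ≤ αS Σ_{z ∈ ball 2r} (QQ‖K‖)(z) ≤ αS Σ_{T(w) ≤ 2r+L^k} ‖K w‖`
  have hpart1 : ∑ z, a' * (chi y₀ r z * ‖(Q1 *ᵥ K) z‖) * ‖ψ z‖ ≤
      B1RG242Torus.α P a k * S * (A * (1 + 2 * P.d * 3 ^ (P.d - 1) * (2 * r + P.L ^ k : ℕ))) := by
    have hpt : ∀ z, a' * (chi y₀ r z * ‖(Q1 *ᵥ K) z‖) * ‖ψ z‖ ≤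
        B1RG242Torus.α P a k * S * (if z ∈ ball y₀ (2 * r) then (QQ *ᵥ nK) z else 0) := by
      intro z
      have hχ0 := chi_nonneg y₀ r z
      by_cases h0 : chi y₀ r z = 0
      · rw [h0, zero_mul, mul_zero, zero_mul]; split_ifs <;> [exact mul_nonneg (mul_nonneg hα hS) (hQQnn _ (fun w => norm_nonneg _) z); simp]
      · have hT := supDist_lt_of_chi_ne_zero hr h0
        rw [if_pos (mem_ball.2 hT.le)]
        have hψz := hψS z (by omega)
        have hχ1 := chi_le_one hr y₀ z
        calc a' * (chi y₀ r z * ‖(Q1 *ᵥ K) z‖) * ‖ψ z‖ ≤ a' * (1 * ‖(Q1 *ᵥ K) z‖) * S := by gcongr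
          _ = (a' * ‖(Q1 *ᵥ K) z‖) * S := by ring
          _ ≤ (B1RG242Torus.α P a k * (QQ *ᵥ nK) z) * S := mul_le_mul_of_nonneg_right (hQ K z) hS
          _ = _ := by ring
    refine (sum_le_sum fun z _ => hpt z).trans ?_
    rw [← mul_sum, ← sum_filter, Finset.filter_mem_eq_inter, univ_inter]
    refine mul_le_mul_of_nonneg_left ?_ (mul_nonneg hα hS)
    refine (sum_towerQQ_le hk nK (fun w => norm_nonneg _) _).trans ?_
    refine radial_env_one hd y₀ (2 * r + P.L ^ k) hA _ (fun w _ => ?_) (fun w hw => ?_)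
    · split_ifs
      · exact hK1 w
      · positivity
    · rw [if_neg]
      rintro ⟨x, hx, hxw⟩
      rw [mem_ball] at hx
      have h1 := supDist_le_of_blkIter_eq' hk hxw
      have h2 := BIJ85Ineq722Torus.supDist_triangle y₀ x w
      omega
  -- part (ii): `Σ_z a′‖Q1(χK)‖‖ψ‖ ≤ αS Σ_z (QQ(χ‖K‖))(z) ≤ αS Σ_w χ‖K‖`
  have hpart2 : ∑ z, a' * ‖(Q1 *ᵥ fun w => ((chi y₀ r w : ℝ) : ℂ) * K w) z‖ * ‖ψ z‖ ≤
      B1RG242Torus.α P a k * S * (A * (1 + 2 * P.d * 3 ^ (P.d - 1) * (2 * r : ℕ))) := by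
    have hnn : ∀ w, 0 ≤ nKχ w := fun w => mul_nonneg (chi_nonneg y₀ r w) (norm_nonneg _)
    have hnorm : (fun w => ‖((chi y₀ r w : ℝ) : ℂ) * K w‖) = nKχ := by
      funext w; rw [hnKχ, norm_mul, Complex.norm_real, Real.norm_of_nonneg (chi_nonneg y₀ r w)]
    have hpt : ∀ z, a' * ‖(Q1 *ᵥ fun w => ((chi y₀ r w : ℝ) : ℂ) * K w) z‖ * ‖ψ z‖ ≤ B1RG242Torus.α P a k * S * (QQ *ᵥ nKχ) z := by
      intro z
      have h1 := hQ (fun w => ((chi y₀ r w : ℝ) : ℂ) * K w) z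
      rw [hnorm] at h1
      by_cases hz : (QQ *ᵥ nKχ) z = 0
      · rw [hz] at h1 ⊢
        have : a' * ‖(Q1 *ᵥ fun w => ((chi y₀ r w : ℝ) : ℂ) * K w) z‖ = 0 :=
          le_antisymm (by simpa using h1) (mul_nonneg ha' (norm_nonneg _))
        rw [this, zero_mul, mul_zero]
      · -- some site of the block of `z` carries `χ ≠ 0`, so `T(z) ≤ 2r − 1 + L^k`
        have hex : ∃ w ∈ blockK k (blkIter k z), nKχ w ≠ 0 := by
          by_contra hno
          push Not at hno
          apply hz
          rw [hQQ, towerQQ_apply_blockK hk, sum_eq_zero hno, mul_zero]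
        obtain ⟨w, hw, hw0⟩ := hex
        have hχw : chi y₀ r w ≠ 0 := fun h => hw0 (by rw [hnKχ]; simp [h])
        have hTw := supDist_lt_of_chi_ne_zero hr hχw
        have hzw : supDist w z ≤ P.L ^ k := supDist_le_of_blkIter_eq' hk (mem_blockK.1 hw)
        have hTz : supDist y₀ z ≤ 2 * r + P.L ^ k := by
          have := BIJ85Ineq722Torus.supDist_triangle y₀ w z; omega
        have hψz := hψS z hTz
        calc a' * ‖(Q1 *ᵥ fun w => ((chi y₀ r w : ℝ) : ℂ) * K w) z‖ * ‖ψ z‖ ≤ (B1RG242Torus.α P a k * (QQ *ᵥ nKχ) z) * S :=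
              mul_le_mul h1 hψz (norm_nonneg _) (mul_nonneg hα (hQQnn _ hnn z))
          _ = _ := by ring
    refine (sum_le_sum fun z _ => hpt z).trans ?_
    rw [← mul_sum]
    refine mul_le_mul_of_nonneg_left ?_ (mul_nonneg hα hS)
    have h2 := sum_towerQQ_le hk nKχ hnn univ
    rw [show (∑ x ∈ (univ : Finset (Balaban1983to89.Site P 0)), (QQ *ᵥ nKχ) x) = ∑ x, (QQ *ᵥ nKχ) x from rfl] at h2
    refine h2.trans ?_
    refine radial_env_one hd y₀ (2 * r) hA _ (fun w _ => ?_) (fun w hw => ?_)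
    · have hχ1 := chi_le_one hr y₀ w
      have hχ0 := chi_nonneg y₀ r w
      split_ifs
      · calc nKχ w = chi y₀ r w * ‖K w‖ := rfl
          _ ≤ 1 * (A / (max (supDist y₀ w : ℝ) 1) ^ (P.d - 1)) := by gcongr; exact hK1 w
          _ = _ := one_mul _
      · positivity
    · have h0 : chi y₀ r w = 0 := by
        by_contra h0; have := supDist_lt_of_chi_ne_zero hr h0; omega
      split_ifs
      · show chi y₀ r w * ‖K w‖ ≤ 0
        rw [h0, zero_mul]
      · exact le_rfl
  -- combine
  have hpt : ∀ z, ‖((a' : ℝ) : ℂ) * (((chi y₀ r z : ℝ) : ℂ) * (Q1 *ᵥ K) z - (Q1 *ᵥ fun w => ((chi y₀ r w : ℝ) : ℂ) * K w) z) * ψ z‖ ≤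
      a' * (chi y₀ r z * ‖(Q1 *ᵥ K) z‖) * ‖ψ z‖ + a' * ‖(Q1 *ᵥ fun w => ((chi y₀ r w : ℝ) : ℂ) * K w) z‖ * ‖ψ z‖ := by
    intro z
    rw [norm_mul, norm_mul, Complex.norm_real, Real.norm_of_nonneg ha']
    have h := norm_sub_le (((chi y₀ r z : ℝ) : ℂ) * (Q1 *ᵥ K) z) ((Q1 *ᵥ fun w => ((chi y₀ r w : ℝ) : ℂ) * K w) z)
    rw [norm_mul, Complex.norm_real, Real.norm_of_nonneg (chi_nonneg y₀ r z)] at h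
    calc a' * ‖((chi y₀ r z : ℝ) : ℂ) * (Q1 *ᵥ K) z - (Q1 *ᵥ fun w => ((chi y₀ r w : ℝ) : ℂ) * K w) z‖ * ‖ψ z‖
        ≤ a' * (chi y₀ r z * ‖(Q1 *ᵥ K) z‖ + ‖(Q1 *ᵥ fun w => ((chi y₀ r w : ℝ) : ℂ) * K w) z‖) * ‖ψ z‖ := by gcongr
      _ = _ := by ring
  calc _ ≤ ∑ z, (a' * (chi y₀ r z * ‖(Q1 *ᵥ K) z‖) * ‖ψ z‖ + a' * ‖(Q1 *ᵥ fun w => ((chi y₀ r w : ℝ) : ℂ) * K w) z‖ * ‖ψ z‖) :=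
        (norm_sum_le _ _).trans (sum_le_sum fun z _ => hpt z)
    _ = _ := sum_add_distrib
    _ ≤ _ := add_le_add hpart1 hpart2
    _ = _ := by ring

set_option maxHeartbeats 400000 in
/-- **THE LOCAL INTERIOR GRADIENT ESTIMATE AT ONE BOND** (our device for the covariant-derivative member of [7] (1.10); divergence of method
from [7]'s random-walk expansion disclosed in the module docstring).  Data: a `U(1)` field `u` on `T^{(0)}` whose bond variables deviate from
`1` at most LINEARLY in the sup-distance from `y₀` on the ball of radius `2r` (`|u_{z,μ} − 1| ≤ γ|y₀ − z|_∞`; the centred axial gauge of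
`BIJ85CentredAxialGauge` produces this with `γ = (d−1)θ`), a solution `ψ` of `N(u)ψ = f′` for the whole-torus operator
`N(u) = D_u^*D_u + α_kL^{kd}Q_k(u)^*Q_k(u)` of (4.6.2), local bounds `‖ψ‖ ≤ S` (ball `2r + L^k + 1`), `‖u_bψ(b₊) − ψ(b₋)‖ ≤ M` and `‖f′‖ ≤ F`
(ball `2r`), and the flat kernel envelopes of `BIJ85FlatPropagatorKernelDiffs` with constant `C_K`.  Conclusion, `r ≥ 4`, `4r + 6 ≤ sitesPerDir`:
`‖ψ(y₀+e_{μ₀}) − ψ(y₀)‖ ≤ C(d, C_K)·(Fε²r + γr²M + γrS + S/r + α_kε²(r + L^k)S)`. [cite: BalabanImbrieJaffe1985, (4.6.2) p.313] -/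
theorem local_gradient_bound (dd : ℕ) (hdd : 1 ≤ dd) (C_K : ℝ) (hCK : 0 ≤ C_K) :
    ∃ C : ℝ, 0 < C ∧ ∀ (P : Params), P.d = dd → ∀ {a : ℝ}, 0 < a → ∀ {k : ℕ}, 1 ≤ k → k ≤ P.K →
      ∀ {r : ℕ}, 4 ≤ r → 4 * r + 6 ≤ P.sitesPerDir 0 →
      ∀ (y₀ : Balaban1983to89.Site P 0) (μ₀ : Fin P.d) (U : GaugeField P 0 U1) (ψ f' : Balaban1983to89.Site P 0 → ℂ),
        nOp (B1RG242Torus.α P a k * (P.L : ℝ) ^ (k * P.d)) P.eps⁻¹ U k univ *ᵥ ψ = f' →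
      ∀ {γ S Mloc Floc : ℝ}, 0 ≤ γ → 0 ≤ S → 0 ≤ Mloc → 0 ≤ Floc →
        (∀ z, |(B1RG242Torus.tower P a 0).G k (y₀.shift μ₀) z - (B1RG242Torus.tower P a 0).G k y₀ z| ≤
            C_K * P.eps ^ 2 / (max (supDist y₀ z : ℝ) 1) ^ (P.d - 1)) →
        (∀ (ν : Fin P.d) z, |(B1RG242Torus.tower P a 0).G k (y₀.shift μ₀) (z.shift ν) - (B1RG242Torus.tower P a 0).G k (y₀.shift μ₀) z
            - (B1RG242Torus.tower P a 0).G k y₀ (z.shift ν) + (B1RG242Torus.tower P a 0).G k y₀ z| ≤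
            C_K * P.eps ^ 2 / (max (supDist y₀ z : ℝ) 1) ^ P.d) →
        (∀ z μ, supDist y₀ z ≤ 2 * r → ‖cfg U ⟨z, μ⟩ - 1‖ ≤ γ * supDist y₀ z) →
        (∀ z, supDist y₀ z ≤ 2 * r + P.L ^ k + 1 → ‖ψ z‖ ≤ S) →
        (∀ z μ, supDist y₀ z ≤ 2 * r → ‖cfg U ⟨z, μ⟩ * ψ (z.shift μ) - ψ z‖ ≤ Mloc) →
        (∀ z, supDist y₀ z ≤ 2 * r → ‖f' z‖ ≤ Floc) →
        ‖ψ (y₀.shift μ₀) - ψ y₀‖ ≤ C * (Floc * P.eps ^ 2 * r + γ * r ^ 2 * Mloc + γ * r * S + S / r +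
          B1RG242Torus.α P a k * P.eps ^ 2 * (r + P.L ^ k) * S) := by
  -- the constant
  set s₁ : ℝ := 2 * dd * 3 ^ (dd - 1) with hs₁
  have hs₁0 : 0 ≤ s₁ := by positivity
  set cF : ℝ := 1 + 2 * s₁ with hcF
  set cM : ℝ := dd * (4 * s₁) with hcM
  set cγ : ℝ := dd * (4 * s₁ * 2 ^ (dd - 1) + (1 + 2 * s₁)) with hcγ
  set cr : ℝ := dd * (8 * 9 ^ (dd - 1) + 2 * 10 ^ dd) with hcr
  set cα : ℝ := 4 + 8 * s₁ with hcα
  have hcF0 : 0 ≤ cF := by rw [hcF]; positivity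
  have hcM0 : 0 ≤ cM := by rw [hcM]; positivity
  have hcγ0 : 0 ≤ cγ := by rw [hcγ]; positivity
  have hcr0 : 0 ≤ cr := by rw [hcr]; positivity
  have hcα0 : 0 ≤ cα := by rw [hcα]; positivity
  refine ⟨C_K * (cF + cM + cγ + cr + cα) + 1, by positivity, ?_⟩
  intro P hPd a ha k hk1 hkK r hr hN y₀ μ₀ U ψ f' hψ γ S Mloc Floc hγ hS hMloc hFloc hK1 hK2 hgauge hSψ hM hF
  subst hPd
  -- basic quantities
  have hd : 1 ≤ P.d := hdd
  have hk : k ≤ P.m + P.K := hkK.trans (Nat.le_add_left _ _)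
  have hr1 : 1 ≤ r := by omega
  have hr0 : (0 : ℝ) < r := by exact_mod_cast (show 0 < r by omega)
  have hε : 0 < P.eps := P.eps_pos
  have hLpos : (0 : ℝ) < P.L := P.cast_L_pos
  have hn : (0 : ℝ) < (P.L : ℝ) ^ k := pow_pos hLpos k
  have hα : 0 < B1RG242Torus.α P a k :=
    mul_pos (B1.aSeq_pos ha (B1RG242Torus.one_lt_cast_L P) hk1) (inv_pos.2 (pow_pos (P.spacing_pos k) 2))
  set a' : ℝ := B1RG242Torus.α P a k * (P.L : ℝ) ^ (k * P.d) with ha'def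
  set A : ℝ := C_K * P.eps ^ 2 with hAdef
  have hA : 0 ≤ A := by positivity
  set Gf := gBox a' P.eps⁻¹ (1 : GaugeField P 0 U1) k univ with hGf
  set Nf := nOp a' P.eps⁻¹ (1 : GaugeField P 0 U1) k univ with hNf
  set N' := nOp a' P.eps⁻¹ U k univ with hN'
  set Q1 := (qMatK (1 : GaugeField P 0 U1) k univ)ᴴ * qMatK (1 : GaugeField P 0 U1) k univ with hQ1
  set Qu := (qMatK U k univ)ᴴ * qMatK U k univ with hQu
  set K : Balaban1983to89.Site P 0 → ℂ := fun z => Gf (y₀.shift μ₀) z - Gf y₀ z with hK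
  set χc : Balaban1983to89.Site P 0 → ℂ := fun z => ((chi y₀ r z : ℝ) : ℂ) with hχc
  -- the kernel envelopes, complex form
  have hKz : ∀ z, K z = (((B1RG242Torus.tower P a 0).G k (y₀.shift μ₀) z - (B1RG242Torus.tower P a 0).G k y₀ z : ℝ) : ℂ) := by
    intro z
    simp only [hK, hGf, ha'def, gBox_flat_eq_tower ha hk1 hk, map_apply, Complex.ofRealHom_eq_coe, Complex.ofReal_sub]
  have hK1' : ∀ z, ‖K z‖ ≤ A / (max (supDist y₀ z : ℝ) 1) ^ (P.d - 1) := fun z => by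
    rw [hKz, Complex.norm_real, Real.norm_eq_abs]; exact hK1 z
  have hK2' : ∀ z ν, ‖K (z.shift ν) - K z‖ ≤ A / (max (supDist y₀ z : ℝ) 1) ^ P.d := fun z ν => by
    rw [hKz, hKz, ← Complex.ofReal_sub, Complex.norm_real, Real.norm_eq_abs]
    have e : (B1RG242Torus.tower P a 0).G k (y₀.shift μ₀) (z.shift ν) - (B1RG242Torus.tower P a 0).G k y₀ (z.shift ν) -
        ((B1RG242Torus.tower P a 0).G k (y₀.shift μ₀) z - (B1RG242Torus.tower P a 0).G k y₀ z) =
        (B1RG242Torus.tower P a 0).G k (y₀.shift μ₀) (z.shift ν) - (B1RG242Torus.tower P a 0).G k (y₀.shift μ₀) z -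
          (B1RG242Torus.tower P a 0).G k y₀ (z.shift ν) + (B1RG242Torus.tower P a 0).G k y₀ z := by ring
    rw [e]; exact hK2 ν z
  -- the representation
  have hχ0 : χc y₀ = 1 := by
    simp only [hχc]; rw [chi_eq_one_of_supDist_le (by rw [(supDist_eq_zero_iff y₀ y₀).2 rfl]; exact Nat.zero_le _)]; simp
  have hχ1 : χc (y₀.shift μ₀) = 1 := by
    simp only [hχc]; rw [chi_eq_one_of_supDist_le ((supDist_shift_le_one' y₀ μ₀).trans hr1)]; simp
  have rep := loc_representation ha hk1 hk U ψ f' hψ χc y₀ μ₀ hχ0 hχ1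
  have hu1 : ∀ b : PBond P 0, conj (cfg U b) * cfg U b = 1 := fun b => conj_mul_toC (U b)
  -- (T1) the source term
  have hT1 : ‖∑ z, K z * (χc z * f' z)‖ ≤ Floc * A * (1 + 2 * P.d * 3 ^ (P.d - 1) * (2 * r : ℕ)) :=
    chi_weighted_sum_le hd hr1 y₀ K f' hA hFloc hK1' fun z hz => hF z hz.le
  -- (T2) the perturbation term: `W`-part and block part
  have hW := W_sum_identity (fun z => χc z * K z) ψ (cfg U) hu1
  simp only [hχc] at hW
  have hT2eq : ∑ z, K z * (χc z * ((N' - Nf) *ᵥ ψ) z) =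
      ((P.eps⁻¹ : ℝ) : ℂ) ^ 2 * ∑ μ : Fin P.d, ∑ z : Balaban1983to89.Site P 0,
        ((conj (cfg U ⟨z, μ⟩) - 1) * (((chi y₀ r z : ℝ) : ℂ) * K z) * (cfg U ⟨z, μ⟩ * ψ (z.shift μ) - ψ z) +
          (1 - conj (cfg U ⟨z, μ⟩)) * ((((chi y₀ r (z.shift μ) : ℝ) : ℂ) * K (z.shift μ)) - (((chi y₀ r z : ℝ) : ℂ) * K z)) * ψ z) +
      ∑ z, K z * (((chi y₀ r z : ℝ) : ℂ) * (((a' : ℝ) : ℂ) * ((Qu *ᵥ ψ) z - (Q1 *ᵥ ψ) z))) := by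
    rw [← hW, mul_sum, ← sum_add_distrib]
    refine sum_congr rfl fun z _ => ?_
    rw [hN', hNf, nOp_sub_flat_mulVec_apply, hχc]
    ring
  have hT2W := W_term_le hd hr1 hN y₀ K ψ (cfg U) hA hγ hS hMloc hK1' hK2' hgauge (fun z hz => hSψ z (by omega)) hM
  have hT2Q : ‖∑ z, K z * (((chi y₀ r z : ℝ) : ℂ) * (((a' : ℝ) : ℂ) * ((Qu *ᵥ ψ) z - (Q1 *ᵥ ψ) z)))‖ ≤
      (2 * (B1RG242Torus.α P a k * S)) * A * (1 + 2 * P.d * 3 ^ (P.d - 1) * (2 * r : ℕ)) := by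
    refine chi_weighted_sum_le hd hr1 y₀ K _ hA (by positivity) hK1' fun z hz => ?_
    have hblk : ∀ z', blkIter k z' = blkIter k z → ‖ψ z'‖ ≤ S := fun z' hz' => by
      refine hSψ z' ?_
      have h1 := supDist_le_of_blkIter_eq' hk hz'
      have h2 := BIJ85Ineq722Torus.supDist_triangle y₀ z z'
      rw [supDist_comm z z'] at h2
      omega
    have h1 := aQQ_norm_le hk hα.le U ψ z hblk
    have h2 := aQQ_norm_le hk hα.le (1 : GaugeField P 0 U1) ψ z hblk
    have ha'0 : 0 ≤ a' := by positivity
    rw [norm_mul, Complex.norm_real, Real.norm_of_nonneg ha'0]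
    calc a' * ‖(Qu *ᵥ ψ) z - (Q1 *ᵥ ψ) z‖ ≤ a' * (‖(Qu *ᵥ ψ) z‖ + ‖(Q1 *ᵥ ψ) z‖) :=
          mul_le_mul_of_nonneg_left (norm_sub_le _ _) ha'0
      _ ≤ 2 * (B1RG242Torus.α P a k * S) := by rw [mul_add]; linarith [h1, h2]
  have hT2 : ‖∑ z, K z * (χc z * ((N' - Nf) *ᵥ ψ) z)‖ ≤
      P.eps⁻¹ ^ 2 * (P.d * (2 * P.d * 3 ^ (P.d - 1) * (γ * (A * (Mloc + 2 ^ (P.d - 1) * S / r))) * (2 * r : ℕ) ^ 2 +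
        γ * (A * S) * (1 + 2 * P.d * 3 ^ (P.d - 1) * (2 * r : ℕ)))) +
      (2 * (B1RG242Torus.α P a k * S)) * A * (1 + 2 * P.d * 3 ^ (P.d - 1) * (2 * r : ℕ)) := by
    rw [hT2eq]
    refine (norm_add_le _ _).trans (add_le_add ?_ hT2Q)
    rw [norm_mul, norm_pow, Complex.norm_real, Real.norm_of_nonneg (inv_nonneg.2 hε.le)]
    exact mul_le_mul_of_nonneg_left hT2W (by positivity)
  -- (T3) the commutator term: Laplacian part and block part
  have hT3eq : ∑ z, ((diagonal χc * Nf - Nf * diagonal χc) *ᵥ K) z * ψ z =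
      ((P.eps⁻¹ : ℝ) : ℂ) ^ 2 * ∑ z : Balaban1983to89.Site P 0, (∑ μ : Fin P.d,
        ((((chi y₀ r (z.shift μ) : ℝ) : ℂ) - ((chi y₀ r z : ℝ) : ℂ)) * K (z.shift μ) +
          (((chi y₀ r (z.unshift μ) : ℝ) : ℂ) - ((chi y₀ r z : ℝ) : ℂ)) * K (z.unshift μ))) * ψ z +
      ∑ z : Balaban1983to89.Site P 0, (((a' : ℝ) : ℂ) *
        (((chi y₀ r z : ℝ) : ℂ) * (Q1 *ᵥ K) z - (Q1 *ᵥ fun w => ((chi y₀ r w : ℝ) : ℂ) * K w) z)) * ψ z := by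
    rw [mul_sum, ← sum_add_distrib]
    refine sum_congr rfl fun z _ => ?_
    rw [hNf, commutator_flat_apply, hχc]
    ring
  have hT3L := commLap_le hr hN y₀ K ψ hA hS hK1' hK2' (fun z hz => hSψ z (by omega))
  have hT3Q := commQ_le hd hk hα.le hr1 y₀ K ψ hA hS hK1' (fun z hz => hSψ z (by omega))
  have hT3 : ‖∑ z, ((diagonal χc * Nf - Nf * diagonal χc) *ᵥ K) z * ψ z‖ ≤
      P.eps⁻¹ ^ 2 * (P.d * (A * S * (8 * 9 ^ (P.d - 1) + 2 * 10 ^ P.d) / r)) +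
      B1RG242Torus.α P a k * S * (A * (1 + 2 * P.d * 3 ^ (P.d - 1) * (2 * r + P.L ^ k : ℕ)) +
        A * (1 + 2 * P.d * 3 ^ (P.d - 1) * (2 * r : ℕ))) := by
    rw [hT3eq]
    refine (norm_add_le _ _).trans (add_le_add ?_ hT3Q)
    rw [norm_mul, norm_pow, Complex.norm_real, Real.norm_of_nonneg (inv_nonneg.2 hε.le)]
    exact mul_le_mul_of_nonneg_left hT3L (by positivity)
  -- assembly
  have htot : ‖ψ (y₀.shift μ₀) - ψ y₀‖ ≤
      Floc * A * (1 + 2 * P.d * 3 ^ (P.d - 1) * (2 * r : ℕ)) +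
      (P.eps⁻¹ ^ 2 * (P.d * (2 * P.d * 3 ^ (P.d - 1) * (γ * (A * (Mloc + 2 ^ (P.d - 1) * S / r))) * (2 * r : ℕ) ^ 2 +
        γ * (A * S) * (1 + 2 * P.d * 3 ^ (P.d - 1) * (2 * r : ℕ)))) +
      (2 * (B1RG242Torus.α P a k * S)) * A * (1 + 2 * P.d * 3 ^ (P.d - 1) * (2 * r : ℕ))) +
      (P.eps⁻¹ ^ 2 * (P.d * (A * S * (8 * 9 ^ (P.d - 1) + 2 * 10 ^ P.d) / r)) +
      B1RG242Torus.α P a k * S * (A * (1 + 2 * P.d * 3 ^ (P.d - 1) * (2 * r + P.L ^ k : ℕ)) +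
        A * (1 + 2 * P.d * 3 ^ (P.d - 1) * (2 * r : ℕ)))) := by
    rw [rep]
    simp only [hχc] at hT1 hT2 hT3 ⊢
    exact ((norm_add_le _ _).trans (add_le_add ((norm_sub_le _ _).trans (add_le_add hT1 hT2)) hT3))
  -- simplify `ε⁻²·A = C_K` and compare coefficients
  have hεA : P.eps⁻¹ ^ 2 * A = C_K := by rw [hAdef]; field_simp
  push_cast at htot
  have hs₁P : 2 * (P.d : ℝ) * 3 ^ (P.d - 1) = s₁ := by rw [hs₁]
  -- each term against the common constant
  set C := C_K * (cF + cM + cγ + cr + cα) + 1 with hC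
  have pF := mul_nonneg hCK hcF0
  have pM := mul_nonneg hCK hcM0
  have pγ := mul_nonneg hCK hcγ0
  have pr := mul_nonneg hCK hcr0
  have pα := mul_nonneg hCK hcα0
  have hCexp : C = C_K * cF + C_K * cM + C_K * cγ + C_K * cr + C_K * cα + 1 := by rw [hC]; ring
  have icF : C_K * cF ≤ C := by rw [hCexp]; linarith
  have icM : C_K * cM ≤ C := by rw [hCexp]; linarith
  have icγ : C_K * cγ ≤ C := by rw [hCexp]; linarith
  have icr : C_K * cr ≤ C := by rw [hCexp]; linarith
  have icα : C_K * cα ≤ C := by rw [hCexp]; linarith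
  -- the five target quantities
  have tF : 0 ≤ Floc * P.eps ^ 2 * r := by positivity
  have tM : 0 ≤ γ * r ^ 2 * Mloc := by positivity
  have tγ : 0 ≤ γ * r * S := by positivity
  have tr : 0 ≤ S / r := by positivity
  have tα : 0 ≤ B1RG242Torus.α P a k * P.eps ^ 2 * (r + P.L ^ k) * S := by positivity
  have hr1' : (1 : ℝ) ≤ r := by exact_mod_cast hr1
  have hrne : (r : ℝ) ≠ 0 := hr0.ne'
  have hεne : P.eps ≠ 0 := hε.ne'
  have hdpos : (0 : ℝ) ≤ P.d := by positivity
  have hsn : 0 ≤ s₁ * (P.L : ℝ) ^ k := mul_nonneg hs₁0 hn.le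
  -- bound each block of `htot` by `coefficient × target`
  have b1 : Floc * A * (1 + 2 * P.d * 3 ^ (P.d - 1) * (2 * (r : ℝ))) ≤ (C_K * cF) * (Floc * P.eps ^ 2 * r) := by
    rw [hs₁P, hAdef, hcF]
    have hw : 0 ≤ Floc * (C_K * P.eps ^ 2) := by positivity
    have h1 : (1 : ℝ) + 2 * s₁ * r ≤ r + 2 * s₁ * r := by linarith
    calc Floc * (C_K * P.eps ^ 2) * (1 + s₁ * (2 * (r : ℝ))) = Floc * (C_K * P.eps ^ 2) * (1 + 2 * s₁ * r) := by ring
      _ ≤ Floc * (C_K * P.eps ^ 2) * (r + 2 * s₁ * r) := mul_le_mul_of_nonneg_left h1 hw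
      _ = C_K * (1 + 2 * s₁) * (Floc * P.eps ^ 2 * r) := by ring
  have b2 : P.eps⁻¹ ^ 2 * (P.d * (2 * P.d * 3 ^ (P.d - 1) * (γ * (A * (Mloc + 2 ^ (P.d - 1) * S / r))) * (2 * (r : ℝ)) ^ 2 +
        γ * (A * S) * (1 + 2 * P.d * 3 ^ (P.d - 1) * (2 * (r : ℝ))))) ≤
      (C_K * cM) * (γ * r ^ 2 * Mloc) + (C_K * cγ) * (γ * r * S) := by
    rw [hs₁P]
    have e1 : P.eps⁻¹ ^ 2 * (P.d * (s₁ * (γ * (A * (Mloc + 2 ^ (P.d - 1) * S / r))) * (2 * (r : ℝ)) ^ 2 +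
        γ * (A * S) * (1 + s₁ * (2 * (r : ℝ))))) =
        (P.eps⁻¹ ^ 2 * A) * (P.d * (4 * s₁) * (γ * r ^ 2 * Mloc) + P.d * (4 * s₁ * 2 ^ (P.d - 1)) * (γ * r * S) +
          P.d * (γ * S * (1 + 2 * s₁ * r))) := by
      field_simp
      ring
    rw [e1, hεA, hcM, hcγ]
    have key : γ * S * (1 + 2 * s₁ * r) ≤ (1 + 2 * s₁) * (γ * r * S) := by
      have h1 : γ * S * 1 ≤ γ * S * r := mul_le_mul_of_nonneg_left hr1' (by positivity)
      have e2 : (1 + 2 * s₁) * (γ * r * S) - γ * S * (1 + 2 * s₁ * r) = γ * S * r - γ * S * 1 := by ring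
      linarith
    have key2 := mul_le_mul_of_nonneg_left key (mul_nonneg hCK hdpos)
    linarith
  have b3 : 2 * (B1RG242Torus.α P a k * S) * A * (1 + 2 * P.d * 3 ^ (P.d - 1) * (2 * (r : ℝ))) ≤
      (C_K * (2 * (1 + 2 * s₁))) * (B1RG242Torus.α P a k * P.eps ^ 2 * (r + P.L ^ k) * S) := by
    rw [hs₁P, hAdef]
    have hw : 0 ≤ 2 * (B1RG242Torus.α P a k * S) * (C_K * P.eps ^ 2) := by positivity
    have h1 : (1 : ℝ) + s₁ * (2 * r) ≤ (1 + 2 * s₁) * (r + (P.L : ℝ) ^ k) := by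
      have e : (1 + 2 * s₁) * (r + (P.L : ℝ) ^ k) - (1 + s₁ * (2 * r)) = (r - 1) + (P.L : ℝ) ^ k + 2 * (s₁ * (P.L : ℝ) ^ k) := by ring
      linarith
    calc 2 * (B1RG242Torus.α P a k * S) * (C_K * P.eps ^ 2) * (1 + s₁ * (2 * (r : ℝ)))
        ≤ 2 * (B1RG242Torus.α P a k * S) * (C_K * P.eps ^ 2) * ((1 + 2 * s₁) * (r + (P.L : ℝ) ^ k)) :=
          mul_le_mul_of_nonneg_left h1 hw
      _ = _ := by ring
  have b4 : P.eps⁻¹ ^ 2 * (P.d * (A * S * (8 * 9 ^ (P.d - 1) + 2 * 10 ^ P.d) / (r : ℝ))) = (C_K * cr) * (S / r) := by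
    rw [hcr, ← hεA]; ring
  have b5 : B1RG242Torus.α P a k * S * (A * (1 + 2 * P.d * 3 ^ (P.d - 1) * (2 * (r : ℝ) + (P.L : ℝ) ^ k)) +
        A * (1 + 2 * P.d * 3 ^ (P.d - 1) * (2 * (r : ℝ)))) ≤
      (C_K * (2 + 4 * s₁)) * (B1RG242Torus.α P a k * P.eps ^ 2 * (r + P.L ^ k) * S) := by
    rw [hs₁P, hAdef]
    have hw : 0 ≤ B1RG242Torus.α P a k * S * (C_K * P.eps ^ 2) := by positivity
    have h1 : (1 + s₁ * (2 * (r : ℝ) + (P.L : ℝ) ^ k)) + (1 + s₁ * (2 * (r : ℝ))) ≤ (2 + 4 * s₁) * (r + (P.L : ℝ) ^ k) := by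
      have e : (2 + 4 * s₁) * (r + (P.L : ℝ) ^ k) - ((1 + s₁ * (2 * (r : ℝ) + (P.L : ℝ) ^ k)) + (1 + s₁ * (2 * (r : ℝ)))) =
          2 * (r - 1) + 2 * (P.L : ℝ) ^ k + 3 * (s₁ * (P.L : ℝ) ^ k) := by ring
      linarith
    calc B1RG242Torus.α P a k * S * (C_K * P.eps ^ 2 * (1 + s₁ * (2 * (r : ℝ) + (P.L : ℝ) ^ k)) +
          C_K * P.eps ^ 2 * (1 + s₁ * (2 * (r : ℝ))))
        = B1RG242Torus.α P a k * S * (C_K * P.eps ^ 2) * ((1 + s₁ * (2 * (r : ℝ) + (P.L : ℝ) ^ k)) + (1 + s₁ * (2 * (r : ℝ)))) := by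
          ring
      _ ≤ B1RG242Torus.α P a k * S * (C_K * P.eps ^ 2) * ((2 + 4 * s₁) * (r + (P.L : ℝ) ^ k)) := mul_le_mul_of_nonneg_left h1 hw
      _ = _ := by ring
  have hα35 : C_K * (2 * (1 + 2 * s₁)) + C_K * (2 + 4 * s₁) = C_K * cα := by rw [hcα]; ring
  calc ‖ψ (y₀.shift μ₀) - ψ y₀‖ ≤ _ := htot
    _ ≤ (C_K * cF) * (Floc * P.eps ^ 2 * r) + ((C_K * cM) * (γ * r ^ 2 * Mloc) + (C_K * cγ) * (γ * r * S)) +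
        (C_K * (2 * (1 + 2 * s₁))) * (B1RG242Torus.α P a k * P.eps ^ 2 * (r + P.L ^ k) * S) +
        (C_K * cr) * (S / r) + (C_K * (2 + 4 * s₁)) * (B1RG242Torus.α P a k * P.eps ^ 2 * (r + P.L ^ k) * S) := by
        rw [← b4]; linarith [b1, b2, b3, b5]
    _ = (C_K * cF) * (Floc * P.eps ^ 2 * r) + (C_K * cM) * (γ * r ^ 2 * Mloc) + (C_K * cγ) * (γ * r * S) +
        (C_K * cr) * (S / r) + (C_K * cα) * (B1RG242Torus.α P a k * P.eps ^ 2 * (r + P.L ^ k) * S) := by rw [← hα35]; ring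
    _ ≤ C * (Floc * P.eps ^ 2 * r) + C * (γ * r ^ 2 * Mloc) + C * (γ * r * S) + C * (S / r) +
        C * (B1RG242Torus.α P a k * P.eps ^ 2 * (r + P.L ^ k) * S) := by gcongr
    _ = C * (Floc * P.eps ^ 2 * r + γ * r ^ 2 * Mloc + γ * r * S + S / r +
          B1RG242Torus.α P a k * P.eps ^ 2 * (r + P.L ^ k) * S) := by ring

end Local


/-! ## §7 p. 326: the COVARIANT-DERIVATIVE member of [7] (1.10) for `G_k(u)` at small non-flat fields, `k`-uniform -/

section Main

variable {P : Params}

open BIJ85BlockAveragesTorus BIJ85BlockAveragesTorusK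
open BIJ88DeltaLoc234Torus (mulOp nOp_gaugeAct conjTranspose_mul_mulOp)

/-- kernel: **gauge transfer of the equation** — if `φ = G_k(u)f` then `ψ = hφ` solves `N(u^h)ψ = hf` ((2.7): `N(u^h) = M_hN(u)M_hᴴ`).
[cite: BalabanImbrieJaffe1985, (2.7) p.303] -/
theorem gauge_transfer {a' c : ℝ} {k : ℕ} (hk : 0 + k ≤ P.m + P.K) (hc : c ≠ 0) (ha' : 0 < a') (U : GaugeField P 0 U1)
    (h : GaugeTransf P 0 U1) (f : Balaban1983to89.Site P 0 → ℂ) :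
    nOp a' c (GaugeField.gaugeAct h U) k univ *ᵥ (fun z => toC (h z) * (gBox a' c U k univ *ᵥ f) z) = fun z => toC (h z) * f z := by
  have hG := (gBox_univ_mul hk hc ha' U).2
  have e1 : (fun z => toC (h z) * (gBox a' c U k univ *ᵥ f) z) = mulOp h *ᵥ (gBox a' c U k univ *ᵥ f) := by
    funext z; rw [mulOp, mulVec_diagonal]
  have e2 : (fun z => toC (h z) * f z) = mulOp h *ᵥ f := by funext z; rw [mulOp, mulVec_diagonal]
  rw [e1, e2, nOp_gaugeAct hk, mulVec_mulVec, mulVec_mulVec, Matrix.mul_assoc (mulOp h * nOp a' c U k univ), conjTranspose_mul_mulOp,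
    Matrix.mul_one, Matrix.mul_assoc (mulOp h), hG, Matrix.mul_one]

/-- kernel: **the bond variables of the gauge copy**: `u^h_b = h(b₋)u_b\overline{h(b₊)}`. [cite: BalabanImbrieJaffe1985, (2.7) p.303] -/
theorem cfg_gaugeAct_apply (h : GaugeTransf P 0 U1) (U : GaugeField P 0 U1) (b : PBond P 0) :
    cfg (GaugeField.gaugeAct h U) b = toC (h b.src) * cfg U b * conj (toC (h b.tgt)) := by
  show toC (h b.src * U b * (h b.tgt)⁻¹) = _
  rw [BIJ88Sect3Statements.toC_mul, BIJ88Sect3Statements.toC_mul, BIJ88Sect3Statements.toC_inv]; rfl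

/-- kernel: **covariant differences are gauge covariant in norm**: `|u^h_b(hφ)(b₊) − (hφ)(b₋)| = |u_bφ(b₊) − φ(b₋)|`.
[cite: BalabanImbrieJaffe1985, (2.7) p.303] -/
theorem norm_covDiff_gaugeAct (h : GaugeTransf P 0 U1) (U : GaugeField P 0 U1) (φ : Balaban1983to89.Site P 0 → ℂ)
    (z : Balaban1983to89.Site P 0) (μ : Fin P.d) :
    ‖cfg (GaugeField.gaugeAct h U) ⟨z, μ⟩ * (toC (h (z.shift μ)) * φ (z.shift μ)) - toC (h z) * φ z‖ =
      ‖cfg U ⟨z, μ⟩ * φ (z.shift μ) - φ z‖ := by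
  rw [cfg_gaugeAct_apply]
  have h1 : conj (toC (h (z.shift μ))) * toC (h (z.shift μ)) = 1 := conj_mul_toC _
  have e : toC (h z) * cfg U ⟨z, μ⟩ * conj (toC (h ((⟨z, μ⟩ : PBond P 0).tgt))) * (toC (h (z.shift μ)) * φ (z.shift μ)) - toC (h z) * φ z =
      toC (h z) * (cfg U ⟨z, μ⟩ * φ (z.shift μ) - φ z) := by
    show toC (h z) * cfg U ⟨z, μ⟩ * conj (toC (h (z.shift μ))) * (toC (h (z.shift μ)) * φ (z.shift μ)) - toC (h z) * φ z = _
    linear_combination (toC (h z) * cfg U ⟨z, μ⟩ * φ (z.shift μ)) * h1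
  rw [e, norm_mul, norm_toC, one_mul]

/-- kernel: the plaquette hypothesis of p. 326 in the `dist1` language of the torus carrier. [cite: BalabanImbrieJaffe1985, (7.3.1) p.326] -/
theorem dist1_plaqHol_le_of_plaqC (U : GaugeField P 0 U1) {θ : ℝ}
    (hθ : ∀ (y : Balaban1983to89.Site P 0) (μ ν : Fin P.d), ‖BIJ85AbelianStokes.plaqC U y μ ν - 1‖ ≤ θ) (p : Balaban1983to89.Plaq P 0) :
    dist1 (GaugeField.plaqHol U p) ≤ θ := by
  rw [BIJ88Smooth43Axial.dist1_eq_norm_toC_sub_one, ← BIJ85AbelianStokes.plaqC_eq_toC_plaqHol U p.src p.hμν]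
  exact hθ _ _ _

/-- kernel: the torus `T^{(0)}` has `2L^{m+K} ≥ 2L^k` sites per direction. [cite: Balaban1987RG1, (0.1) p.251] -/
theorem two_mul_pow_le_sitesPerDir {k : ℕ} (hk : k ≤ P.m + P.K) : 2 * P.L ^ k ≤ P.sitesPerDir 0 := by
  show 2 * P.L ^ k ≤ 2 * P.L ^ (P.m + P.K - 0)
  exact Nat.mul_le_mul_left 2 (Nat.pow_le_pow_right P.L_pos (by omega))

/-- kernel: `(d − 1)θ(L^k)² ≤ 1` under the block-scale smallness `2d³((L^k)²θ)² ≤ 1`. [cite: BalabanImbrieJaffe1985, (7.3.1) p.326] -/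
theorem gamma_nsq_le_one {θ n : ℝ} (hθ : 0 ≤ θ) (hd : 1 ≤ P.d) (hsmall : 2 * (P.d : ℝ) ^ 3 * (n ^ 2 * θ) ^ 2 ≤ 1) :
    ((P.d - 1 : ℕ) : ℝ) * θ * n ^ 2 ≤ 1 := by
  have hd1 : ((P.d - 1 : ℕ) : ℝ) = P.d - 1 := by rw [Nat.cast_sub hd, Nat.cast_one]
  have hD : (1 : ℝ) ≤ P.d := by exact_mod_cast hd
  have hx : 0 ≤ ((P.d - 1 : ℕ) : ℝ) * θ * n ^ 2 := by positivity
  -- `((d−1)θn²)² = (d−1)²(n²θ)² ≤ (d−1)²/(2d³) ≤ 1`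
  have h1 : (((P.d - 1 : ℕ) : ℝ) * θ * n ^ 2) ^ 2 ≤ 1 := by
    rw [hd1]
    have h2 : ((P.d : ℝ) - 1) ^ 2 ≤ 2 * (P.d : ℝ) ^ 3 := by nlinarith
    calc (((P.d : ℝ) - 1) * θ * n ^ 2) ^ 2 = ((P.d : ℝ) - 1) ^ 2 * (n ^ 2 * θ) ^ 2 := by ring
      _ ≤ 2 * (P.d : ℝ) ^ 3 * (n ^ 2 * θ) ^ 2 := mul_le_mul_of_nonneg_right h2 (sq_nonneg _)
      _ ≤ 1 := hsmall
  nlinarith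

set_option maxHeartbeats 400000 in
/-- **p. 326: THE SUP-NORM DECAY OF THE COVARIANT DERIVATIVE OF THE BLOCK PROPAGATOR `G_k(u)` AT SMALL NON-FLAT FIELDS, `k`-UNIFORM** —
the COVARIANT-DERIVATIVE member of [Balaban1983RegularityDecay] (1.10) *"|(D^η_{A,μ}G_k(Ω, A)f)(x)|, |(G_k(Ω, A)f)(x)| ≤ c₀exp(−δ₀ dist(x,
supp f))‖f‖_∞"* for [BalabanImbrieJaffe1985] p. 326 *"The propagators arising from Δ_k(u_k), under the restriction (7.3.1) on the gauge
field, also satisfy the regularity and decay estimates of [7]"*, for p31's torus propagator of record `G_k(T,u) = gBox (α_kL^{kd}) ε⁻¹ u k T`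
under the hypotheses of the VALUE member `BIJ85ScalarPropagatorSupDecay.decay110_smallField` (p27): for `2 ≤ d ≤ 3`, `L` odd `> 1`, `a > 0`
there are `t₀, c₀ > 0` (depending on `d, L, a` only) such that for every volume, every `1 ≤ k ≤ K`, every `U(1)` field with `|u(∂p) − 1| ≤ θ`,
`2d³(L^{2k}θ)² ≤ 1`, every bond `⟨x, x + e_μ⟩` and every `f` with `|f| ≤ F` vanishing at sup-distance `< D` from `x`:
`|(D_uG_k(T,u)f)(⟨x, x+e_μ⟩)| = ε⁻¹|u_{x,μ}(G_kf)(x+e_μ) − (G_kf)(x)| ≤ c₀(L^kε)e^{−t₀D/L^k}F` — ONE power of the block spacing `L^kε` where the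
value member has two.  Method (ours; the print defers to an extension of [7]'s random-walk proofs): the local interior gradient estimate of
§6 at every bond in the centre-rooted axial gauge of `BIJ85CentredAxialGauge` (`|u′ − 1| ≤ (d−1)|z−y|_∞θ`), fed with p27's value bound, and a
weighted maximum principle over the bonds of the torus absorbing the covariant-difference term (`(d−1)θL^{2k} ≤ 1`).
[cite: BalabanImbrieJaffe1985, (7.3.1) p.326; Balaban1983RegularityDecay, (1.10) p.573] -/
theorem decay110_smallField_deriv (d L : ℕ) (hd : 2 ≤ d) (hd3 : d ≤ 3) (hL : Odd L ∧ 1 < L) {a : ℝ} (ha : 0 < a) :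
    ∃ t₀ c₀ : ℝ, 0 < t₀ ∧ 0 < c₀ ∧ ∀ (P : Params), P.d = d → P.L = L →
      ∀ k : ℕ, 1 ≤ k → k ≤ P.K → ∀ (U : GaugeField P 0 U1) (θ : ℝ),
        (∀ (y : Balaban1983to89.Site P 0) (μ ν : Fin P.d), ‖BIJ85AbelianStokes.plaqC U y μ ν - 1‖ ≤ θ) →
        2 * (P.d : ℝ) ^ 3 * (((P.L : ℝ) ^ k) ^ 2 * θ) ^ 2 ≤ 1 →
        ∀ (x : Balaban1983to89.Site P 0) (μ : Fin P.d) (f : Balaban1983to89.Site P 0 → ℂ) (F D : ℝ),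
          (∀ z, ‖f z‖ ≤ F) → (∀ z, f z ≠ 0 → D ≤ (supDist x z : ℝ)) →
          ‖covD P.eps⁻¹ (cfg U) (gBox (B1RG242Torus.α P a k * (P.L : ℝ) ^ (k * P.d)) P.eps⁻¹ U k univ *ᵥ f) ⟨x, μ⟩‖
            ≤ c₀ * P.spacing k * Real.exp (-(t₀ * D / (P.L : ℝ) ^ k)) * F := by
  classical
  obtain ⟨t₁, c_v, ht₁, hc_v, hval⟩ := BIJ85ScalarPropagatorSupDecay.decay110_smallField d L (by omega) hd3 hL ha
  obtain ⟨C_K, hCK, hker⟩ := BIJ85FlatPropagatorKernelDiffs.flat_kernel_diffs d L hd hL ha (le_refl (0 : ℝ))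
  obtain ⟨C_L, hCL, hloc⟩ := local_gradient_bound d (by omega) C_K hCK.le
  -- the rate, the ball fraction and the constant
  set t : ℝ := min t₁ 1 with htdef
  have ht : 0 < t := lt_min ht₁ one_pos
  have ht1 : t ≤ 1 := min_le_right _ _
  have htt₁ : t ≤ t₁ := min_le_left _ _
  set e : ℝ := Real.exp 1 with hedef
  have he1 : 1 ≤ e := by rw [hedef]; exact Real.one_le_exp (by norm_num)
  have he0 : 0 < e := Real.exp_pos 1
  set c : ℝ := min (1 / 8) (1 / (2 * (C_L * e + 1))) with hcdef
  have hc0 : 0 < c := lt_min (by norm_num) (by positivity)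
  have hc8 : c ≤ 1 / 8 := min_le_left _ _
  have hc1 : c ≤ 1 := hc8.trans (by norm_num)
  have hcC : C_L * e * c ≤ 1 / 2 := by
    have h1 : c ≤ 1 / (2 * (C_L * e + 1)) := min_le_right _ _
    have h2 : 0 ≤ C_L * e := by positivity
    calc C_L * e * c ≤ C_L * e * (1 / (2 * (C_L * e + 1))) := mul_le_mul_of_nonneg_left h1 h2
      _ ≤ 1 / 2 := by rw [mul_one_div, div_le_iff₀ (by positivity)]; linarith
  set K₁ : ℝ := e * c + c_v * e ^ 3 * (c + 2 / c + 2 * a) with hK₁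
  have hK₁0 : 0 ≤ K₁ := by positivity
  refine ⟨t, 2 * C_L * K₁ + 8 * e * c_v / c + 1, ht, by positivity, ?_⟩
  intro P hPd hPL k hk1 hkK U θ hθ hsmall x μ f F D hF hsupp
  have hvalP := hval P hPd hPL k hk1 hkK U θ hθ hsmall
  have hkerP := hker P hPd hPL k hk1 hkK
  subst hPd
  -- basic quantities
  have hd1 : 1 ≤ P.d := by omega
  have hk : k ≤ P.m + P.K := hkK.trans (Nat.le_add_left _ _)
  have hk0 : 0 + k ≤ P.m + P.K := by omega
  have hLpos : (0 : ℝ) < P.L := P.cast_L_pos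
  have hL1 : (1 : ℝ) < P.L := B1RG242Torus.one_lt_cast_L P
  have hε : 0 < P.eps := P.eps_pos
  set n : ℝ := (P.L : ℝ) ^ k with hndef
  have hn : 0 < n := pow_pos hLpos k
  have hn1 : 1 ≤ n := one_le_pow₀ hL1.le
  have hsp : P.spacing k = n * P.eps := rfl
  have hsp0 : 0 < P.spacing k := P.spacing_pos k
  have hα : 0 < B1RG242Torus.α P a k := mul_pos (B1.aSeq_pos ha hL1 hk1) (inv_pos.2 (pow_pos hsp0 2))
  have hαa : B1RG242Torus.α P a k * P.spacing k ^ 2 ≤ a := by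
    show B1.aSeq a P.L k * (P.spacing k ^ 2)⁻¹ * P.spacing k ^ 2 ≤ a
    rw [inv_mul_cancel_right₀ (pow_ne_zero 2 hsp0.ne')]
    exact B1.aSeq_le ha hL1 k hk1
  set a' : ℝ := B1RG242Torus.α P a k * (P.L : ℝ) ^ (k * P.d) with ha'def
  have ha' : 0 < a' := mul_pos hα (pow_pos hLpos _)
  have hc' : P.eps⁻¹ ≠ 0 := inv_ne_zero hε.ne'
  have hθ0 : 0 ≤ θ := (norm_nonneg _).trans (hθ x μ μ)
  have hF0 : 0 ≤ F := (norm_nonneg _).trans (hF x)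
  set φ := gBox a' P.eps⁻¹ U k univ *ᵥ f with hφ
  set τ : ℝ := t / n with hτ
  have hτ0 : 0 < τ := div_pos ht hn
  have hexpD : ∀ {D₁ D₂ : ℝ}, D₂ ≤ D₁ → Real.exp (-(t * D₁ / n)) ≤ Real.exp (-(t * D₂ / n)) := fun h =>
    Real.exp_le_exp.2 (by rw [neg_le_neg_iff]; exact div_le_div_of_nonneg_right (mul_le_mul_of_nonneg_left h ht.le) hn.le)
  have hexp_t₁ : ∀ {D' : ℝ}, 0 ≤ D' → Real.exp (-(t₁ * D' / n)) ≤ Real.exp (-(t * D' / n)) := fun hD' =>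
    Real.exp_le_exp.2 (by rw [neg_le_neg_iff]; exact div_le_div_of_nonneg_right (mul_le_mul_of_nonneg_right htt₁ hD') hn.le)
  -- the target, spelled out
  have hgoal : ‖covD P.eps⁻¹ (cfg U) φ ⟨x, μ⟩‖ = P.eps⁻¹ * ‖cfg U ⟨x, μ⟩ * φ (x.shift μ) - φ x‖ := by
    show ‖((P.eps⁻¹ : ℝ) : ℂ) * (cfg U ⟨x, μ⟩ * φ (x.shift μ) - φ x)‖ = _
    rw [norm_mul, Complex.norm_real, Real.norm_of_nonneg (inv_nonneg.2 hε.le)]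
  rw [hgoal]
  have hc₀ : 2 * C_L * K₁ ≤ 2 * C_L * K₁ + 8 * e * c_v / c + 1 := by
    linarith [show (0 : ℝ) ≤ 8 * e * c_v / c by positivity]
  have hc₀' : 8 * e * c_v / c ≤ 2 * C_L * K₁ + 8 * e * c_v / c + 1 := by
    linarith [show (0 : ℝ) ≤ 2 * C_L * K₁ by positivity]
  -- the radius of the interior estimate
  set r : ℕ := ⌊c * n⌋₊ with hrdef
  have hrc : (r : ℝ) ≤ c * n := Nat.floor_le (by positivity)
  by_cases hr4 : r < 4
  · ----------------------------------------------------------------------------------------------------------------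
    -- SMALL CASE `cL^k < 4`: the trivial bound by two values of `φ`
    have hn4 : n < 4 / c := by
      have h1 : c * n < r + 1 := Nat.lt_floor_add_one _
      have h2 : (r : ℝ) + 1 ≤ 4 := by exact_mod_cast hr4
      rw [lt_div_iff₀ hc0]; linarith
    have hφx : ‖φ x‖ ≤ c_v * P.spacing k ^ 2 * Real.exp (-(t * D / n)) * F := by
      have h1 := hvalP x f F (max D 0) hF (fun z hz => max_le (hsupp z hz) (Nat.cast_nonneg _))
      refine h1.trans ?_
      have h2 : Real.exp (-(t₁ * max D 0 / n)) ≤ Real.exp (-(t * D / n)) := (hexp_t₁ (le_max_right _ _)).trans (hexpD (le_max_left _ _))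
      gcongr
    have hφx' : ‖φ (x.shift μ)‖ ≤ c_v * P.spacing k ^ 2 * (e * Real.exp (-(t * D / n))) * F := by
      have h1 := hvalP (x.shift μ) f F (max (D - 1) 0) hF (fun z hz => ?_)
      · refine h1.trans ?_
        have h2 : Real.exp (-(t₁ * max (D - 1) 0 / n)) ≤ e * Real.exp (-(t * D / n)) := by
          refine ((hexp_t₁ (le_max_right _ _)).trans (hexpD (le_max_left _ _))).trans ?_
          rw [hedef, ← Real.exp_add]
          refine Real.exp_le_exp.2 ?_
          rw [show -(t * (D - 1) / n) = -(t * D / n) + t / n by ring]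
          have : t / n ≤ 1 := by rw [div_le_one hn]; exact ht1.trans hn1
          linarith
        gcongr
      · have h3 := hsupp z hz
        have h4 : supDist x z ≤ supDist x (x.shift μ) + supDist (x.shift μ) z := BIJ85Ineq722Torus.supDist_triangle x (x.shift μ) z
        have h5 := supDist_shift_le_one' x μ
        have h6 : (supDist x z : ℝ) ≤ 1 + supDist (x.shift μ) z := by
          have : ((supDist x z : ℕ) : ℝ) ≤ ((supDist x (x.shift μ) + supDist (x.shift μ) z : ℕ) : ℝ) := by exact_mod_cast h4
          have h5' : ((supDist x (x.shift μ) : ℕ) : ℝ) ≤ 1 := by exact_mod_cast h5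
          push_cast at this; linarith
        exact max_le (by linarith) (Nat.cast_nonneg _)
    have hδ : ‖cfg U ⟨x, μ⟩ * φ (x.shift μ) - φ x‖ ≤ 2 * e * c_v * P.spacing k ^ 2 * Real.exp (-(t * D / n)) * F := by
      refine (norm_sub_le _ _).trans ?_
      rw [norm_mul, show ‖cfg U ⟨x, μ⟩‖ = 1 from norm_toC _, one_mul]
      have hE : 0 ≤ Real.exp (-(t * D / n)) := (Real.exp_pos _).le
      have h0 : 0 ≤ c_v * P.spacing k ^ 2 * Real.exp (-(t * D / n)) * F := by positivity
      have e1x : c_v * P.spacing k ^ 2 * Real.exp (-(t * D / n)) * F ≤ c_v * P.spacing k ^ 2 * (e * Real.exp (-(t * D / n))) * F := by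
        have : Real.exp (-(t * D / n)) ≤ e * Real.exp (-(t * D / n)) := le_mul_of_one_le_left hE he1
        gcongr
      linarith [hφx, hφx', e1x]
    calc P.eps⁻¹ * ‖cfg U ⟨x, μ⟩ * φ (x.shift μ) - φ x‖ ≤ P.eps⁻¹ * (2 * e * c_v * P.spacing k ^ 2 * Real.exp (-(t * D / n)) * F) :=
          mul_le_mul_of_nonneg_left hδ (inv_nonneg.2 hε.le)
      _ = (2 * e * c_v * n) * P.spacing k * Real.exp (-(t * D / n)) * F := by rw [hsp]; field_simp
      _ ≤ (8 * e * c_v / c) * P.spacing k * Real.exp (-(t * D / n)) * F := by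
          have : 2 * e * c_v * n ≤ 8 * e * c_v / c := by
            rw [show 8 * e * c_v / c = 2 * e * c_v * (4 / c) by ring]
            exact mul_le_mul_of_nonneg_left hn4.le (by positivity)
          gcongr
      _ ≤ _ := mul_le_mul_of_nonneg_right (mul_le_mul_of_nonneg_right (mul_le_mul_of_nonneg_right hc₀' hsp0.le)
          (Real.exp_pos _).le) hF0
  ----------------------------------------------------------------------------------------------------------------
  -- MAIN CASE `r = ⌊cL^k⌋ ≥ 4`
  push Not at hr4
  have hr1 : 1 ≤ r := by omega
  have hr0 : (0 : ℝ) < r := by exact_mod_cast (show 0 < r by omega)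
  have hcn4 : 4 ≤ c * n := le_trans (by exact_mod_cast hr4) hrc
  have hr2 : c * n / 2 ≤ r := by have h1 : c * n < r + 1 := Nat.lt_floor_add_one _; linarith
  have hrn : (r : ℝ) ≤ n / 8 := hrc.trans (by nlinarith)
  have hN : 4 * r + 6 ≤ P.sitesPerDir 0 := by
    have h1 := two_mul_pow_le_sitesPerDir (P := P) hk
    have h2 : 8 * (r : ℝ) ≤ (P.L ^ k : ℕ) := by push_cast; rw [← hndef]; linarith
    have h3 : 8 * r ≤ P.L ^ k := by exact_mod_cast h2
    omega
  -- the trivial sub-case `f = 0`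
  by_cases hf0 : ∀ z, f z = 0
  · have hφ0 : φ = 0 := by rw [hφ, show f = 0 from funext hf0, mulVec_zero]
    rw [hφ0]; simp only [Pi.zero_apply, mul_zero, sub_zero, norm_zero, mul_zero]
    positivity
  push Not at hf0
  -- the distance to the support and the weighted maximum over bonds
  set supp : Finset (Balaban1983to89.Site P 0) := univ.filter fun w => f w ≠ 0 with hsuppdef
  have hne : supp.Nonempty := by obtain ⟨w, hw⟩ := hf0; exact ⟨w, by rw [hsuppdef, mem_filter]; exact ⟨mem_univ _, hw⟩⟩
  have hmem : ∀ {w}, f w ≠ 0 → w ∈ supp := fun hw => by rw [hsuppdef, mem_filter]; exact ⟨mem_univ _, hw⟩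
  set Df : Balaban1983to89.Site P 0 → ℕ := fun z => supp.inf' hne fun w => supDist z w with hDf
  have hDf_le : ∀ z w, f w ≠ 0 → Df z ≤ supDist z w := fun z w hw => Finset.inf'_le _ (hmem hw)
  have hDf_ex : ∀ z, ∃ w, f w ≠ 0 ∧ Df z = supDist z w := fun z => by
    obtain ⟨w, hw, h⟩ := Finset.exists_mem_eq_inf' hne (fun w => supDist z w)
    rw [hsuppdef, mem_filter] at hw
    exact ⟨w, hw.2, h⟩
  -- `Df z ≥ Df y − |y − z|_∞`
  have hDf_tri : ∀ y z, Df y ≤ supDist y z + Df z := fun y z => by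
    obtain ⟨w, hw, h⟩ := hDf_ex z
    rw [h]
    exact (hDf_le y w hw).trans (BIJ85Ineq722Torus.supDist_triangle y z w)
  set g : PBond P 0 → ℝ := fun b => Real.exp (t * Df b.src / n) * ‖cfg U b * φ b.tgt - φ b.src‖ with hgdef
  obtain ⟨b₀, -, hb₀⟩ := exists_max_image (univ : Finset (PBond P 0)) g ⟨⟨x, μ⟩, mem_univ _⟩
  set M : ℝ := g b₀ with hMdef
  have hMb : ∀ b : PBond P 0, g b ≤ M := fun b => hb₀ b (mem_univ b)
  have hM0 : 0 ≤ M := le_trans (by positivity) (hMb ⟨x, μ⟩)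
  -- how the weighted maximum controls a covariant difference
  have hMuse : ∀ (z : Balaban1983to89.Site P 0) (ν : Fin P.d),
      ‖cfg U ⟨z, ν⟩ * φ (z.shift ν) - φ z‖ ≤ M * Real.exp (-(t * Df z / n)) := by
    intro z ν
    have h1 := hMb ⟨z, ν⟩
    simp only [hgdef] at h1
    have h2 : Real.exp (t * Df z / n) * Real.exp (-(t * Df z / n)) = 1 := by rw [← Real.exp_add, add_neg_cancel, Real.exp_zero]
    calc ‖cfg U ⟨z, ν⟩ * φ (z.shift ν) - φ z‖
        = (Real.exp (t * Df z / n) * ‖cfg U ⟨z, ν⟩ * φ (z.shift ν) - φ z‖) * Real.exp (-(t * Df z / n)) := by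
          rw [mul_comm (Real.exp _), mul_assoc, h2, mul_one]
      _ ≤ M * Real.exp (-(t * Df z / n)) := mul_le_mul_of_nonneg_right h1 (Real.exp_pos _).le
  ----------------------------------------------------------------------------------------------------------------
  -- THE ABSORPTION STEP at the maximal bond `b₀ = ⟨y₀, μ₀⟩`
  obtain ⟨y₀, μ₀⟩ := b₀
  set D₀ : ℝ := (Df y₀ : ℝ) with hD₀
  set E : ℝ := Real.exp (-(t * D₀ / n)) with hEdef
  have hE0 : 0 < E := Real.exp_pos _
  have hEinv : Real.exp (t * D₀ / n) * E = 1 := by rw [hEdef, ← Real.exp_add, add_neg_cancel, Real.exp_zero]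
  -- the local exponential slack factors
  have hslack1 : Real.exp (t * (2 * r) / n) ≤ e := by
    rw [hedef]; refine Real.exp_le_exp.2 ?_
    rw [div_le_one hn]
    have h1 : t * (2 * r) ≤ 1 * (2 * r) := mul_le_mul_of_nonneg_right ht1 (by positivity)
    linarith
  have hslack3 : Real.exp (t * (2 * r + n + 1) / n) ≤ e ^ 3 := by
    rw [hedef, ← Real.exp_nat_mul]; refine Real.exp_le_exp.2 ?_
    rw [div_le_iff₀ hn]
    have h1 : t * (2 * r + n + 1) ≤ 1 * (2 * r + n + 1) := mul_le_mul_of_nonneg_right ht1 (by positivity)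
    push_cast
    linarith
  -- the gauge
  set hg := BIJ85CentredAxialGauge.centredGauge U y₀ (2 * r) with hhg
  set U' := GaugeField.gaugeAct hg U with hU'
  set ψ : Balaban1983to89.Site P 0 → ℂ := fun z => toC (hg z) * φ z with hψdef
  set f' : Balaban1983to89.Site P 0 → ℂ := fun z => toC (hg z) * f z with hf'def
  have hψeq : nOp a' P.eps⁻¹ U' k univ *ᵥ ψ = f' := gauge_transfer hk0 hc' ha' U hg f
  have hnormψ : ∀ z, ‖ψ z‖ = ‖φ z‖ := fun z => by simp only [hψdef]; rw [norm_mul, norm_toC, one_mul]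
  have hnormf' : ∀ z, ‖f' z‖ = ‖f z‖ := fun z => by simp only [hf'def]; rw [norm_mul, norm_toC, one_mul]
  have hcov : ∀ z ν, ‖cfg U' ⟨z, ν⟩ * ψ (z.shift ν) - ψ z‖ = ‖cfg U ⟨z, ν⟩ * φ (z.shift ν) - φ z‖ := fun z ν =>
    norm_covDiff_gaugeAct hg U φ z ν
  set γ : ℝ := ((P.d - 1 : ℕ) : ℝ) * θ with hγdef
  have hγ0 : 0 ≤ γ := by positivity
  have hγn : γ * n ^ 2 ≤ 1 := gamma_nsq_le_one hθ0 hd1 hsmall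
  have hgauge : ∀ z ν, supDist y₀ z ≤ 2 * r → ‖cfg U' ⟨z, ν⟩ - 1‖ ≤ γ * supDist y₀ z := by
    intro z ν hz
    have hR : 2 * (2 * r) + 4 < P.sitesPerDir 0 := by omega
    have h1 := BIJ85CentredAxialGauge.dist1_centredGauge_le U hθ0 (dist1_plaqHol_le_of_plaqC U hθ) y₀ hR z hz ν
    rw [BIJ88Smooth43Axial.dist1_eq_norm_toC_sub_one] at h1
    calc ‖cfg U' ⟨z, ν⟩ - 1‖ = ‖toC (GaugeField.gaugeAct hg U ⟨z, ν⟩) - 1‖ := rfl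
      _ ≤ ((P.d - 1 : ℕ) : ℝ) * (supDist y₀ z : ℝ) * θ := h1
      _ = γ * supDist y₀ z := by rw [hγdef]; ring
  -- the local data
  set S : ℝ := c_v * P.spacing k ^ 2 * F * E * e ^ 3 with hSdef
  have hS0 : 0 ≤ S := by positivity
  have hSψ : ∀ z, supDist y₀ z ≤ 2 * r + P.L ^ k + 1 → ‖ψ z‖ ≤ S := by
    intro z hz
    rw [hnormψ]
    have hsup : ∀ w, f w ≠ 0 → max (D₀ - supDist y₀ z) 0 ≤ (supDist z w : ℝ) := fun w hw => by
      refine max_le ?_ (Nat.cast_nonneg _)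
      have h1 := (hDf_le y₀ w hw).trans (BIJ85Ineq722Torus.supDist_triangle y₀ z w)
      have : ((Df y₀ : ℕ) : ℝ) ≤ ((supDist y₀ z + supDist z w : ℕ) : ℝ) := by exact_mod_cast h1
      push_cast at this; rw [hD₀]; linarith
    refine (hvalP z f F _ hF hsup).trans ?_
    have h2 : Real.exp (-(t₁ * max (D₀ - supDist y₀ z) 0 / n)) ≤ E * e ^ 3 := by
      refine ((hexp_t₁ (le_max_right _ _)).trans (hexpD (le_max_left _ _))).trans ?_
      have hz' : (supDist y₀ z : ℝ) ≤ 2 * r + n + 1 := by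
        have : ((supDist y₀ z : ℕ) : ℝ) ≤ ((2 * r + P.L ^ k + 1 : ℕ) : ℝ) := by exact_mod_cast hz
        push_cast at this; rw [hndef]; exact this
      calc Real.exp (-(t * (D₀ - supDist y₀ z) / n)) = E * Real.exp (t * supDist y₀ z / n) := by
            rw [hEdef, ← Real.exp_add]; congr 1; ring
        _ ≤ E * Real.exp (t * (2 * r + n + 1) / n) := by
            refine mul_le_mul_of_nonneg_left (Real.exp_le_exp.2 ?_) hE0.le
            exact div_le_div_of_nonneg_right (mul_le_mul_of_nonneg_left hz' ht.le) hn.le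
        _ ≤ E * e ^ 3 := mul_le_mul_of_nonneg_left hslack3 hE0.le
    calc c_v * P.spacing k ^ 2 * Real.exp (-(t₁ * max (D₀ - ↑(supDist y₀ z)) 0 / n)) * F
        ≤ c_v * P.spacing k ^ 2 * (E * e ^ 3) * F := by gcongr
      _ = S := by rw [hSdef]; ring
  set Mloc : ℝ := M * E * e with hMlocdef
  have hMloc0 : 0 ≤ Mloc := by positivity
  have hMψ : ∀ z ν, supDist y₀ z ≤ 2 * r → ‖cfg U' ⟨z, ν⟩ * ψ (z.shift ν) - ψ z‖ ≤ Mloc := by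
    intro z ν hz
    rw [hcov]
    refine (hMuse z ν).trans ?_
    have h1 : Real.exp (-(t * Df z / n)) ≤ E * e := by
      have h2 : (D₀ - 2 * r : ℝ) ≤ Df z := by
        have := hDf_tri y₀ z
        have h3 : ((Df y₀ : ℕ) : ℝ) ≤ ((supDist y₀ z + Df z : ℕ) : ℝ) := by exact_mod_cast this
        have h4 : ((supDist y₀ z : ℕ) : ℝ) ≤ ((2 * r : ℕ) : ℝ) := by exact_mod_cast hz
        push_cast at h3 h4; rw [hD₀]; linarith
      refine (hexpD h2).trans ?_
      calc Real.exp (-(t * (D₀ - 2 * r) / n)) = E * Real.exp (t * (2 * r) / n) := by rw [hEdef, ← Real.exp_add]; congr 1; ring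
        _ ≤ E * e := mul_le_mul_of_nonneg_left hslack1 hE0.le
    calc M * Real.exp (-(t * Df z / n)) ≤ M * (E * e) := mul_le_mul_of_nonneg_left h1 hM0
      _ = Mloc := by rw [hMlocdef]; ring
  set Floc : ℝ := F * E * e with hFlocdef
  have hFloc0 : 0 ≤ Floc := by positivity
  have hFf' : ∀ z, supDist y₀ z ≤ 2 * r → ‖f' z‖ ≤ Floc := by
    intro z hz
    rw [hnormf']
    by_cases hfz : f z = 0
    · rw [hfz, norm_zero]; exact hFloc0
    · have h1 : D₀ ≤ 2 * r := by
        have := (hDf_le y₀ z hfz).trans hz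
        have h2 : ((Df y₀ : ℕ) : ℝ) ≤ ((2 * r : ℕ) : ℝ) := by exact_mod_cast this
        push_cast at h2; rw [hD₀]; exact h2
      have h2 : 1 ≤ E * e := by
        have h3 : Real.exp (-(t * (2 * r) / n)) ≤ E := hexpD h1
        have h4 : Real.exp (-(t * (2 * r) / n)) * Real.exp (t * (2 * r) / n) = 1 := by
          rw [← Real.exp_add, neg_add_cancel, Real.exp_zero]
        calc (1 : ℝ) = Real.exp (-(t * (2 * r) / n)) * Real.exp (t * (2 * r) / n) := h4.symm
          _ ≤ E * e := mul_le_mul h3 hslack1 (Real.exp_pos _).le hE0.le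
      calc ‖f z‖ ≤ F := hF z
        _ = F * 1 := (mul_one F).symm
        _ ≤ F * (E * e) := mul_le_mul_of_nonneg_left h2 hF0
        _ = Floc := by rw [hFlocdef]; ring
  -- THE LOCAL ESTIMATE
  have hmain := hloc P rfl ha hk1 hkK hr4 hN y₀ μ₀ U' ψ f' hψeq hγ0 hS0 hMloc0 hFloc0 (fun z => hkerP.1 μ₀ y₀ z)
    (fun ν z => hkerP.2 μ₀ ν y₀ z) hgauge hSψ hMψ hFf'
  -- its left-hand side is `M·E`
  have hLHS : ‖ψ (y₀.shift μ₀) - ψ y₀‖ = M * E := by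
    have hu1 : cfg U' ⟨y₀, μ₀⟩ = 1 := by
      have h1 := hgauge y₀ μ₀ (by rw [(supDist_eq_zero_iff y₀ y₀).2 rfl]; exact Nat.zero_le _)
      rw [(supDist_eq_zero_iff y₀ y₀).2 rfl, Nat.cast_zero, mul_zero] at h1
      exact sub_eq_zero.1 (norm_le_zero_iff.1 h1)
    have h2 : ‖ψ (y₀.shift μ₀) - ψ y₀‖ = ‖cfg U ⟨y₀, μ₀⟩ * φ (y₀.shift μ₀) - φ y₀‖ := by rw [← hcov, hu1, one_mul]
    rw [h2, hMdef, hgdef]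
    show _ = Real.exp (t * Df y₀ / n) * ‖cfg U ⟨y₀, μ₀⟩ * φ (y₀.shift μ₀) - φ y₀‖ * E
    rw [mul_comm (Real.exp _), mul_assoc, ← hD₀, hEinv, mul_one]
  rw [hLHS] at hmain
  -- `γ r² ≤ c²`, the contraction factor `κ = C_L e γ r² ≤ 1/2`
  have hγr : γ * (r : ℝ) ^ 2 ≤ c ^ 2 := by
    calc γ * (r : ℝ) ^ 2 ≤ γ * (c * n) ^ 2 := mul_le_mul_of_nonneg_left (pow_le_pow_left₀ hr0.le hrc 2) hγ0
      _ = c ^ 2 * (γ * n ^ 2) := by ring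
      _ ≤ c ^ 2 * 1 := mul_le_mul_of_nonneg_left hγn (sq_nonneg c)
      _ = c ^ 2 := mul_one _
  have hκ : C_L * (γ * (r : ℝ) ^ 2) * e ≤ 1 / 2 := by
    calc C_L * (γ * (r : ℝ) ^ 2) * e ≤ C_L * c ^ 2 * e := by gcongr
      _ = (C_L * e * c) * c := by ring
      _ ≤ (1 / 2) * 1 := mul_le_mul hcC hc1 hc0.le (by norm_num)
      _ = 1 / 2 := by norm_num
  -- divide the local estimate by `E` and absorb: `M ≤ 2·C_L·(F e ε² r + (γ r + 1/r + α ε²(r+n))·c_v (L^kε)² F e³)`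
  set A₁ : ℝ := C_L * (F * e * P.eps ^ 2 * r +
      (γ * r + 1 / r + B1RG242Torus.α P a k * P.eps ^ 2 * (r + n)) * (c_v * P.spacing k ^ 2 * F * e ^ 3)) with hA₁def
  have hA₁0 : 0 ≤ A₁ := by positivity
  have hM_le : M ≤ 2 * A₁ := by
    -- `M E ≤ C_L(Floc ε² r + γ r² Mloc + γ r S + S/r + α ε²(r+n) S)` with `Floc = F E e`, `Mloc = M E e`, `S = c_v sp² F E e³`
    have h1 : M * E ≤ E * (A₁ + (C_L * (γ * (r : ℝ) ^ 2) * e) * M) := by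
      refine hmain.trans (le_of_eq ?_)
      simp only [hA₁def, hFlocdef, hMlocdef, hSdef, hndef]
      ring
    have h2 : M ≤ A₁ + (C_L * (γ * (r : ℝ) ^ 2) * e) * M := le_of_mul_le_mul_right (by linarith [h1]) hE0
    have h3 : (C_L * (γ * (r : ℝ) ^ 2) * e) * M ≤ (1 / 2) * M := mul_le_mul_of_nonneg_right hκ hM0
    linarith
  -- `A₁ ≤ C_L K₁ · n ε² F`
  have hA₁le : A₁ ≤ C_L * K₁ * (n * P.eps ^ 2 * F) := by
    have hsp2 : P.spacing k ^ 2 = n ^ 2 * P.eps ^ 2 := by rw [hsp]; ring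
    have q1 : F * e * P.eps ^ 2 * r ≤ (e * c) * (n * P.eps ^ 2 * F) := by
      calc F * e * P.eps ^ 2 * r ≤ F * e * P.eps ^ 2 * (c * n) := mul_le_mul_of_nonneg_left hrc (by positivity)
        _ = (e * c) * (n * P.eps ^ 2 * F) := by ring
    have q2 : γ * r * (c_v * P.spacing k ^ 2 * F * e ^ 3) ≤ (c_v * e ^ 3 * c) * (n * P.eps ^ 2 * F) := by
      have h1 : γ * r * n ^ 2 ≤ c * n := by
        calc γ * r * n ^ 2 ≤ γ * (c * n) * n ^ 2 := by gcongr
          _ = c * n * (γ * n ^ 2) := by ring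
          _ ≤ c * n * 1 := mul_le_mul_of_nonneg_left hγn (by positivity)
          _ = c * n := mul_one _
      calc γ * r * (c_v * P.spacing k ^ 2 * F * e ^ 3) = (γ * r * n ^ 2) * (c_v * P.eps ^ 2 * F * e ^ 3) := by rw [hsp2]; ring
        _ ≤ (c * n) * (c_v * P.eps ^ 2 * F * e ^ 3) := mul_le_mul_of_nonneg_right h1 (by positivity)
        _ = (c_v * e ^ 3 * c) * (n * P.eps ^ 2 * F) := by ring
    have q3 : 1 / r * (c_v * P.spacing k ^ 2 * F * e ^ 3) ≤ (c_v * e ^ 3 * (2 / c)) * (n * P.eps ^ 2 * F) := by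
      have h1 : 1 / (r : ℝ) * n ^ 2 ≤ (2 / c) * n := by
        have h2 : n ≤ (2 / c) * r := by rw [div_mul_eq_mul_div, le_div_iff₀ hc0]; linarith [hr2]
        have h3 : n / r ≤ 2 / c := by rw [div_le_iff₀ hr0]; exact h2
        calc 1 / (r : ℝ) * n ^ 2 = (n / r) * n := by ring
          _ ≤ (2 / c) * n := mul_le_mul_of_nonneg_right h3 hn.le
      calc 1 / r * (c_v * P.spacing k ^ 2 * F * e ^ 3) = (1 / r * n ^ 2) * (c_v * P.eps ^ 2 * F * e ^ 3) := by rw [hsp2]; ring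
        _ ≤ ((2 / c) * n) * (c_v * P.eps ^ 2 * F * e ^ 3) := mul_le_mul_of_nonneg_right h1 (by positivity)
        _ = (c_v * e ^ 3 * (2 / c)) * (n * P.eps ^ 2 * F) := by ring
    have q4 : B1RG242Torus.α P a k * P.eps ^ 2 * (r + n) * (c_v * P.spacing k ^ 2 * F * e ^ 3) ≤
        (c_v * e ^ 3 * (2 * a)) * (n * P.eps ^ 2 * F) := by
      have h1 : (r : ℝ) + n ≤ 2 * n := by linarith [hrn, hn.le]
      calc B1RG242Torus.α P a k * P.eps ^ 2 * (r + n) * (c_v * P.spacing k ^ 2 * F * e ^ 3)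
          = (B1RG242Torus.α P a k * P.spacing k ^ 2) * (r + n) * (c_v * P.eps ^ 2 * F * e ^ 3) := by ring
        _ ≤ a * (2 * n) * (c_v * P.eps ^ 2 * F * e ^ 3) := by gcongr
        _ = (c_v * e ^ 3 * (2 * a)) * (n * P.eps ^ 2 * F) := by ring
    have hsum : F * e * P.eps ^ 2 * r + (γ * r + 1 / r + B1RG242Torus.α P a k * P.eps ^ 2 * (r + n)) * (c_v * P.spacing k ^ 2 * F * e ^ 3)
        ≤ K₁ * (n * P.eps ^ 2 * F) := by
      rw [hK₁]; linarith [q1, q2, q3, q4]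
    calc A₁ = C_L * _ := rfl
      _ ≤ C_L * (K₁ * (n * P.eps ^ 2 * F)) := mul_le_mul_of_nonneg_left hsum hCL.le
      _ = C_L * K₁ * (n * P.eps ^ 2 * F) := by ring
  -- conclusion at the bond `⟨x, μ⟩`
  have hDx : D ≤ (Df x : ℝ) := by
    obtain ⟨w, hw, h⟩ := hDf_ex x
    rw [h]; exact hsupp w hw
  have hδx : ‖cfg U ⟨x, μ⟩ * φ (x.shift μ) - φ x‖ ≤ (2 * C_L * K₁) * (n * P.eps ^ 2 * F) * Real.exp (-(t * D / n)) := by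
    refine (hMuse x μ).trans ?_
    have h1 : M ≤ (2 * C_L * K₁) * (n * P.eps ^ 2 * F) := by linarith [hM_le, hA₁le]
    exact mul_le_mul h1 (hexpD hDx) (Real.exp_pos _).le (by positivity)
  calc P.eps⁻¹ * ‖cfg U ⟨x, μ⟩ * φ (x.shift μ) - φ x‖ ≤ P.eps⁻¹ * ((2 * C_L * K₁) * (n * P.eps ^ 2 * F) * Real.exp (-(t * D / n))) :=
        mul_le_mul_of_nonneg_left hδx (inv_nonneg.2 hε.le)
    _ = (2 * C_L * K₁) * P.spacing k * Real.exp (-(t * D / n)) * F := by rw [hsp]; field_simp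
    _ ≤ _ := mul_le_mul_of_nonneg_right (mul_le_mul_of_nonneg_right (mul_le_mul_of_nonneg_right hc₀ hsp0.le)
        (Real.exp_pos _).le) hF0

/-- **THE SAME BOUND IN p31's (1.10) SHAPE** (distance `B5Ineq137Torus.T = |·−·|_∞`, rate `e^{−δ₀εD}`; `L^kε ≤ 1` for `k ≤ K`): the
covariant-derivative companion of `BIJ85ScalarPropagatorSupDecay.decay110_smallField_T`.
[cite: BalabanImbrieJaffe1985, (7.3.1) p.326; Balaban1983RegularityDecay, (1.10) p.573] -/
theorem decay110_smallField_deriv_T (d L : ℕ) (hd : 2 ≤ d) (hd3 : d ≤ 3) (hL : Odd L ∧ 1 < L) {a : ℝ} (ha : 0 < a) :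
    ∃ δ₀ c₀ : ℝ, 0 < δ₀ ∧ 0 < c₀ ∧ ∀ (P : Params), P.d = d → P.L = L →
      ∀ k : ℕ, 1 ≤ k → k ≤ P.K → ∀ (U : GaugeField P 0 U1) (θ : ℝ),
        (∀ (y : Balaban1983to89.Site P 0) (μ ν : Fin P.d), ‖BIJ85AbelianStokes.plaqC U y μ ν - 1‖ ≤ θ) →
        2 * (P.d : ℝ) ^ 3 * (((P.L : ℝ) ^ k) ^ 2 * θ) ^ 2 ≤ 1 →
        ∀ (x : Balaban1983to89.Site P 0) (μ : Fin P.d) (f : Balaban1983to89.Site P 0 → ℂ) (F D : ℝ),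
          (∀ z, ‖f z‖ ≤ F) → 0 ≤ D → (∀ z, f z ≠ 0 → D ≤ B5Ineq137Torus.T P 0 x z) →
          ‖covD P.eps⁻¹ (cfg U) (gBox (B1RG242Torus.α P a k * (P.L : ℝ) ^ (k * P.d)) P.eps⁻¹ U k univ *ᵥ f) ⟨x, μ⟩‖
            ≤ c₀ * Real.exp (-(δ₀ * (P.eps * D))) * F := by
  obtain ⟨t₀, c₀, ht₀, hc₀, hmain⟩ := decay110_smallField_deriv d L hd hd3 hL ha
  refine ⟨t₀, c₀, ht₀, hc₀, fun P hPd hPL k hk1 hkK U θ hθ hsmall x μ f F D hF hD hsupp => ?_⟩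
  have h := hmain P hPd hPL k hk1 hkK U θ hθ hsmall x μ f F D hF
    (fun z hz => by rw [← B3Bound323ZeroTorus.T_eq_supDist]; exact hsupp z hz)
  have hF0 : 0 ≤ F := (norm_nonneg _).trans (hF x)
  have hsp1 : (P.L : ℝ) ^ k * P.eps ≤ 1 := B3GkZeroTorusRescaled.spacing_le_one P hkK
  have hn : 0 < (P.L : ℝ) ^ k := pow_pos P.cast_L_pos k
  have hexp : Real.exp (-(t₀ * D / (P.L : ℝ) ^ k)) ≤ Real.exp (-(t₀ * (P.eps * D))) := by
    rw [Real.exp_le_exp, neg_le_neg_iff, le_div_iff₀ hn]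
    nlinarith [mul_nonneg ht₀.le hD, P.eps_pos.le]
  calc _ ≤ c₀ * P.spacing k * Real.exp (-(t₀ * D / (P.L : ℝ) ^ k)) * F := h
    _ ≤ c₀ * 1 * Real.exp (-(t₀ * (P.eps * D))) * F :=
        mul_le_mul_of_nonneg_right
          (mul_le_mul (mul_le_mul_of_nonneg_left hsp1 hc₀.le) hexp (Real.exp_pos _).le (by positivity)) hF0
    _ = c₀ * Real.exp (-(t₀ * (P.eps * D))) * F := by rw [mul_one]

/-- **KERNEL FORM**: `ε⁻¹|u_{x,μ}G_k(T,u)(x+e_μ,y) − G_k(T,u)(x,y)| ≤ c₀(L^kε)e^{−t₀|x−y|_∞/L^k}` at small non-flat fields, `k`-uniform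
(`2 ≤ d ≤ 3`). [cite: BalabanImbrieJaffe1985, (7.3.1) p.326; Balaban1983RegularityDecay, (1.10) p.573] -/
theorem decay110_smallField_deriv_kernel (d L : ℕ) (hd : 2 ≤ d) (hd3 : d ≤ 3) (hL : Odd L ∧ 1 < L) {a : ℝ} (ha : 0 < a) :
    ∃ t₀ c₀ : ℝ, 0 < t₀ ∧ 0 < c₀ ∧ ∀ (P : Params), P.d = d → P.L = L →
      ∀ k : ℕ, 1 ≤ k → k ≤ P.K → ∀ (U : GaugeField P 0 U1) (θ : ℝ),
        (∀ (y : Balaban1983to89.Site P 0) (μ ν : Fin P.d), ‖BIJ85AbelianStokes.plaqC U y μ ν - 1‖ ≤ θ) →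
        2 * (P.d : ℝ) ^ 3 * (((P.L : ℝ) ^ k) ^ 2 * θ) ^ 2 ≤ 1 →
        ∀ (x y : Balaban1983to89.Site P 0) (μ : Fin P.d),
          ‖covD P.eps⁻¹ (cfg U) (fun z => gBox (B1RG242Torus.α P a k * (P.L : ℝ) ^ (k * P.d)) P.eps⁻¹ U k univ z y) ⟨x, μ⟩‖
            ≤ c₀ * P.spacing k * Real.exp (-(t₀ * (supDist x y : ℝ) / (P.L : ℝ) ^ k)) := by
  obtain ⟨t₀, c₀, ht₀, hc₀, hmain⟩ := decay110_smallField_deriv d L hd hd3 hL ha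
  refine ⟨t₀, c₀, ht₀, hc₀, fun P hPd hPL k hk1 hkK U θ hθ hsmall x y μ => ?_⟩
  have h := hmain P hPd hPL k hk1 hkK U θ hθ hsmall x μ (Pi.single y 1) 1 (supDist x y : ℝ)
    (fun z => by by_cases hz : z = y <;> simp [hz]) (fun z hz => by
      by_cases hzy : z = y
      · rw [hzy]
      · exact absurd (by simp [hzy]) hz)
  have e : gBox (B1RG242Torus.α P a k * (P.L : ℝ) ^ (k * P.d)) P.eps⁻¹ U k univ *ᵥ Pi.single y 1 =
      fun z => gBox (B1RG242Torus.α P a k * (P.L : ℝ) ^ (k * P.d)) P.eps⁻¹ U k univ z y := by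
    funext z; rw [mulVec_single_one, col_apply]
  rwa [e, mul_one] at h

end Main

end

end Literature.MathematicalPhysics.QuantumFieldTheory.BalabanImbrieJaffe1984to88.BIJ85ScalarPropagatorSupDecayDeriv
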